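import Literature.AlgebraicGeometry.Shioda1982.HodgeQuadruplesSixPrime
import HarnessLib

/-!
# The pair-free Hodge `4`-multisets of level `12p` (`p ≥ 17` prime) in Chinese-remainder coordinates

Topic `Literature/AlgebraicGeometry/Shioda1982`; the level `m = 12p` of Shioda 1982, Lemma 1 / Prop. 4 (Q′) and Aoki–Shioda 1983,
Theorem (𝔅²ₘ) (ii) — after `2p, 4p, 6p, 2ʲp` the first level of the tree's series at which EXCEPTIONAL quadruples occur (`12 ∣ m`;
Shioda's table p. 727 and Meyer–Neutsch's Tabelle 1, row `N = 12`: the two orbits of `(1, 4, 9, 10)`, `(1, 6, 8, 9)`). THEOREM (no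
named fact, no `sorry`): **`classify_hodgeMultiset_twelvePrime`** — a pair-free Hodge `4`-multiset `s` over `ℤ/12p`, `p ≥ 17` prime
(`IsHodgeMultiset s`, Shioda's semigroup condition), is `{x, x + 6p, −2x, 6p}`, `{x, x + 6p, 2x + 6p, −4x}` or
`{x, x + 4p, x + 8p, −3x}` for some residue `x` (the values of Shioda's `αᵢ, βᵢ` with `m′ = 6p` and `γⱼ` with `m″ = 4p`), or
`{x, 4x, 9x, 10x}`, `{x, 6x, 8x, 9x}` with `x = t·p`, `t ∈ {1, 5, 7, 11}` (the `8` multiples by `p` of the unit orbits of the two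
exceptional quadruples of level `12`) [cite: Shioda1982PicardFermat, §4 Lemma 1 p. 728, Prop. 4 (Q′) p. 729, table p. 727];
[cite: AokiShioda1983, §2 Theorem (𝔅²ₘ) (ii) a)–c)]; [cite: MeyerNeutsch1981Fermatquadrupel, Tabelle 1 p. 54 (N = 12)]. Also public:
the transfer `isHodgeMultiset_transfer_twelvePrime` (level `12p → 6p`).

## The proof (ours — Koblitz–Ogus in Chinese-remainder coordinates plus the transfer to level `6p`; NOT the printed argument)

(1) RELATIONS. Koblitz–Ogus in the tree's proved form `KoblitzOgus.hodge_eq_combination` [cite: Deligne1982HodgeCycles, Rem. 7.16 (a)]: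
the multiplicity function of a Hodge multiset is a `ℚ`-combination of reflection vectors and distribution vectors `D_{M,z}`, `M ∣ 12p`.
Identify `ℤ/12p ≅ ℤ/12 × ℤ/p` (`crt`, `pt`) and write `ĝ(e, c) = g(e, c) − g(−e, −c)`; three odd functionals kill every `D_{M,z}`
(`LU_koD`, `LIII_koD`, `LIV_koD`, divisor by divisor): (U) `ĝ(1,c) − ĝ(5,c) − ĝ(7,c) + ĝ(11,c) = 0` for `c ≠ 0` (`χ₄χ₃`-weighted
units); (III) `Γ₄(c) = U₄(c) + U₄(3c) − 2T₄(3c)` is constant on `c ≠ 0` (`U₄ = ĝ1 + ĝ5 − ĝ7 − ĝ11`, `T₄(c) = ĝ(9,c) − ĝ(3,c)`);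
(IV) `Γ₃(c) = U₃(c) + U₃(2c) − 2E₃(2c) − 2E₃(4c) + 2Q₃(4c)` is constant on `c ≠ 0` (`U₃ = ĝ1 − ĝ5 + ĝ7 − ĝ11`,
`E₃(c) = ĝ(10,c) − ĝ(2,c)`, `Q₃(c) = ĝ(4,c) − ĝ(8,c)`) — elementary shadows of the relations of the odd characters `χψ` in Aoki's
criterion [cite: Aoki1983, Prop. 2.2]. On the multiset of coordinates these are `Rels` (`rels_of_isHodgeMultiset`), evaluated on
explicit multisets through the tables of `χ₄, χ₃` (`cLU_cons`, …; `decide`d table lemmas); four consequences are used: `period_two` (an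
odd two-element configuration `{x, y}` off the fibre `pℤ/12p` satisfying U, III has `y = x + 6p`), `delta_not_rels`
(`{v, v + 2p, v − 2p, −3v}` violates U/III), `halfpair_odd` (`{u₁, 6p − u₁, u₃, 6p − u₃}`, all odd, violates U/III) and `even_pair`
(IV forces the even members `pt(f, c), pt(f′, −c)` next to two odd members in `pℤ/12p` into `f, f′ ∈ {0, 6}`). Only `i·c ≠ j·c` in
`ℤ/p` for `c ≠ 0`, `|i|, |j| ≤ 8` is used (`kb_ne`), whence `p ≥ 17`.
(2) TRANSFER. For a unit `u` of `ℤ/12p` also `u(1 + 6p)` is one; adding the two norm equations shows that `T(s)` = (odd members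
mod `6p`) + 2·((even members)/2 mod `6p`) is a Hodge multiset of level `6p` (`isHodgeMultiset_transfer_twelvePrime`, the analogue of
`isHodgeMultiset_transfer_fourPrime`), to which the tree's `classify_hodgeMultiset_sixPrime` applies.
(3) CASES by the number of odd members (even, since `Σ = 0`). All members in `pℤ/12p`: the norm equations at the units `pt(u, 1)`
make `s/p` a pair-free Hodge quadruple of level `12`, and those (`16` multisets: types α, β, γ and the two exceptional orbits) are
enumerated by the kernel (`level_twelve_pairfree`, `decide` over `(ℤ/12)³`) — `fibre_zero`. No odd member: `T(s) = 2σ` with `σ` a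
pair-free Hodge quadruple of level `6p`; double back (`case_all_even`). Two odd members `x, y`: if one is off `pℤ`, then `y = x + 6p`
and `{x̄, ẑ, ŵ, 3p}` is a Hodge quadruple of level `6p` — a pair in it means `s = α_x`, otherwise it is `A_y` with `y ∈ {x̄, x̄ + 3p}`
and `s = β_x` (`case_two_odd`); both in `pℤ` is impossible (`case_two_odd_fibre`: the unit `pt(1, −1)` would give `y = −x`). Four odd
members: `s̄ = s mod 6p` has odd members, so it is `C_y` if pair-free, and the four lifts of `C_y` with `Σ = 0` are `γ_u` or a
`δ`-quadruple (excluded); if `s̄` has a pair, `halfpair_odd` (`case_all_odd`).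
Numerical companions (cell `pub-hfermat`, outside Lean): `code/lit/picard/rel12p.py` (U, III, IV annihilate every `D_{M,z}` at
`m = 60, 84, 132, 156, 204`) and `code/lit/picard/table_vs_12p.py` (brute force at `m = 204, 228`: the indecomposable Hodge quadruples
are exactly `α` (`100`/`112`) + `β` (`98`/`110`) + `γ` (`66`/`74`) + `ε` (`8`), `|𝔍²ₘ| = 384p − 72`; Shioda's rank formula (9) checked
against the table of `H²·²`-ranks for `p = 17, 19, 23`).

HONEST FRAMING (cell `pub-hfermat`): explicit algebraic cycles for specific Hodge classes on Fermat/Delsarte varieties; residual open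
instances listed; no claim on general Hodge. (This file reproduces a printed structure theorem; the proof route is this formalisation's.)
-/

namespace Literature.AlgebraicGeometry.Shioda1982

open Finset Multiset
open Literature.AlgebraicGeometry.HodgeTheory Literature.AlgebraicGeometry.HodgeTheory.FermatCharacter

section TwelvePrime

variable {p : ℕ}

set_option linter.unusedSimpArgs false -- uniform simp sets across the case analyses of §§5–7 (as in `HodgeQuadruplesSixPrime`)

/-! ### `ℤ/12p ≅ ℤ/12 × ℤ/p`: Chinese-remainder coordinates -/

/-- `(12, p) = 1` for a prime `p ≥ 5`. [folklore] -/
private theorem coprime_twelve (hp : p.Prime) (h5 : 5 ≤ p) : Nat.Coprime 12 p := by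
  have h2 : Nat.Coprime 2 p := (Nat.coprime_primes Nat.prime_two hp).2 (by omega)
  have h3 : Nat.Coprime 3 p := (Nat.coprime_primes Nat.prime_three hp).2 (by omega)
  have h4 : Nat.Coprime 4 p := Nat.Coprime.mul_left h2 h2
  exact Nat.Coprime.mul_left h4 h3

/-- The Chinese-remainder isomorphism `ℤ/12p ≃+* ℤ/12 × ℤ/p`. [folklore] -/
private def crt (h : Nat.Coprime 12 p) : ZMod (12 * p) ≃+* ZMod 12 × ZMod p := ZMod.chineseRemainder h

/-- The residue with coordinates `(e, b)`. [folklore] -/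
private def pt (h : Nat.Coprime 12 p) (e : ZMod 12) (b : ZMod p) : ZMod (12 * p) := (crt h).symm (e, b)

/-- First coordinate = residue mod `12`. [folklore] -/
private theorem crt_fst (h : Nat.Coprime 12 p) [NeZero (12 * p)] (w : ZMod (12 * p)) :
    (crt h w).1 = (w.val : ZMod 12) := by
  conv_lhs => rw [← ZMod.natCast_zmod_val w]
  rw [map_natCast, Prod.fst_natCast]

/-- Second coordinate = residue mod `p`. [folklore] -/
private theorem crt_snd (h : Nat.Coprime 12 p) [NeZero (12 * p)] (w : ZMod (12 * p)) :
    (crt h w).2 = (w.val : ZMod p) := by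
  conv_lhs => rw [← ZMod.natCast_zmod_val w]
  rw [map_natCast, Prod.snd_natCast]

/-- `crt (pt e b) = (e, b)`. [folklore] -/
private theorem crt_pt (h : Nat.Coprime 12 p) (e : ZMod 12) (b : ZMod p) : crt h (pt h e b) = (e, b) :=
  (crt h).apply_symm_apply (e, b)

/-- `pt (crt w) = w`. [folklore] -/
private theorem pt_crt (h : Nat.Coprime 12 p) (w : ZMod (12 * p)) : pt h (crt h w).1 (crt h w).2 = w :=
  (crt h).symm_apply_apply w

/-- `pt` is injective. [folklore] -/
private theorem pt_inj (h : Nat.Coprime 12 p) {e e' : ZMod 12} {b b' : ZMod p} :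
    pt h e b = pt h e' b' ↔ e = e' ∧ b = b' := by
  rw [pt, pt, (crt h).symm.injective.eq_iff, Prod.mk.injEq]

/-- `pt` is additive. [folklore] -/
private theorem pt_add (h : Nat.Coprime 12 p) (e e' : ZMod 12) (b b' : ZMod p) :
    pt h e b + pt h e' b' = pt h (e + e') (b + b') := by
  rw [pt, pt, pt, ← (crt h).symm.map_add, Prod.mk_add_mk]

/-- `pt` is multiplicative. [folklore] -/
private theorem pt_mul (h : Nat.Coprime 12 p) (e e' : ZMod 12) (b b' : ZMod p) :
    pt h e b * pt h e' b' = pt h (e * e') (b * b') := by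
  rw [pt, pt, pt, ← (crt h).symm.map_mul, Prod.mk_mul_mk]

/-- `pt` and negation. [folklore] -/
private theorem neg_pt (h : Nat.Coprime 12 p) (e : ZMod 12) (b : ZMod p) : -pt h e b = pt h (-e) (-b) := by
  rw [pt, pt, ← (crt h).symm.map_neg, Prod.neg_mk]

/-- `pt` and subtraction. [folklore] -/
private theorem pt_sub (h : Nat.Coprime 12 p) (e e' : ZMod 12) (b b' : ZMod p) :
    pt h e b - pt h e' b' = pt h (e - e') (b - b') := by
  rw [sub_eq_add_neg, neg_pt, pt_add, ← sub_eq_add_neg, ← sub_eq_add_neg]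

/-- `pt` and natural multiples. [folklore] -/
private theorem natCast_mul_pt (h : Nat.Coprime 12 p) (k : ℕ) (e : ZMod 12) (b : ZMod p) :
    (k : ZMod (12 * p)) * pt h e b = pt h (k * e) (k * b) := by
  rw [pt, pt, ← nsmul_eq_mul, ← _root_.map_nsmul, Prod.smul_mk, nsmul_eq_mul, nsmul_eq_mul]

/-- `⟨pt e b⟩ mod 12` is `⟨e⟩`. [folklore] -/
private theorem val_pt_mod_twelve (h : Nat.Coprime 12 p) [NeZero (12 * p)] (e : ZMod 12) (b : ZMod p) :
    (pt h e b).val % 12 = e.val := by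
  have := crt_fst h (pt h e b)
  rw [crt_pt] at this
  have h2 := congrArg ZMod.val this
  rw [ZMod.val_natCast] at h2
  exact h2.symm

/-- `⟨pt e b⟩ mod 2` is `⟨e⟩ mod 2`. [folklore] -/
private theorem val_pt_mod_two (h : Nat.Coprime 12 p) [NeZero (12 * p)] (e : ZMod 12) (b : ZMod p) :
    (pt h e b).val % 2 = e.val % 2 := by
  rw [← Nat.mod_mod_of_dvd _ (by norm_num : 2 ∣ 12), val_pt_mod_twelve]

/-- `⟨pt e b⟩ mod p` is `⟨b⟩`. [folklore] -/
private theorem val_pt_mod_p (h : Nat.Coprime 12 p) [NeZero (12 * p)] [NeZero p] (e : ZMod 12) (b : ZMod p) :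
    (pt h e b).val % p = b.val := by
  have := crt_snd h (pt h e b)
  rw [crt_pt] at this
  have h2 := congrArg ZMod.val this
  rw [ZMod.val_natCast] at h2
  exact h2.symm

/-- The prime `p` as a residue mod `12`. -/
local notation "π" => ((p : ℕ) : ZMod 12)

/-- `crt p = (p mod 12, 0)`. [folklore] -/
private theorem crt_P (h : Nat.Coprime 12 p) [NeZero (12 * p)] : crt h (p : ZMod (12 * p)) = (π, 0) := by
  rw [Prod.ext_iff, crt_fst, crt_snd, ZMod.val_natCast]
  have hp12 : p % (12 * p) = p := Nat.mod_eq_of_lt (by have := NeZero.ne (12 * p); omega)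
  rw [hp12]
  exact ⟨rfl, ZMod.natCast_self p⟩

/-- `p = pt (p mod 12) 0`. [folklore] -/
private theorem P_eq_pt (h : Nat.Coprime 12 p) [NeZero (12 * p)] : (p : ZMod (12 * p)) = pt h π 0 := by
  rw [← pt_crt h (p : ZMod (12 * p)), crt_P]

/-- `p mod 12 ∈ {1, 5, 7, 11}` for a prime `p ≥ 5`. [folklore] -/
private theorem pi_eq (hp : p.Prime) (h5 : 5 ≤ p) : π = 1 ∨ π = 5 ∨ π = 7 ∨ π = 11 := by
  have h2 : ¬ 2 ∣ p := fun h ↦ by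
    have := (Nat.prime_dvd_prime_iff_eq Nat.prime_two hp).1 h; omega
  have h3 : ¬ 3 ∣ p := fun h ↦ by
    have := (Nat.prime_dvd_prime_iff_eq Nat.prime_three hp).1 h; omega
  have h12 : p % 12 = 1 ∨ p % 12 = 5 ∨ p % 12 = 7 ∨ p % 12 = 11 := by omega
  rw [← ZMod.natCast_mod p 12]
  rcases h12 with h12 | h12 | h12 | h12 <;> rw [h12]
  · exact Or.inl rfl
  · exact Or.inr (Or.inl rfl)
  · exact Or.inr (Or.inr (Or.inl rfl))
  · exact Or.inr (Or.inr (Or.inr rfl))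

/-- `π² = 1`, `6π = 6` in `ℤ/12` (`π ∈ {1, 5, 7, 11}`). [folklore] -/
private theorem pi_facts (hp : p.Prime) (h5 : 5 ≤ p) : π * π = 1 ∧ (6 : ZMod 12) * π = 6 := by
  rcases pi_eq hp h5 with h | h | h | h <;> rw [h] <;> decide

/-- `k·p = pt (kπ) 0`. [folklore] -/
private theorem natCast_mul_P (h : Nat.Coprime 12 p) [NeZero (12 * p)] (k : ℕ) :
    ((k * p : ℕ) : ZMod (12 * p)) = pt h (k * π) 0 := by
  rw [Nat.cast_mul, P_eq_pt h, natCast_mul_pt, mul_zero]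

/-- `6p = pt 6 0`. [folklore] -/
private theorem sixP_eq_pt (h : Nat.Coprime 12 p) [NeZero (12 * p)] (hp : p.Prime) (h5 : 5 ≤ p) :
    ((6 * p : ℕ) : ZMod (12 * p)) = pt h 6 0 := by
  rw [natCast_mul_P h, Nat.cast_ofNat, (pi_facts hp h5).2]

/-! ### The Koblitz–Ogus distribution vectors in Chinese-remainder coordinates -/

/-- The Koblitz–Ogus distribution vector of level `M ∣ 12p` through `z` (as in `KoblitzOgus.hodge_eq_combination`):
`w ↦ [w ≡ z (mod M)] − [(12p/M)·z = w]`. [cite: Deligne1982HodgeCycles, Rem. 7.16 (a)] -/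
private def koD (N : ℕ) (M : ℕ) (z w : ZMod N) : ℚ :=
  (if w.val % M = z.val % M then (1 : ℚ) else 0) - (if ((N / M : ℕ) : ZMod N) * z = w then 1 else 0)

/-- The divisors of `12p`. [folklore] -/
private theorem eq_of_dvd_twelve_mul_prime (hp : p.Prime) (h5 : 5 ≤ p) {M : ℕ} (hM : M ∣ 12 * p) :
    M = 1 ∨ M = 2 ∨ M = 3 ∨ M = 4 ∨ M = 6 ∨ M = 12 ∨
      M = p ∨ M = 2 * p ∨ M = 3 * p ∨ M = 4 * p ∨ M = 6 * p ∨ M = 12 * p := by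
  obtain ⟨a, b, ha, hb, rfl⟩ := (Nat.dvd_mul.1 hM)
  have ha' : a = 1 ∨ a = 2 ∨ a = 3 ∨ a = 4 ∨ a = 6 ∨ a = 12 := by
    have := Nat.le_of_dvd (by norm_num) ha
    interval_cases a <;> simp_all
  rcases (Nat.dvd_prime hp).1 hb with rfl | rfl <;> rcases ha' with rfl | rfl | rfl | rfl | rfl | rfl <;> simp

/-- Congruence mod `12` in coordinates. [folklore] -/
private theorem mod_twelve_iff (h : Nat.Coprime 12 p) [NeZero (12 * p)] (w z : ZMod (12 * p)) :
    w.val % 12 = z.val % 12 ↔ (crt h w).1 = (crt h z).1 := by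
  rw [crt_fst, crt_fst, ZMod.natCast_eq_natCast_iff']

/-- Congruence mod `p` in coordinates. [folklore] -/
private theorem mod_p_iff (h : Nat.Coprime 12 p) [NeZero (12 * p)] (w z : ZMod (12 * p)) :
    w.val % p = z.val % p ↔ (crt h w).2 = (crt h z).2 := by
  rw [crt_snd, crt_snd, ZMod.natCast_eq_natCast_iff']

/-- Congruence mod a divisor `k` of `12` in coordinates. [folklore] -/
private theorem mod_dvd_twelve_iff (h : Nat.Coprime 12 p) [NeZero (12 * p)] {k : ℕ} (hk : k ∣ 12)
    (w z : ZMod (12 * p)) : w.val % k = z.val % k ↔ (crt h w).1.val % k = (crt h z).1.val % k := by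
  rw [crt_fst, crt_fst, ZMod.val_natCast, ZMod.val_natCast, Nat.mod_mod_of_dvd _ hk, Nat.mod_mod_of_dvd _ hk]

/-- Congruence mod `k·p`, `k ∣ 12`, in coordinates. [folklore] -/
private theorem mod_dvd_twelve_mul_iff (h : Nat.Coprime 12 p) [NeZero (12 * p)] {k : ℕ} (hk : k ∣ 12)
    (w z : ZMod (12 * p)) :
    w.val % (k * p) = z.val % (k * p) ↔ (crt h w).1.val % k = (crt h z).1.val % k ∧ (crt h w).2 = (crt h z).2 := by
  have hkp : Nat.Coprime k p := Nat.Coprime.coprime_dvd_left hk h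
  rw [← mod_dvd_twelve_iff h hk, ← mod_p_iff]
  exact (Nat.modEq_and_modEq_iff_modEq_mul hkp).symm

/-- A multiple of `z = pt e b` in coordinates. [folklore] -/
private theorem natCast_mul_eq_pt_iff (h : Nat.Coprime 12 p) (k : ℕ) (ez e : ZMod 12) (bz c : ZMod p) :
    (k : ZMod (12 * p)) * pt h ez bz = pt h e c ↔ (k : ZMod 12) * ez = e ∧ (k : ZMod p) * bz = c := by
  rw [natCast_mul_pt, pt_inj]

/-- Cancellation by `2, 3, 4` in `ℤ/p`, `p ≥ 5` prime, in the orientations used below. [folklore] -/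
private theorem cancel_facts (hp : p.Prime) (h5 : 5 ≤ p) (c x : ZMod p) :
    (2 * x = 2 * c ↔ c = x) ∧ (2 * x = -(2 * c) ↔ -c = x) ∧
    (3 * x = 3 * c ↔ c = x) ∧ (3 * x = -(3 * c) ↔ -c = x) ∧
    (4 * x = 4 * c ↔ c = x) ∧ (4 * x = -(4 * c) ↔ -c = x) ∧
    (2 * x = 4 * c ↔ 2 * c = x) ∧ (2 * x = -(4 * c) ↔ -(2 * c) = x) := by
  haveI := Fact.mk hp
  have h2 : (2 : ZMod p) ≠ 0 := by
    intro h0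
    have := (ZMod.natCast_eq_zero_iff 2 p).1 (by exact_mod_cast h0)
    exact absurd (Nat.le_of_dvd (by norm_num) this) (by omega)
  have h3 : (3 : ZMod p) ≠ 0 := by
    intro h0
    have := (ZMod.natCast_eq_zero_iff 3 p).1 (by exact_mod_cast h0)
    exact absurd (Nat.le_of_dvd (by norm_num) this) (by omega)
  have h4 : (4 : ZMod p) ≠ 0 := by
    rw [show (4 : ZMod p) = 2 * 2 by norm_num]; exact mul_ne_zero h2 h2
  have key : ∀ {k : ZMod p}, k ≠ 0 → ∀ u : ZMod p, (k * x = k * u ↔ u = x) := fun hk u ↦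
    ⟨fun e ↦ (mul_left_cancel₀ hk e).symm, fun e ↦ by rw [e]⟩
  refine ⟨key h2 c, ?_, key h3 c, ?_, key h4 c, ?_, ?_, ?_⟩
  · rw [show -(2 * c) = 2 * (-c) by ring]; exact key h2 _
  · rw [show -(3 * c) = 3 * (-c) by ring]; exact key h3 _
  · rw [show -(4 * c) = 4 * (-c) by ring]; exact key h4 _
  · rw [show (4 : ZMod p) * c = 2 * (2 * c) by ring]; exact key h2 _
  · rw [show -(4 * c) = 2 * (-(2 * c)) by ring]; exact key h2 _

/-- Small multiples of a non-zero residue are distinct: `i b ≠ j b` for `i ≠ j`, `|i|, |j| ≤ 8`, `p ≥ 17`. [folklore] -/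
private theorem kb_ne (hp : p.Prime) (h17 : 17 ≤ p) {b : ZMod p} (hb : b ≠ 0) {i j : ℤ} (hij : i ≠ j) (hi : |i| ≤ 8)
    (hj : |j| ≤ 8) : (i : ZMod p) * b ≠ (j : ZMod p) * b := by
  haveI := Fact.mk hp
  intro h
  have h1 : ((i - j : ℤ) : ZMod p) * b = 0 := by push_cast; linear_combination h
  rcases mul_eq_zero.1 h1 with h2 | h2
  · rw [ZMod.intCast_zmod_eq_zero_iff_dvd] at h2
    have h3 : (p : ℤ) ∣ |i - j| := (dvd_abs _ _).2 h2
    have h4 : |i - j| ≤ 16 := by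
      have := abs_sub i j; omega
    have h5 : 0 < |i - j| := abs_pos.2 (sub_ne_zero.2 hij)
    have := Int.le_of_dvd h5 h3
    omega
  · exact hb h2

/-- `k b ≠ 0` for `b ≠ 0` and `1 ≤ k ≤ 16 < p`. [folklore] -/
private theorem natCast_mul_ne_zero (hp : p.Prime) (h17 : 17 ≤ p) {b : ZMod p} (hb : b ≠ 0) {k : ℕ} (hk0 : 0 < k)
    (hk : k ≤ 16) : (k : ZMod p) * b ≠ 0 := by
  haveI := Fact.mk hp
  intro h
  rcases mul_eq_zero.1 h with h2 | h2
  · rw [ZMod.natCast_eq_zero_iff] at h2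
    have := Nat.le_of_dvd hk0 h2
    omega
  · exact hb h2

/-- `2b, 3b, 4b, 6b, 12b ≠ 0` for `b ≠ 0` in `ℤ/p`, `p ≥ 17`. [folklore] -/
private theorem mul_ne_zero_facts (hp : p.Prime) (h17 : 17 ≤ p) {b : ZMod p} (hb : b ≠ 0) :
    (2 * b ≠ 0) ∧ (3 * b ≠ 0) ∧ (4 * b ≠ 0) ∧ (6 * b ≠ 0) ∧ (12 * b ≠ 0) := by
  refine ⟨?_, ?_, ?_, ?_, ?_⟩
  · exact_mod_cast natCast_mul_ne_zero hp h17 hb (k := 2) (by norm_num) (by norm_num)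
  · exact_mod_cast natCast_mul_ne_zero hp h17 hb (k := 3) (by norm_num) (by norm_num)
  · exact_mod_cast natCast_mul_ne_zero hp h17 hb (k := 4) (by norm_num) (by norm_num)
  · exact_mod_cast natCast_mul_ne_zero hp h17 hb (k := 6) (by norm_num) (by norm_num)
  · exact_mod_cast natCast_mul_ne_zero hp h17 hb (k := 12) (by norm_num) (by norm_num)

/-! ### The three Koblitz–Ogus functionals of level `12p` -/

/-- `ĝ(w) = g(w) − g(−w)`: twice the odd part. [folklore] -/
private def hat (g : ZMod (12 * p) → ℚ) (w : ZMod (12 * p)) : ℚ := g w - g (-w)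

/-- The `χ₄χ₃`-weighted unit part of the fibre `c`: `ĝ(1,c) − ĝ(5,c) − ĝ(7,c) + ĝ(11,c)`. [folklore] -/
private def LU (h : Nat.Coprime 12 p) (g : ZMod (12 * p) → ℚ) (c : ZMod p) : ℚ :=
  hat g (pt h 1 c) - hat g (pt h 5 c) - hat g (pt h 7 c) + hat g (pt h 11 c)

/-- The `χ₄`-weighted unit part of the fibre `c`: `ĝ(1,c) + ĝ(5,c) − ĝ(7,c) − ĝ(11,c)`. [folklore] -/
private def U4 (h : Nat.Coprime 12 p) (g : ZMod (12 * p) → ℚ) (c : ZMod p) : ℚ :=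
  hat g (pt h 1 c) + hat g (pt h 5 c) - hat g (pt h 7 c) - hat g (pt h 11 c)

/-- The `χ₄`-weighted odd-multiple-of-`3` part of the fibre `c`: `ĝ(9,c) − ĝ(3,c)`. [folklore] -/
private def T4 (h : Nat.Coprime 12 p) (g : ZMod (12 * p) → ℚ) (c : ZMod p) : ℚ :=
  hat g (pt h 9 c) - hat g (pt h 3 c)

/-- `Γ₄(c) = U₄(c) + U₄(3c) − 2T₄(3c)`. [folklore] -/
private def Gam4 (h : Nat.Coprime 12 p) (g : ZMod (12 * p) → ℚ) (c : ZMod p) : ℚ :=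
  U4 h g c + U4 h g (3 * c) - 2 * T4 h g (3 * c)

/-- **The `χ₄ψ`-functional** `L_III(c, c′) = Γ₄(c) − Γ₄(c′)` (even characters `ψ ≠ 1` of `(ℤ/p)ˣ`). [folklore] -/
private def LIII (h : Nat.Coprime 12 p) (g : ZMod (12 * p) → ℚ) (c c' : ZMod p) : ℚ := Gam4 h g c - Gam4 h g c'

/-- The `χ₃`-weighted unit part of the fibre `c`: `ĝ(1,c) − ĝ(5,c) + ĝ(7,c) − ĝ(11,c)`. [folklore] -/
private def U3 (h : Nat.Coprime 12 p) (g : ZMod (12 * p) → ℚ) (c : ZMod p) : ℚ :=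
  hat g (pt h 1 c) - hat g (pt h 5 c) + hat g (pt h 7 c) - hat g (pt h 11 c)

/-- The `χ₃`-weighted `2 mod 4` part of the fibre `c`: `ĝ(10,c) − ĝ(2,c)`. [folklore] -/
private def E3 (h : Nat.Coprime 12 p) (g : ZMod (12 * p) → ℚ) (c : ZMod p) : ℚ :=
  hat g (pt h 10 c) - hat g (pt h 2 c)

/-- The `χ₃`-weighted `0 mod 4` part of the fibre `c`: `ĝ(4,c) − ĝ(8,c)`. [folklore] -/
private def Q3 (h : Nat.Coprime 12 p) (g : ZMod (12 * p) → ℚ) (c : ZMod p) : ℚ :=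
  hat g (pt h 4 c) - hat g (pt h 8 c)

/-- `Γ₃(c) = U₃(c) + U₃(2c) − 2E₃(2c) − 2E₃(4c) + 2Q₃(4c)`. [folklore] -/
private def Gam3 (h : Nat.Coprime 12 p) (g : ZMod (12 * p) → ℚ) (c : ZMod p) : ℚ :=
  U3 h g c + U3 h g (2 * c) - 2 * E3 h g (2 * c) - 2 * E3 h g (4 * c) + 2 * Q3 h g (4 * c)

/-- **The `χ₃ψ`-functional** `L_IV(c, c′) = Γ₃(c) − Γ₃(c′)` (even characters `ψ ≠ 1` of `(ℤ/p)ˣ`). [folklore] -/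
private def LIV (h : Nat.Coprime 12 p) (g : ZMod (12 * p) → ℚ) (c c' : ZMod p) : ℚ := Gam3 h g c - Gam3 h g c'

/-- `ĝ` is additive. [folklore] -/
private theorem hat_add (g g' : ZMod (12 * p) → ℚ) (w : ZMod (12 * p)) :
    hat (fun z ↦ g z + g' z) w = hat g w + hat g' w := by
  simp only [hat]; ring

/-- `ĝ` is homogeneous. [folklore] -/
private theorem hat_smul (a : ℚ) (g : ZMod (12 * p) → ℚ) (w : ZMod (12 * p)) :
    hat (fun z ↦ a * g z) w = a * hat g w := by
  simp only [hat]; ring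

/-- `ĝ` commutes with sums. [folklore] -/
private theorem hat_sum {ι : Type} (t : Finset ι) (g : ι → ZMod (12 * p) → ℚ) (w : ZMod (12 * p)) :
    hat (fun z ↦ ∑ i ∈ t, g i z) w = ∑ i ∈ t, hat (g i) w := by
  simp only [hat, Finset.sum_sub_distrib]

/-- `ĝ = 0` for negation-invariant `g`. [folklore] -/
private theorem hat_even {g : ZMod (12 * p) → ℚ} (hg : ∀ z, g (-z) = g z) (w : ZMod (12 * p)) : hat g w = 0 := by
  simp only [hat, hg, sub_self]

/-- `L_U` is linear and kills negation-invariant functions. [folklore] -/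
private theorem LU_linear (h : Nat.Coprime 12 p) (c : ZMod p) :
    (∀ g g' : ZMod (12 * p) → ℚ, LU h (fun z ↦ g z + g' z) c = LU h g c + LU h g' c) ∧
    (∀ (a : ℚ) (g : ZMod (12 * p) → ℚ), LU h (fun z ↦ a * g z) c = a * LU h g c) ∧
    (∀ {ι : Type} (t : Finset ι) (g : ι → ZMod (12 * p) → ℚ), LU h (fun z ↦ ∑ i ∈ t, g i z) c = ∑ i ∈ t, LU h (g i) c) ∧
    (∀ g : ZMod (12 * p) → ℚ, (∀ z, g (-z) = g z) → LU h g c = 0) := by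
  refine ⟨fun g g' ↦ ?_, fun a g ↦ ?_, fun t g ↦ ?_, fun g hg ↦ ?_⟩
  · simp only [LU, hat_add]; ring
  · simp only [LU, hat_smul]; ring
  · simp only [LU, hat_sum, ← Finset.sum_add_distrib, ← Finset.sum_sub_distrib]
  · simp only [LU, hat_even hg]; ring

/-- `L_III` is linear and kills negation-invariant functions. [folklore] -/
private theorem LIII_linear (h : Nat.Coprime 12 p) (c c' : ZMod p) :
    (∀ g g' : ZMod (12 * p) → ℚ, LIII h (fun z ↦ g z + g' z) c c' = LIII h g c c' + LIII h g' c c') ∧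
    (∀ (a : ℚ) (g : ZMod (12 * p) → ℚ), LIII h (fun z ↦ a * g z) c c' = a * LIII h g c c') ∧
    (∀ {ι : Type} (t : Finset ι) (g : ι → ZMod (12 * p) → ℚ),
      LIII h (fun z ↦ ∑ i ∈ t, g i z) c c' = ∑ i ∈ t, LIII h (g i) c c') ∧
    (∀ g : ZMod (12 * p) → ℚ, (∀ z, g (-z) = g z) → LIII h g c c' = 0) := by
  refine ⟨fun g g' ↦ ?_, fun a g ↦ ?_, fun t g ↦ ?_, fun g hg ↦ ?_⟩
  · simp only [LIII, Gam4, U4, T4, hat_add]; ring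
  · simp only [LIII, Gam4, U4, T4, hat_smul]; ring
  · simp only [LIII, Gam4, U4, T4, hat_sum, Finset.mul_sum, ← Finset.sum_add_distrib, ← Finset.sum_sub_distrib]
  · simp only [LIII, Gam4, U4, T4, hat_even hg]; ring

/-- `L_IV` is linear and kills negation-invariant functions. [folklore] -/
private theorem LIV_linear (h : Nat.Coprime 12 p) (c c' : ZMod p) :
    (∀ g g' : ZMod (12 * p) → ℚ, LIV h (fun z ↦ g z + g' z) c c' = LIV h g c c' + LIV h g' c c') ∧
    (∀ (a : ℚ) (g : ZMod (12 * p) → ℚ), LIV h (fun z ↦ a * g z) c c' = a * LIV h g c c') ∧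
    (∀ {ι : Type} (t : Finset ι) (g : ι → ZMod (12 * p) → ℚ),
      LIV h (fun z ↦ ∑ i ∈ t, g i z) c c' = ∑ i ∈ t, LIV h (g i) c c') ∧
    (∀ g : ZMod (12 * p) → ℚ, (∀ z, g (-z) = g z) → LIV h g c c' = 0) := by
  refine ⟨fun g g' ↦ ?_, fun a g ↦ ?_, fun t g ↦ ?_, fun g hg ↦ ?_⟩
  · simp only [LIV, Gam3, U3, E3, Q3, hat_add]; ring
  · simp only [LIV, Gam3, U3, E3, Q3, hat_smul]; ring
  · simp only [LIV, Gam3, U3, E3, Q3, hat_sum, Finset.mul_sum, ← Finset.sum_add_distrib, ← Finset.sum_sub_distrib]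
  · simp only [LIV, Gam3, U3, E3, Q3, hat_even hg]; ring

/-! ### The functionals kill every distribution vector -/

/-- `pt 0 0 = 0`. [folklore] -/
private theorem pt_zero (h : Nat.Coprime 12 p) : pt h 0 0 = 0 := by
  show (crt h).symm (0, 0) = 0
  exact map_zero (crt h).symm

/-- A point with non-zero second coordinate is not of the form `pt e 0`. [folklore] -/
private theorem pt_ne_pt_zero (h : Nat.Coprime 12 p) {c : ZMod p} (hc : c ≠ 0) (e e' : ZMod 12) :
    pt h e' 0 ≠ pt h e c := fun eq ↦ hc ((pt_inj h).1 eq).2.symm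

/-- `ĝ` of a distribution vector at a coordinate point, unfolded. [folklore] -/
private theorem hat_koD (h : Nat.Coprime 12 p) (M : ℕ) (z : ZMod (12 * p)) (e : ZMod 12) (c : ZMod p) :
    hat (koD (12 * p) M z) (pt h e c) =
      ((if (pt h e c).val % M = z.val % M then (1 : ℚ) else 0) -
        (if (pt h (-e) (-c)).val % M = z.val % M then (1 : ℚ) else 0)) -
      ((if ((12 * p / M : ℕ) : ZMod (12 * p)) * z = pt h e c then (1 : ℚ) else 0) -
        (if ((12 * p / M : ℕ) : ZMod (12 * p)) * z = pt h (-e) (-c) then (1 : ℚ) else 0)) := by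
  simp only [hat, koD, neg_pt]
  ring

/-- The distribution vector of level `12p` is zero. [folklore] -/
private theorem koD_top [NeZero (12 * p)] (z w : ZMod (12 * p)) : koD (12 * p) (12 * p) z w = 0 := by
  have h0 : (12 * p) ≠ 0 := NeZero.ne _
  simp only [koD, Nat.mod_eq_of_lt (ZMod.val_lt _), Nat.div_self (Nat.pos_of_ne_zero h0), Nat.cast_one, one_mul]
  by_cases hw : w = z
  · rw [if_pos (by rw [hw]), if_pos hw.symm, sub_self]
  · rw [if_neg (fun e ↦ hw (ZMod.val_injective _ e)), if_neg (fun e ↦ hw e.symm), sub_self]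

/-- Level `k ∣ 12`: `ĝ(e, c) = [e ≡ e_z (k)] − [−e ≡ e_z (k)]` off the fibre `0`. [folklore] -/
private theorem hat_koD_dvd_twelve (h : Nat.Coprime 12 p) [NeZero (12 * p)] {k : ℕ} (hk : k ∣ 12) (hk0 : 0 < k)
    (ez e : ZMod 12) {bz c : ZMod p} (hc : c ≠ 0) : hat (koD (12 * p) k (pt h ez bz)) (pt h e c) =
      (if e.val % k = ez.val % k then (1 : ℚ) else 0) - (if (-e).val % k = ez.val % k then (1 : ℚ) else 0) := by
  rw [hat_koD]
  obtain ⟨j, hj⟩ := hk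
  have hjk : (12 * p / k : ℕ) = j * p := by
    rw [hj, mul_assoc]; exact Nat.mul_div_cancel_left _ hk0
  have hP : ((j * p : ℕ) : ZMod p) = 0 := by rw [Nat.cast_mul, ZMod.natCast_self, mul_zero]
  have n1 : ((j * p : ℕ) : ZMod (12 * p)) * pt h ez bz ≠ pt h e c := by
    rw [natCast_mul_pt, hP, zero_mul]; exact pt_ne_pt_zero h hc _ _
  have n2 : ((j * p : ℕ) : ZMod (12 * p)) * pt h ez bz ≠ pt h (-e) (-c) := by
    rw [natCast_mul_pt, hP, zero_mul]; exact pt_ne_pt_zero h (neg_ne_zero.2 hc) _ _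
  rw [hjk, if_neg n1, if_neg n2]
  simp only [mod_dvd_twelve_iff h ⟨j, hj⟩, crt_pt, sub_zero]

/-- Level `p`: `ĝ(e, c) = [c = b_z] − [−c = b_z] − [0 = e, 12b_z = c] + [0 = −e, 12b_z = −c]`. [folklore] -/
private theorem hat_koD_P (h : Nat.Coprime 12 p) [NeZero (12 * p)] (hp : p.Prime) (ez e : ZMod 12) (bz c : ZMod p) :
    hat (koD (12 * p) p (pt h ez bz)) (pt h e c) =
      ((if c = bz then (1 : ℚ) else 0) - (if -c = bz then (1 : ℚ) else 0)) -
      ((if 0 = e ∧ 12 * bz = c then (1 : ℚ) else 0) - (if 0 = -e ∧ 12 * bz = -c then (1 : ℚ) else 0)) := by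
  rw [hat_koD]
  have h12 : (12 * p / p : ℕ) = 12 := Nat.mul_div_cancel 12 hp.pos
  have h120 : (12 : ZMod 12) * ez = 0 := by rw [show (12 : ZMod 12) = 0 by decide, zero_mul]
  rw [h12]
  simp only [natCast_mul_eq_pt_iff]
  simp only [mod_p_iff h, crt_pt, Nat.cast_ofNat, h120]

/-- Level `k·p`, `k ∣ 12`, `12 = j·k`: `ĝ(e, c) = [e ≡ e_z (k), c = b_z] − [−e ≡ e_z (k), −c = b_z] − [j e_z = e, j b_z = c]
 + [j e_z = −e, j b_z = −c]`. [folklore] -/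
private theorem hat_koD_mulP (h : Nat.Coprime 12 p) [NeZero (12 * p)] (hp : p.Prime) {k j : ℕ} (hjk : 12 = j * k)
    (ez e : ZMod 12) (bz c : ZMod p) :
    hat (koD (12 * p) (k * p) (pt h ez bz)) (pt h e c) =
      ((if e.val % k = ez.val % k ∧ c = bz then (1 : ℚ) else 0) -
        (if (-e).val % k = ez.val % k ∧ -c = bz then (1 : ℚ) else 0)) -
      ((if (j : ZMod 12) * ez = e ∧ (j : ZMod p) * bz = c then (1 : ℚ) else 0) -
        (if (j : ZMod 12) * ez = -e ∧ (j : ZMod p) * bz = -c then (1 : ℚ) else 0)) := by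
  rw [hat_koD]
  have hk0 : 0 < k := Nat.pos_of_ne_zero fun h0 ↦ by rw [h0, mul_zero] at hjk; exact absurd hjk (by norm_num)
  have hj : (12 * p / (k * p) : ℕ) = j := by
    rw [hjk, show j * k * p = j * (k * p) by ring]; exact Nat.mul_div_cancel j (Nat.mul_pos hk0 hp.pos)
  rw [hj]
  simp only [natCast_mul_eq_pt_iff]
  simp only [mod_dvd_twelve_mul_iff h ⟨j, by rw [hjk, mul_comm]⟩, crt_pt]

/-- **`L_U` kills every distribution vector.** [folklore] -/
private theorem LU_koD (h : Nat.Coprime 12 p) [NeZero (12 * p)] (hp : p.Prime) (h17 : 17 ≤ p) {M : ℕ}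
    (hM : M ∈ (12 * p).divisors) (z : ZMod (12 * p)) {c : ZMod p} (hc : c ≠ 0) : LU h (koD (12 * p) M z) c = 0 := by
  have h5 : 5 ≤ p := by omega
  obtain ⟨ez, bz, rfl⟩ : ∃ ez bz, z = pt h ez bz := ⟨_, _, (pt_crt h z).symm⟩
  rcases eq_of_dvd_twelve_mul_prime hp h5 (Nat.dvd_of_mem_divisors hM) with
    rfl | rfl | rfl | rfl | rfl | rfl | rfl | rfl | rfl | rfl | rfl | hM12
  · simp only [LU, hat_koD_dvd_twelve h (by norm_num : 1 ∣ 12) (by norm_num) _ _ hc]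
    fin_cases ez <;> simp +decide
  · simp only [LU, hat_koD_dvd_twelve h (by norm_num : 2 ∣ 12) (by norm_num) _ _ hc]
    fin_cases ez <;> simp +decide
  · simp only [LU, hat_koD_dvd_twelve h (by norm_num : 3 ∣ 12) (by norm_num) _ _ hc]
    fin_cases ez <;> simp +decide
  · simp only [LU, hat_koD_dvd_twelve h (by norm_num : 4 ∣ 12) (by norm_num) _ _ hc]
    fin_cases ez <;> simp +decide
  · simp only [LU, hat_koD_dvd_twelve h (by norm_num : 6 ∣ 12) (by norm_num) _ _ hc]
    fin_cases ez <;> simp +decide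
  · simp only [LU, hat_koD_dvd_twelve h (by norm_num : 12 ∣ 12) (by norm_num) _ _ hc]
    fin_cases ez <;> simp +decide
  · simp only [LU, hat_koD_P h hp]
    fin_cases ez <;> simp +decide
  · simp only [LU, hat_koD_mulP h hp (k := 2) (j := 6) (by norm_num)]
    fin_cases ez <;> simp +decide
  · simp only [LU, hat_koD_mulP h hp (k := 3) (j := 4) (by norm_num)]
    fin_cases ez <;> simp +decide <;> ring
  · simp only [LU, hat_koD_mulP h hp (k := 4) (j := 3) (by norm_num)]
    fin_cases ez <;> simp +decide
  · simp only [LU, hat_koD_mulP h hp (k := 6) (j := 2) (by norm_num)]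
    fin_cases ez <;> simp +decide <;> ring
  · rw [hM12]
    simp only [LU, hat, koD_top, sub_self]
    norm_num

/-- **`L_III` kills every distribution vector.** [folklore] -/
private theorem LIII_koD (h : Nat.Coprime 12 p) [NeZero (12 * p)] (hp : p.Prime) (h17 : 17 ≤ p) {M : ℕ}
    (hM : M ∈ (12 * p).divisors) (z : ZMod (12 * p)) {c c' : ZMod p} (hc : c ≠ 0) (hc' : c' ≠ 0) :
    LIII h (koD (12 * p) M z) c c' = 0 := by
  have h5 : 5 ≤ p := by omega
  obtain ⟨-, h3c, -, -, -⟩ := mul_ne_zero_facts hp h17 hc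
  obtain ⟨-, h3c', -, -, -⟩ := mul_ne_zero_facts hp h17 hc'
  obtain ⟨ez, bz, rfl⟩ : ∃ ez bz, z = pt h ez bz := ⟨_, _, (pt_crt h z).symm⟩
  obtain ⟨-, -, c3, c4, -, -, -, -⟩ := cancel_facts hp h5 c bz
  obtain ⟨-, -, c3', c4', -, -, -, -⟩ := cancel_facts hp h5 c' bz
  rcases eq_of_dvd_twelve_mul_prime hp h5 (Nat.dvd_of_mem_divisors hM) with
    rfl | rfl | rfl | rfl | rfl | rfl | rfl | rfl | rfl | rfl | rfl | hM12
  · simp only [LIII, Gam4, U4, T4, hat_koD_dvd_twelve h (by norm_num : 1 ∣ 12) (by norm_num) _ _ hc,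
      hat_koD_dvd_twelve h (by norm_num : 1 ∣ 12) (by norm_num) _ _ h3c,
      hat_koD_dvd_twelve h (by norm_num : 1 ∣ 12) (by norm_num) _ _ hc',
      hat_koD_dvd_twelve h (by norm_num : 1 ∣ 12) (by norm_num) _ _ h3c']
    fin_cases ez <;> simp +decide
  · simp only [LIII, Gam4, U4, T4, hat_koD_dvd_twelve h (by norm_num : 2 ∣ 12) (by norm_num) _ _ hc,
      hat_koD_dvd_twelve h (by norm_num : 2 ∣ 12) (by norm_num) _ _ h3c,
      hat_koD_dvd_twelve h (by norm_num : 2 ∣ 12) (by norm_num) _ _ hc',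
      hat_koD_dvd_twelve h (by norm_num : 2 ∣ 12) (by norm_num) _ _ h3c']
    fin_cases ez <;> simp +decide
  · simp only [LIII, Gam4, U4, T4, hat_koD_dvd_twelve h (by norm_num : 3 ∣ 12) (by norm_num) _ _ hc,
      hat_koD_dvd_twelve h (by norm_num : 3 ∣ 12) (by norm_num) _ _ h3c,
      hat_koD_dvd_twelve h (by norm_num : 3 ∣ 12) (by norm_num) _ _ hc',
      hat_koD_dvd_twelve h (by norm_num : 3 ∣ 12) (by norm_num) _ _ h3c']
    fin_cases ez <;> simp +decide
  · simp only [LIII, Gam4, U4, T4, hat_koD_dvd_twelve h (by norm_num : 4 ∣ 12) (by norm_num) _ _ hc,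
      hat_koD_dvd_twelve h (by norm_num : 4 ∣ 12) (by norm_num) _ _ h3c,
      hat_koD_dvd_twelve h (by norm_num : 4 ∣ 12) (by norm_num) _ _ hc',
      hat_koD_dvd_twelve h (by norm_num : 4 ∣ 12) (by norm_num) _ _ h3c']
    fin_cases ez <;> simp +decide
  · simp only [LIII, Gam4, U4, T4, hat_koD_dvd_twelve h (by norm_num : 6 ∣ 12) (by norm_num) _ _ hc,
      hat_koD_dvd_twelve h (by norm_num : 6 ∣ 12) (by norm_num) _ _ h3c,
      hat_koD_dvd_twelve h (by norm_num : 6 ∣ 12) (by norm_num) _ _ hc',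
      hat_koD_dvd_twelve h (by norm_num : 6 ∣ 12) (by norm_num) _ _ h3c']
    fin_cases ez <;> simp +decide
  · simp only [LIII, Gam4, U4, T4, hat_koD_dvd_twelve h (by norm_num : 12 ∣ 12) (by norm_num) _ _ hc,
      hat_koD_dvd_twelve h (by norm_num : 12 ∣ 12) (by norm_num) _ _ h3c,
      hat_koD_dvd_twelve h (by norm_num : 12 ∣ 12) (by norm_num) _ _ hc',
      hat_koD_dvd_twelve h (by norm_num : 12 ∣ 12) (by norm_num) _ _ h3c']
    fin_cases ez <;> simp +decide
  · simp only [LIII, Gam4, U4, T4, hat_koD_P h hp]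
    fin_cases ez <;> simp +decide
  · simp only [LIII, Gam4, U4, T4, hat_koD_mulP h hp (k := 2) (j := 6) (by norm_num)]
    fin_cases ez <;> simp +decide
  · simp only [LIII, Gam4, U4, T4, hat_koD_mulP h hp (k := 3) (j := 4) (by norm_num)]
    fin_cases ez <;> simp +decide
  · simp only [LIII, Gam4, U4, T4, hat_koD_mulP h hp (k := 4) (j := 3) (by norm_num), Nat.cast_ofNat,
      c3, c4, c3', c4']
    fin_cases ez <;> simp +decide <;> ring
  · simp only [LIII, Gam4, U4, T4, hat_koD_mulP h hp (k := 6) (j := 2) (by norm_num)]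
    fin_cases ez <;> simp +decide
  · rw [hM12]
    simp only [LIII, Gam4, U4, T4, hat, koD_top, sub_self]

/-- **`L_IV` kills every distribution vector.** [folklore] -/
private theorem LIV_koD (h : Nat.Coprime 12 p) [NeZero (12 * p)] (hp : p.Prime) (h17 : 17 ≤ p) {M : ℕ}
    (hM : M ∈ (12 * p).divisors) (z : ZMod (12 * p)) {c c' : ZMod p} (hc : c ≠ 0) (hc' : c' ≠ 0) :
    LIV h (koD (12 * p) M z) c c' = 0 := by
  have h5 : 5 ≤ p := by omega
  obtain ⟨h2c, -, h4c, -, -⟩ := mul_ne_zero_facts hp h17 hc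
  obtain ⟨h2c', -, h4c', -, -⟩ := mul_ne_zero_facts hp h17 hc'
  obtain ⟨ez, bz, rfl⟩ : ∃ ez bz, z = pt h ez bz := ⟨_, _, (pt_crt h z).symm⟩
  obtain ⟨c1, c2, -, -, c5, c6, c7, c8⟩ := cancel_facts hp h5 c bz
  obtain ⟨c1', c2', -, -, c5', c6', c7', c8'⟩ := cancel_facts hp h5 c' bz
  rcases eq_of_dvd_twelve_mul_prime hp h5 (Nat.dvd_of_mem_divisors hM) with
    rfl | rfl | rfl | rfl | rfl | rfl | rfl | rfl | rfl | rfl | rfl | hM12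
  · simp only [LIV, Gam3, U3, E3, Q3, hat_koD_dvd_twelve h (by norm_num : 1 ∣ 12) (by norm_num) _ _ hc,
      hat_koD_dvd_twelve h (by norm_num : 1 ∣ 12) (by norm_num) _ _ h2c,
      hat_koD_dvd_twelve h (by norm_num : 1 ∣ 12) (by norm_num) _ _ h4c,
      hat_koD_dvd_twelve h (by norm_num : 1 ∣ 12) (by norm_num) _ _ hc',
      hat_koD_dvd_twelve h (by norm_num : 1 ∣ 12) (by norm_num) _ _ h2c',
      hat_koD_dvd_twelve h (by norm_num : 1 ∣ 12) (by norm_num) _ _ h4c']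
    fin_cases ez <;> simp +decide
  · simp only [LIV, Gam3, U3, E3, Q3, hat_koD_dvd_twelve h (by norm_num : 2 ∣ 12) (by norm_num) _ _ hc,
      hat_koD_dvd_twelve h (by norm_num : 2 ∣ 12) (by norm_num) _ _ h2c,
      hat_koD_dvd_twelve h (by norm_num : 2 ∣ 12) (by norm_num) _ _ h4c,
      hat_koD_dvd_twelve h (by norm_num : 2 ∣ 12) (by norm_num) _ _ hc',
      hat_koD_dvd_twelve h (by norm_num : 2 ∣ 12) (by norm_num) _ _ h2c',
      hat_koD_dvd_twelve h (by norm_num : 2 ∣ 12) (by norm_num) _ _ h4c']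
    fin_cases ez <;> simp +decide
  · simp only [LIV, Gam3, U3, E3, Q3, hat_koD_dvd_twelve h (by norm_num : 3 ∣ 12) (by norm_num) _ _ hc,
      hat_koD_dvd_twelve h (by norm_num : 3 ∣ 12) (by norm_num) _ _ h2c,
      hat_koD_dvd_twelve h (by norm_num : 3 ∣ 12) (by norm_num) _ _ h4c,
      hat_koD_dvd_twelve h (by norm_num : 3 ∣ 12) (by norm_num) _ _ hc',
      hat_koD_dvd_twelve h (by norm_num : 3 ∣ 12) (by norm_num) _ _ h2c',
      hat_koD_dvd_twelve h (by norm_num : 3 ∣ 12) (by norm_num) _ _ h4c']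
    fin_cases ez <;> simp +decide
  · simp only [LIV, Gam3, U3, E3, Q3, hat_koD_dvd_twelve h (by norm_num : 4 ∣ 12) (by norm_num) _ _ hc,
      hat_koD_dvd_twelve h (by norm_num : 4 ∣ 12) (by norm_num) _ _ h2c,
      hat_koD_dvd_twelve h (by norm_num : 4 ∣ 12) (by norm_num) _ _ h4c,
      hat_koD_dvd_twelve h (by norm_num : 4 ∣ 12) (by norm_num) _ _ hc',
      hat_koD_dvd_twelve h (by norm_num : 4 ∣ 12) (by norm_num) _ _ h2c',
      hat_koD_dvd_twelve h (by norm_num : 4 ∣ 12) (by norm_num) _ _ h4c']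
    fin_cases ez <;> simp +decide
  · simp only [LIV, Gam3, U3, E3, Q3, hat_koD_dvd_twelve h (by norm_num : 6 ∣ 12) (by norm_num) _ _ hc,
      hat_koD_dvd_twelve h (by norm_num : 6 ∣ 12) (by norm_num) _ _ h2c,
      hat_koD_dvd_twelve h (by norm_num : 6 ∣ 12) (by norm_num) _ _ h4c,
      hat_koD_dvd_twelve h (by norm_num : 6 ∣ 12) (by norm_num) _ _ hc',
      hat_koD_dvd_twelve h (by norm_num : 6 ∣ 12) (by norm_num) _ _ h2c',
      hat_koD_dvd_twelve h (by norm_num : 6 ∣ 12) (by norm_num) _ _ h4c']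
    fin_cases ez <;> simp +decide
  · simp only [LIV, Gam3, U3, E3, Q3, hat_koD_dvd_twelve h (by norm_num : 12 ∣ 12) (by norm_num) _ _ hc,
      hat_koD_dvd_twelve h (by norm_num : 12 ∣ 12) (by norm_num) _ _ h2c,
      hat_koD_dvd_twelve h (by norm_num : 12 ∣ 12) (by norm_num) _ _ h4c,
      hat_koD_dvd_twelve h (by norm_num : 12 ∣ 12) (by norm_num) _ _ hc',
      hat_koD_dvd_twelve h (by norm_num : 12 ∣ 12) (by norm_num) _ _ h2c',
      hat_koD_dvd_twelve h (by norm_num : 12 ∣ 12) (by norm_num) _ _ h4c']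
    fin_cases ez <;> simp +decide
  · simp only [LIV, Gam3, U3, E3, Q3, hat_koD_P h hp]
    fin_cases ez <;> simp +decide
  · simp only [LIV, Gam3, U3, E3, Q3, hat_koD_mulP h hp (k := 2) (j := 6) (by norm_num)]
    fin_cases ez <;> simp +decide
  · simp only [LIV, Gam3, U3, E3, Q3, hat_koD_mulP h hp (k := 3) (j := 4) (by norm_num), Nat.cast_ofNat,
      c5, c6, c5', c6']
    fin_cases ez <;> simp +decide <;> ring
  · simp only [LIV, Gam3, U3, E3, Q3, hat_koD_mulP h hp (k := 4) (j := 3) (by norm_num)]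
    fin_cases ez <;> simp +decide
  · simp only [LIV, Gam3, U3, E3, Q3, hat_koD_mulP h hp (k := 6) (j := 2) (by norm_num), Nat.cast_ofNat,
      c1, c2, c7, c8, c1', c2', c7', c8']
    fin_cases ez <;> simp +decide <;> ring
  · rw [hM12]
    simp only [LIV, Gam3, U3, E3, Q3, hat, koD_top, sub_self]


/-! ### The three relations on Hodge multisets of level `12p` -/

/-- **Koblitz–Ogus, functional form:** a linear functional on `ℚ^{ℤ/12p}` that kills the negation-invariant functions and all
distribution vectors kills the multiplicity function of every Hodge multiset (the tree's PROVED
`KoblitzOgus.hodge_eq_combination`; as in `HodgeQuadruplesSixPrime`). [cite: Deligne1982HodgeCycles, Rem. 7.16 (a)] -/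
private theorem functional_count_eq_zero [NeZero (12 * p)] {s : Multiset (ZMod (12 * p))} (hs : IsHodgeMultiset s)
    (L : (ZMod (12 * p) → ℚ) → ℚ)
    (hadd : ∀ g g' : ZMod (12 * p) → ℚ, L (fun z ↦ g z + g' z) = L g + L g')
    (hmul : ∀ (a : ℚ) (g : ZMod (12 * p) → ℚ), L (fun z ↦ a * g z) = a * L g)
    (hsum : ∀ {ι : Type} (t : Finset ι) (g : ι → ZMod (12 * p) → ℚ), L (fun z ↦ ∑ i ∈ t, g i z) = ∑ i ∈ t, L (g i))
    (heven : ∀ g : ZMod (12 * p) → ℚ, (∀ z, g (-z) = g z) → L g = 0)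
    (hko : ∀ M ∈ (12 * p).divisors, ∀ y : ZMod (12 * p), L (koD (12 * p) M y) = 0) :
    L (fun w ↦ (count w s : ℚ)) = 0 := by
  classical
  obtain ⟨cr, cd, hrep⟩ := Literature.NumberTheory.Transcendental.KoblitzOgus.hodge_eq_combination
    (N := 12 * p) (fun x ↦ (count x s : ℚ)) (fun u hu ↦ hs.sum_count_mul_bern_eq_zero hu)
  have hf : (fun w ↦ (count w s : ℚ)) =
      fun w ↦ (∑ a : ZMod (12 * p), cr a * ((if a = w then (1 : ℚ) else 0) + (if -a = w then 1 else 0))) +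
        ∑ M ∈ (12 * p).divisors, ∑ y : ZMod (12 * p), cd M y * koD (12 * p) M y w := funext hrep
  rw [hf, hadd, hsum, hsum]
  have hA : ∀ a : ZMod (12 * p),
      L (fun w ↦ cr a * ((if a = w then (1 : ℚ) else 0) + (if -a = w then 1 else 0))) = 0 := fun a ↦ by
    rw [hmul, heven _ fun w ↦ ?_, mul_zero]
    rw [add_comm]
    congr 1
    · simp only [neg_inj]
    · simp only [eq_neg_iff_add_eq_zero, neg_eq_iff_add_eq_zero]
  have hB : ∀ M ∈ (12 * p).divisors, L (fun w ↦ ∑ y : ZMod (12 * p), cd M y * koD (12 * p) M y w) = 0 :=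
    fun M hM ↦ by
      rw [hsum]
      refine Finset.sum_eq_zero fun y _ ↦ ?_
      rw [hmul, hko M hM y, mul_zero]
  rw [Finset.sum_eq_zero fun a _ ↦ hA a, Finset.sum_eq_zero hB, add_zero]

/-- **Relation U** (the characters `χ₄χ₃ψ`, `ψ` odd mod `p`) for the multiplicity function of a Hodge multiset of level `12p`.
[cite: Deligne1982HodgeCycles, Rem. 7.16 (a)] [cite: Aoki1983, Prop. 2.2] -/
private theorem LU_count_eq_zero (h : Nat.Coprime 12 p) [NeZero (12 * p)] (hp : p.Prime) (h17 : 17 ≤ p)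
    {s : Multiset (ZMod (12 * p))} (hs : IsHodgeMultiset s) {c : ZMod p} (hc : c ≠ 0) :
    LU h (fun w ↦ (count w s : ℚ)) c = 0 := by
  have lin := LU_linear h c
  exact functional_count_eq_zero hs (fun g ↦ LU h g c) lin.1 lin.2.1 (fun t g ↦ lin.2.2.1 t g) lin.2.2.2
    (fun M hM y ↦ LU_koD h hp h17 hM y hc)

/-- **Relation III** (the characters `χ₄ψ`, `ψ ≠ 1` even mod `p`), difference form. [cite: Deligne1982HodgeCycles, Rem. 7.16 (a)] [cite: Aoki1983, Prop. 2.2] -/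
private theorem LIII_count_eq_zero (h : Nat.Coprime 12 p) [NeZero (12 * p)] (hp : p.Prime) (h17 : 17 ≤ p)
    {s : Multiset (ZMod (12 * p))} (hs : IsHodgeMultiset s) {c c' : ZMod p} (hc : c ≠ 0) (hc' : c' ≠ 0) :
    LIII h (fun w ↦ (count w s : ℚ)) c c' = 0 := by
  have lin := LIII_linear h c c'
  exact functional_count_eq_zero hs (fun g ↦ LIII h g c c') lin.1 lin.2.1 (fun t g ↦ lin.2.2.1 t g) lin.2.2.2
    (fun M hM y ↦ LIII_koD h hp h17 hM y hc hc')

/-- **Relation IV** (the characters `χ₃ψ`, `ψ ≠ 1` even mod `p`), difference form. [cite: Deligne1982HodgeCycles, Rem. 7.16 (a)] [cite: Aoki1983, Prop. 2.2] -/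
private theorem LIV_count_eq_zero (h : Nat.Coprime 12 p) [NeZero (12 * p)] (hp : p.Prime) (h17 : 17 ≤ p)
    {s : Multiset (ZMod (12 * p))} (hs : IsHodgeMultiset s) {c c' : ZMod p} (hc : c ≠ 0) (hc' : c' ≠ 0) :
    LIV h (fun w ↦ (count w s : ℚ)) c c' = 0 := by
  have lin := LIV_linear h c c'
  exact functional_count_eq_zero hs (fun g ↦ LIV h g c c') lin.1 lin.2.1 (fun t g ↦ lin.2.2.1 t g) lin.2.2.2
    (fun M hM y ↦ LIV_koD h hp h17 hM y hc hc')

/-! ### The odd part in coordinates and the character tables mod `12` -/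

/-- The odd part of the multiplicity function of `T : Multiset (ℤ/12 × ℤ/p)`: `o(q) = #_q T − #_{−q} T`. [folklore] -/
private def oc (T : Multiset (ZMod 12 × ZMod p)) (q : ZMod 12 × ZMod p) : ℤ := (count q T : ℤ) - count (-q) T

/-- `ĝ` of the multiplicity function of `s` at `pt e c` is the odd part of `s.map crt` at `(e, c)`. [folklore] -/
private theorem hat_count (h : Nat.Coprime 12 p) (s : Multiset (ZMod (12 * p))) (e : ZMod 12) (c : ZMod p) :
    hat (fun w ↦ (count w s : ℚ)) (pt h e c) = (oc (s.map (crt h)) (e, c) : ℚ) := by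
  classical
  have hc : ∀ q : ZMod 12 × ZMod p, count q (s.map (crt h)) = count ((crt h).symm q) s := fun q ↦ by
    rw [← Multiset.count_map_eq_count' _ _ (crt h).symm.injective, Multiset.map_map]
    simp only [Function.comp_def, RingEquiv.symm_apply_apply, Multiset.map_id']
  simp only [hat, oc, hc, neg_pt, Int.cast_sub, Int.cast_natCast]
  rfl

/-- The odd character mod `4`, on `ℤ/12` (`0` on even residues). [folklore] -/
private def chi4 (f : ZMod 12) : ℤ := if f.val % 4 = 1 then 1 else if f.val % 4 = 3 then -1 else 0

/-- The odd character mod `3`, on `ℤ/12` (`0` on multiples of `3`). [folklore] -/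
private def chi3 (f : ZMod 12) : ℤ := if f.val % 3 = 1 then 1 else if f.val % 3 = 2 then -1 else 0

/-- `χ₄χ₃` (supported on the units `1, 5, 7, 11`). [folklore] -/
private def chi43 (f : ZMod 12) : ℤ := chi4 f * chi3 f

/-- `χ₄` restricted to the units. [folklore] -/
private def chi4u (f : ZMod 12) : ℤ := chi4 f * (chi3 f * chi3 f)

/-- `χ₄` restricted to the odd multiples of `3` (`9 ↦ 1`, `3 ↦ −1`). [folklore] -/
private def chi4t (f : ZMod 12) : ℤ := chi4 f * (1 - chi3 f * chi3 f)

/-- `χ₃` restricted to the units. [folklore] -/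
private def chi3u (f : ZMod 12) : ℤ := chi3 f * (chi4 f * chi4 f)

/-- `χ₃` restricted to the residues `≡ 2 (mod 4)` (`10 ↦ 1`, `2 ↦ −1`). [folklore] -/
private def chi3e (f : ZMod 12) : ℤ := if f.val % 4 = 2 then chi3 f else 0

/-- `χ₃` restricted to the residues `≡ 0 (mod 4)` (`4 ↦ 1`, `8 ↦ −1`). [folklore] -/
private def chi3q (f : ZMod 12) : ℤ := if f.val % 4 = 0 then chi3 f else 0

variable (T : Multiset (ZMod 12 × ZMod p))

/-- `L_U` in coordinates: `o(1,c) − o(5,c) − o(7,c) + o(11,c)`. [folklore] -/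
private def cLU (c : ZMod p) : ℤ := oc T (1, c) - oc T (5, c) - oc T (7, c) + oc T (11, c)

/-- `U₄` in coordinates. [folklore] -/
private def cU4 (c : ZMod p) : ℤ := oc T (1, c) + oc T (5, c) - oc T (7, c) - oc T (11, c)

/-- `T₄` in coordinates. [folklore] -/
private def cT4 (c : ZMod p) : ℤ := oc T (9, c) - oc T (3, c)

/-- `Γ₄` in coordinates. [folklore] -/
private def cGam4 (c : ZMod p) : ℤ := cU4 T c + cU4 T (3 * c) - 2 * cT4 T (3 * c)

/-- `U₃` in coordinates. [folklore] -/
private def cU3 (c : ZMod p) : ℤ := oc T (1, c) - oc T (5, c) + oc T (7, c) - oc T (11, c)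

/-- `E₃` in coordinates. [folklore] -/
private def cE3 (c : ZMod p) : ℤ := oc T (10, c) - oc T (2, c)

/-- `Q₃` in coordinates. [folklore] -/
private def cQ3 (c : ZMod p) : ℤ := oc T (4, c) - oc T (8, c)

/-- `Γ₃` in coordinates. [folklore] -/
private def cGam3 (c : ZMod p) : ℤ := cU3 T c + cU3 T (2 * c) - 2 * cE3 T (2 * c) - 2 * cE3 T (4 * c) + 2 * cQ3 T (4 * c)

/-- The three relations satisfied by the coordinates of a Hodge multiset of level `12p`. [folklore] -/
private structure Rels (T : Multiset (ZMod 12 × ZMod p)) : Prop where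
  relU : ∀ c : ZMod p, c ≠ 0 → cLU T c = 0
  relIII : ∀ c c' : ZMod p, c ≠ 0 → c' ≠ 0 → cGam4 T c = cGam4 T c'
  relIV : ∀ c c' : ZMod p, c ≠ 0 → c' ≠ 0 → cGam3 T c = cGam3 T c'

/-- The two relations that see only the odd members (U and III). [folklore] -/
private structure RelsOdd (T : Multiset (ZMod 12 × ZMod p)) : Prop where
  relU : ∀ c : ZMod p, c ≠ 0 → cLU T c = 0
  relIII : ∀ c c' : ZMod p, c ≠ 0 → c' ≠ 0 → cGam4 T c = cGam4 T c'

variable {T}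

/-- `Rels` implies `RelsOdd`. [folklore] -/
private theorem Rels.odd (h : Rels T) : RelsOdd T := ⟨h.relU, h.relIII⟩

/-- **The relations U, III, IV for the coordinates of a Hodge multiset of level `12p`.** [cite: Aoki1983, Prop. 2.2] -/
private theorem rels_of_isHodgeMultiset (h : Nat.Coprime 12 p) [NeZero (12 * p)] (hp : p.Prime) (h17 : 17 ≤ p)
    {s : Multiset (ZMod (12 * p))} (hs : IsHodgeMultiset s) : Rels (s.map (crt h)) := by
  refine ⟨fun c hc ↦ ?_, fun c c' hc hc' ↦ ?_, fun c c' hc hc' ↦ ?_⟩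
  · have key := LU_count_eq_zero h hp h17 hs hc
    simp only [LU, hat_count] at key
    have e : ((cLU (s.map (crt h)) c : ℤ) : ℚ) = 0 := by push_cast [cLU]; linear_combination key
    exact_mod_cast e
  · have key := LIII_count_eq_zero h hp h17 hs hc hc'
    simp only [LIII, Gam4, U4, T4, hat_count] at key
    have e : ((cGam4 (s.map (crt h)) c - cGam4 (s.map (crt h)) c' : ℤ) : ℚ) = 0 := by
      push_cast [cGam4, cU4, cT4]; linear_combination key
    have := Int.cast_eq_zero.mp e
    linarith
  · have key := LIV_count_eq_zero h hp h17 hs hc hc'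
    simp only [LIV, Gam3, U3, E3, Q3, hat_count] at key
    have e : ((cGam3 (s.map (crt h)) c - cGam3 (s.map (crt h)) c' : ℤ) : ℚ) = 0 := by
      push_cast [cGam3, cU3, cE3, cQ3]; linear_combination key
    have := Int.cast_eq_zero.mp e
    linarith

/-! ### Evaluating the relations on explicit multisets: member contributions -/

/-- `o` of the empty multiset. [folklore] -/
private theorem oc_zero (q : ZMod 12 × ZMod p) : oc (0 : Multiset (ZMod 12 × ZMod p)) q = 0 := by simp [oc]

/-- `o` of `a ::ₘ T`. [folklore] -/
private theorem oc_cons (a : ZMod 12 × ZMod p) (T : Multiset (ZMod 12 × ZMod p)) (q : ZMod 12 × ZMod p) :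
    oc (a ::ₘ T) q = oc T q + ((if q = a then 1 else 0) - (if -q = a then 1 else 0)) := by
  simp only [oc, Multiset.count_cons, Nat.cast_add, Nat.cast_ite, Nat.cast_one, Nat.cast_zero]
  ring

/-- `o` of a singleton. [folklore] -/
private theorem oc_singleton (a q : ZMod 12 × ZMod p) :
    oc ({a} : Multiset (ZMod 12 × ZMod p)) q = (if q = a then 1 else 0) - (if -q = a then 1 else 0) := by
  rw [← Multiset.cons_zero, oc_cons, oc_zero, zero_add]

/-- The contribution of a member `(f, d)` to `L_U(c)`: `χ₄χ₃(f)·([c = d] − [−c = d])`. [folklore] -/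
private theorem cLU_cons (f : ZMod 12) (d : ZMod p) (T : Multiset (ZMod 12 × ZMod p)) (c : ZMod p) :
    cLU ((f, d) ::ₘ T) c = cLU T c + chi43 f * ((if c = d then 1 else 0) - (if -c = d then 1 else 0)) := by
  simp only [cLU, oc_cons, Prod.mk.injEq, Prod.neg_mk]
  fin_cases f <;> simp +decide [chi43, chi4, chi3] <;> split_ifs <;> omega

/-- The contribution of a member `(f, d)` to `U₄(c)`: `χ₄(f)[f unit]·([c = d] + [−c = d])`. [folklore] -/
private theorem cU4_cons (f : ZMod 12) (d : ZMod p) (T : Multiset (ZMod 12 × ZMod p)) (c : ZMod p) :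
    cU4 ((f, d) ::ₘ T) c = cU4 T c + chi4u f * ((if c = d then 1 else 0) + (if -c = d then 1 else 0)) := by
  simp only [cU4, oc_cons, Prod.mk.injEq, Prod.neg_mk]
  fin_cases f <;> simp +decide [chi4u, chi4, chi3] <;> split_ifs <;> omega

/-- The contribution of a member `(f, d)` to `T₄(c)`: `χ₄(f)[3 ∣ f]·([c = d] + [−c = d])`. [folklore] -/
private theorem cT4_cons (f : ZMod 12) (d : ZMod p) (T : Multiset (ZMod 12 × ZMod p)) (c : ZMod p) :
    cT4 ((f, d) ::ₘ T) c = cT4 T c + chi4t f * ((if c = d then 1 else 0) + (if -c = d then 1 else 0)) := by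
  simp only [cT4, oc_cons, Prod.mk.injEq, Prod.neg_mk]
  fin_cases f <;> simp +decide [chi4t, chi4, chi3] <;> split_ifs <;> omega

/-- The contribution of a member `(f, d)` to `U₃(c)`: `χ₃(f)[f unit]·([c = d] + [−c = d])`. [folklore] -/
private theorem cU3_cons (f : ZMod 12) (d : ZMod p) (T : Multiset (ZMod 12 × ZMod p)) (c : ZMod p) :
    cU3 ((f, d) ::ₘ T) c = cU3 T c + chi3u f * ((if c = d then 1 else 0) + (if -c = d then 1 else 0)) := by
  simp only [cU3, oc_cons, Prod.mk.injEq, Prod.neg_mk]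
  fin_cases f <;> simp +decide [chi3u, chi4, chi3] <;> split_ifs <;> omega

/-- The contribution of a member `(f, d)` to `E₃(c)`: `χ₃(f)[f ≡ 2 (4)]·([c = d] + [−c = d])`. [folklore] -/
private theorem cE3_cons (f : ZMod 12) (d : ZMod p) (T : Multiset (ZMod 12 × ZMod p)) (c : ZMod p) :
    cE3 ((f, d) ::ₘ T) c = cE3 T c + chi3e f * ((if c = d then 1 else 0) + (if -c = d then 1 else 0)) := by
  simp only [cE3, oc_cons, Prod.mk.injEq, Prod.neg_mk]
  fin_cases f <;> simp +decide [chi3e, chi3] <;> split_ifs <;> omega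

/-- The contribution of a member `(f, d)` to `Q₃(c)`: `χ₃(f)[f ≡ 0 (4)]·([c = d] + [−c = d])`. [folklore] -/
private theorem cQ3_cons (f : ZMod 12) (d : ZMod p) (T : Multiset (ZMod 12 × ZMod p)) (c : ZMod p) :
    cQ3 ((f, d) ::ₘ T) c = cQ3 T c + chi3q f * ((if c = d then 1 else 0) + (if -c = d then 1 else 0)) := by
  simp only [cQ3, oc_cons, Prod.mk.injEq, Prod.neg_mk]
  fin_cases f <;> simp +decide [chi3q, chi3] <;> split_ifs <;> omega

/-- The functionals vanish on the empty multiset. [folklore] -/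
private theorem cfun_zero (c : ZMod p) :
    cLU (0 : Multiset (ZMod 12 × ZMod p)) c = 0 ∧ cU4 (0 : Multiset (ZMod 12 × ZMod p)) c = 0 ∧
      cT4 (0 : Multiset (ZMod 12 × ZMod p)) c = 0 ∧ cU3 (0 : Multiset (ZMod 12 × ZMod p)) c = 0 ∧
      cE3 (0 : Multiset (ZMod 12 × ZMod p)) c = 0 ∧ cQ3 (0 : Multiset (ZMod 12 × ZMod p)) c = 0 := by
  simp [cLU, cU4, cT4, cU3, cE3, cQ3, oc_zero]

/-- `L_U` of a singleton. [folklore] -/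
private theorem cLU_singleton (f : ZMod 12) (d : ZMod p) (c : ZMod p) :
    cLU ({(f, d)} : Multiset (ZMod 12 × ZMod p)) c = chi43 f * ((if c = d then 1 else 0) - (if -c = d then 1 else 0)) := by
  rw [← Multiset.cons_zero, cLU_cons, (cfun_zero c).1, zero_add]

/-- `U₄` of a singleton. [folklore] -/
private theorem cU4_singleton (f : ZMod 12) (d : ZMod p) (c : ZMod p) :
    cU4 ({(f, d)} : Multiset (ZMod 12 × ZMod p)) c = chi4u f * ((if c = d then 1 else 0) + (if -c = d then 1 else 0)) := by
  rw [← Multiset.cons_zero, cU4_cons, (cfun_zero c).2.1, zero_add]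

/-- `T₄` of a singleton. [folklore] -/
private theorem cT4_singleton (f : ZMod 12) (d : ZMod p) (c : ZMod p) :
    cT4 ({(f, d)} : Multiset (ZMod 12 × ZMod p)) c = chi4t f * ((if c = d then 1 else 0) + (if -c = d then 1 else 0)) := by
  rw [← Multiset.cons_zero, cT4_cons, (cfun_zero c).2.2.1, zero_add]

/-- `U₃` of a singleton. [folklore] -/
private theorem cU3_singleton (f : ZMod 12) (d : ZMod p) (c : ZMod p) :
    cU3 ({(f, d)} : Multiset (ZMod 12 × ZMod p)) c = chi3u f * ((if c = d then 1 else 0) + (if -c = d then 1 else 0)) := by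
  rw [← Multiset.cons_zero, cU3_cons, (cfun_zero c).2.2.2.1, zero_add]

/-- `E₃` of a singleton. [folklore] -/
private theorem cE3_singleton (f : ZMod 12) (d : ZMod p) (c : ZMod p) :
    cE3 ({(f, d)} : Multiset (ZMod 12 × ZMod p)) c = chi3e f * ((if c = d then 1 else 0) + (if -c = d then 1 else 0)) := by
  rw [← Multiset.cons_zero, cE3_cons, (cfun_zero c).2.2.2.2.1, zero_add]

/-- `Q₃` of a singleton. [folklore] -/
private theorem cQ3_singleton (f : ZMod 12) (d : ZMod p) (c : ZMod p) :
    cQ3 ({(f, d)} : Multiset (ZMod 12 × ZMod p)) c = chi3q f * ((if c = d then 1 else 0) + (if -c = d then 1 else 0)) := by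
  rw [← Multiset.cons_zero, cQ3_cons, (cfun_zero c).2.2.2.2.2, zero_add]

/-- A non-vanishing bracket `[A] + [B]` forces `A ∨ B`. [folklore] -/
private theorem or_of_bracket_ne {A B : Prop} [Decidable A] [Decidable B]
    (h : ((if A then (1 : ℤ) else 0) + (if B then 1 else 0)) ≠ 0) : A ∨ B := by
  by_cases hA : A
  · exact Or.inl hA
  · by_cases hB : B
    · exact Or.inr hB
    · simp [hA, hB] at h

/-- Non-coincidences of small multiples of `c ≠ 0` in `ℤ/p`, `p ≥ 17`, in the literal shapes met below. [folklore] -/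
private theorem ncf (hp : p.Prime) (h17 : 17 ≤ p) {c : ZMod p} (hc : c ≠ 0) :
    (-c ≠ c ∧ c ≠ -c) ∧
    ((3 : ZMod p) * c ≠ c ∧ -((3 : ZMod p) * c) ≠ c ∧ (3 : ZMod p) * c ≠ -c ∧ -((3 : ZMod p) * c) ≠ -c) ∧
    ((2 : ZMod p) * c ≠ c ∧ -((2 : ZMod p) * c) ≠ c ∧ (2 : ZMod p) * c ≠ -c ∧ -((2 : ZMod p) * c) ≠ -c) ∧
    ((3 : ZMod p) * (2 * c) ≠ c ∧ -((3 : ZMod p) * (2 * c)) ≠ c ∧ (3 : ZMod p) * (2 * c) ≠ -c ∧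
      -((3 : ZMod p) * (2 * c)) ≠ -c) ∧
    ((4 : ZMod p) * c ≠ c ∧ -((4 : ZMod p) * c) ≠ c ∧ (4 : ZMod p) * c ≠ -c ∧ -((4 : ZMod p) * c) ≠ -c) ∧
    ((2 : ZMod p) * (2 * c) ≠ c ∧ -((2 : ZMod p) * (2 * c)) ≠ c ∧ (2 : ZMod p) * (2 * c) ≠ -c ∧
      -((2 : ZMod p) * (2 * c)) ≠ -c) ∧
    ((4 : ZMod p) * (2 * c) ≠ c ∧ -((4 : ZMod p) * (2 * c)) ≠ c ∧ (4 : ZMod p) * (2 * c) ≠ -c ∧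
      -((4 : ZMod p) * (2 * c)) ≠ -c) := by
  have K : ∀ i j : ℤ, i ≠ j → |i| ≤ 8 → |j| ≤ 8 → (i : ZMod p) * c ≠ (j : ZMod p) * c :=
    fun i j hij hi hj ↦ kb_ne hp h17 hc hij hi hj
  refine ⟨⟨fun h' ↦ K (-1) 1 (by norm_num) (by norm_num) (by norm_num) (by push_cast; linear_combination h'),
      fun h' ↦ K 1 (-1) (by norm_num) (by norm_num) (by norm_num) (by push_cast; linear_combination h')⟩,
    ⟨fun h' ↦ K 3 1 (by norm_num) (by norm_num) (by norm_num) (by push_cast; linear_combination h'),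
      fun h' ↦ K (-3) 1 (by norm_num) (by norm_num) (by norm_num) (by push_cast; linear_combination h'),
      fun h' ↦ K 3 (-1) (by norm_num) (by norm_num) (by norm_num) (by push_cast; linear_combination h'),
      fun h' ↦ K (-3) (-1) (by norm_num) (by norm_num) (by norm_num) (by push_cast; linear_combination h')⟩,
    ⟨fun h' ↦ K 2 1 (by norm_num) (by norm_num) (by norm_num) (by push_cast; linear_combination h'),
      fun h' ↦ K (-2) 1 (by norm_num) (by norm_num) (by norm_num) (by push_cast; linear_combination h'),
      fun h' ↦ K 2 (-1) (by norm_num) (by norm_num) (by norm_num) (by push_cast; linear_combination h'),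
      fun h' ↦ K (-2) (-1) (by norm_num) (by norm_num) (by norm_num) (by push_cast; linear_combination h')⟩,
    ⟨fun h' ↦ K 6 1 (by norm_num) (by norm_num) (by norm_num) (by push_cast; linear_combination h'),
      fun h' ↦ K (-6) 1 (by norm_num) (by norm_num) (by norm_num) (by push_cast; linear_combination h'),
      fun h' ↦ K 6 (-1) (by norm_num) (by norm_num) (by norm_num) (by push_cast; linear_combination h'),
      fun h' ↦ K (-6) (-1) (by norm_num) (by norm_num) (by norm_num) (by push_cast; linear_combination h')⟩,
    ⟨fun h' ↦ K 4 1 (by norm_num) (by norm_num) (by norm_num) (by push_cast; linear_combination h'),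
      fun h' ↦ K (-4) 1 (by norm_num) (by norm_num) (by norm_num) (by push_cast; linear_combination h'),
      fun h' ↦ K 4 (-1) (by norm_num) (by norm_num) (by norm_num) (by push_cast; linear_combination h'),
      fun h' ↦ K (-4) (-1) (by norm_num) (by norm_num) (by norm_num) (by push_cast; linear_combination h')⟩,
    ⟨fun h' ↦ K 4 1 (by norm_num) (by norm_num) (by norm_num) (by push_cast; linear_combination h'),
      fun h' ↦ K (-4) 1 (by norm_num) (by norm_num) (by norm_num) (by push_cast; linear_combination h'),
      fun h' ↦ K 4 (-1) (by norm_num) (by norm_num) (by norm_num) (by push_cast; linear_combination h'),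
      fun h' ↦ K (-4) (-1) (by norm_num) (by norm_num) (by norm_num) (by push_cast; linear_combination h')⟩,
    ⟨fun h' ↦ K 8 1 (by norm_num) (by norm_num) (by norm_num) (by push_cast; linear_combination h'),
      fun h' ↦ K (-8) 1 (by norm_num) (by norm_num) (by norm_num) (by push_cast; linear_combination h'),
      fun h' ↦ K 8 (-1) (by norm_num) (by norm_num) (by norm_num) (by push_cast; linear_combination h'),
      fun h' ↦ K (-8) (-1) (by norm_num) (by norm_num) (by norm_num) (by push_cast; linear_combination h')⟩⟩

/-! ### Finite facts about the character tables mod `12` -/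

/-- The type trichotomy of a residue mod `12`: unit (`χ₄χ₃ ≠ 0`), odd multiple of `3` (`χ₄ᵗ ≠ 0`), or even (the odd tables
vanish). [folklore] -/
private theorem type_cases (f : ZMod 12) :
    chi43 f ≠ 0 ∨ chi4t f ≠ 0 ∨ (chi4u f = 0 ∧ chi4t f = 0 ∧ chi43 f = 0 ∧ chi3u f = 0) := by
  revert f; decide

/-- An odd residue is a unit or an odd multiple of `3`. [folklore] -/
private theorem odd_cases {f : ZMod 12} (hf : f.val % 2 = 1) : chi43 f ≠ 0 ∨ chi4t f ≠ 0 := by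
  revert f; decide

/-- An even residue has vanishing odd tables. [folklore] -/
private theorem even_tables {f : ZMod 12} (hf : f.val % 2 = 0) :
    chi4u f = 0 ∧ chi4t f = 0 ∧ chi43 f = 0 ∧ chi3u f = 0 := by
  revert f; decide

/-- An odd residue has vanishing even tables. [folklore] -/
private theorem odd_tables {f : ZMod 12} (hf : f.val % 2 = 1) : chi3e f = 0 ∧ chi3q f = 0 := by
  revert f; decide

/-- For a unit `f`: `χ₄ᵘ(f) ≠ 0`, `χ₃ᵘ(f) ≠ 0`, and the other tables vanish. [folklore] -/
private theorem unit_tables {f : ZMod 12} (hf : chi43 f ≠ 0) :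
    chi4u f ≠ 0 ∧ chi4t f = 0 ∧ chi3e f = 0 ∧ chi3q f = 0 ∧ chi3u f ≠ 0 := by
  revert f; decide

/-- For an odd multiple of `3`: the unit and even tables vanish. [folklore] -/
private theorem ttype_tables {f : ZMod 12} (hf : chi4t f ≠ 0) :
    chi4u f = 0 ∧ chi43 f = 0 ∧ chi3u f = 0 ∧ chi3e f = 0 ∧ chi3q f = 0 := by
  revert f; decide

/-- Two units with opposite `χ₄χ₃` and opposite `χ₄` differ by `6`. [folklore] -/
private theorem unit_shift {e e' : ZMod 12} (he : chi43 e ≠ 0) (h1 : chi43 e + chi43 e' = 0)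
    (h2 : chi4u e + chi4u e' = 0) : e' = e + 6 := by
  revert e e'; decide

/-- Two units with the same `χ₄χ₃` and opposite `χ₄` are opposite. [folklore] -/
private theorem unit_neg {e e' : ZMod 12} (he : chi43 e ≠ 0) (h1 : chi43 e = chi43 e') (h2 : chi4u e + chi4u e' = 0) :
    e' = -e := by
  revert e e'; decide

/-- Two odd multiples of `3` with opposite `χ₄` differ by `6`, i.e. are opposite. [folklore] -/
private theorem ttype_shift {e e' : ZMod 12} (he : chi4t e ≠ 0) (h1 : chi4t e + chi4t e' = 0) :
    e' = e + 6 ∧ e' = -e := by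
  revert e e'; decide

/-- Even members are invisible to the relations U and III. [folklore] -/
private theorem RelsOdd.of_cons_even {q : ZMod 12 × ZMod p} {T : Multiset (ZMod 12 × ZMod p)} (h : RelsOdd (q ::ₘ T))
    (hq : q.1.val % 2 = 0) : RelsOdd T := by
  obtain ⟨f, d⟩ := q
  obtain ⟨h4u, h4t, h43, -⟩ := even_tables (f := f) hq
  refine ⟨fun c hc ↦ ?_, fun c c' hc hc' ↦ ?_⟩
  · have := h.relU c hc
    rw [cLU_cons, h43, zero_mul, add_zero] at this
    exact this
  · have := h.relIII c c' hc hc'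
    simp only [cGam4, cU4_cons, cT4_cons, h4u, h4t, zero_mul, add_zero] at this
    simp only [cGam4]
    exact this

/-! ### Two odd members: the shift `x ↦ x + 6p` -/

/-- **Periodicity for a two-element odd configuration.** If `O = {x, y}` satisfies the relations U and III, `x = (e, c)` is odd
with `c ≠ 0` and `y ≠ −x`, then `y = (e + 6, c)` (`= x + 6p` in `ℤ/12p`). [folklore] -/
private theorem period_two (hp : p.Prime) (h17 : 17 ≤ p) {O : Multiset (ZMod 12 × ZMod p)} (hO : RelsOdd O)
    {e e' : ZMod 12} {c c' : ZMod p} (hOe : O = {(e, c), (e', c')}) (he : e.val % 2 = 1) (hc : c ≠ 0)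
    (hyx : ((e', c') : ZMod 12 × ZMod p) ≠ -(e, c)) : e' = e + 6 ∧ c' = c := by
  haveI := Fact.mk hp
  obtain ⟨h2c, h3c, -, -, -⟩ := mul_ne_zero_facts hp h17 hc
  obtain ⟨⟨hcc, hcc'⟩, ⟨n31, nm31, n3m1, nm3m1⟩, ⟨n21, nm21, n2m1, nm2m1⟩, ⟨n61, nm61, n6m1, nm6m1⟩, -, -, -⟩ :=
    ncf hp h17 hc
  have h3 : (3 : ZMod p) ≠ 0 := fun h0 ↦ h3c (by rw [h0, zero_mul])
  -- `d` with `3d = c`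
  set d : ZMod p := (3 : ZMod p)⁻¹ * c with hd
  have h3d : 3 * d = c := by rw [hd, ← mul_assoc, mul_inv_cancel₀ h3, one_mul]
  have hd0 : d ≠ 0 := fun h0 ↦ hc (by rw [← h3d, h0, mul_zero])
  have ndc : d ≠ c := fun h' ↦ n31 (by linear_combination (-3) * h' + h3d)
  have nmdc : -d ≠ c := fun h' ↦ n3m1 (by linear_combination (-3) * h' - h3d)
  have ndmc : d ≠ -c := fun h' ↦ n3m1 (by linear_combination 3 * h' - h3d)
  have nmdmc : -d ≠ -c := fun h' ↦ ndc (neg_inj.mp h')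
  -- the two relations, expanded on `O = {(e,c), (e',c')}`
  have EU : ∀ c₀, cLU O c₀ = chi43 e * ((if c₀ = c then 1 else 0) - (if -c₀ = c then 1 else 0)) +
      chi43 e' * ((if c₀ = c' then 1 else 0) - (if -c₀ = c' then 1 else 0)) := fun c₀ ↦ by
    rw [hOe, Multiset.insert_eq_cons, cLU_cons, cLU_singleton]; ring
  have EG : ∀ c₀, cGam4 O c₀ =
      (chi4u e * ((if c₀ = c then 1 else 0) + (if -c₀ = c then 1 else 0)) +
        chi4u e' * ((if c₀ = c' then 1 else 0) + (if -c₀ = c' then 1 else 0))) +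
      (chi4u e * ((if 3 * c₀ = c then 1 else 0) + (if -(3 * c₀) = c then 1 else 0)) +
        chi4u e' * ((if 3 * c₀ = c' then 1 else 0) + (if -(3 * c₀) = c' then 1 else 0))) -
      2 * (chi4t e * ((if 3 * c₀ = c then 1 else 0) + (if -(3 * c₀) = c then 1 else 0)) +
        chi4t e' * ((if 3 * c₀ = c' then 1 else 0) + (if -(3 * c₀) = c' then 1 else 0))) := fun c₀ ↦ by
    rw [hOe, Multiset.insert_eq_cons]
    simp only [cGam4, cU4_cons, cU4_singleton, cT4_cons, cT4_singleton]
    ring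
  rcases odd_cases he with hunit | httype
  · -- `x` of unit type
    obtain ⟨h4u, h4t, -, -, -⟩ := unit_tables hunit
    by_cases h1 : c = c'
    · subst c'
      have hU := hO.relU c hc
      have hG := hO.relIII c (2 * c) hc h2c
      rw [EU] at hU
      rw [EG, EG] at hG
      simp only [hcc, if_true, if_false, n31, nm31, n21, nm21, n61, nm61, h4t] at hU hG
      exact ⟨unit_shift hunit (by linarith) (by linarith), rfl⟩
    · by_cases h2 : -c = c'
      · subst c'
        have hU := hO.relU c hc
        have hG := hO.relIII c (2 * c) hc h2c
        rw [EU] at hU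
        rw [EG, EG] at hG
        simp only [hcc, hcc', if_true, if_false, n31, nm31, n3m1, nm3m1, n21, nm21, n2m1, nm2m1, n61,
          nm61, n6m1, nm6m1, h4t] at hU hG
        have key := unit_neg hunit (by linarith) (by linarith)
        exact absurd (by rw [key, Prod.neg_mk]) hyx
      · exfalso
        have hU := hO.relU c hc
        rw [EU] at hU
        simp only [hcc, if_true, if_false, h1, h2] at hU
        exact hunit (by linarith)
  · -- `x` an odd multiple of `3`
    obtain ⟨h4u, h43, -, -, -⟩ := ttype_tables httype
    rcases type_cases e' with hyu | hyt | ⟨hy4u, hy4t, -, -⟩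
    · -- `y` of unit type: impossible
      exfalso
      by_cases hc'0 : c' = 0
      · subst c'
        have hG := hO.relIII d c hd0 hc
        rw [EG, EG] at hG
        simp only [h3d, hcc, if_true, if_false, ndc, nmdc, hd0, neg_eq_zero, hc, h3c, n31, nm31,
          h4u] at hG
        exact httype (by linarith)
      · have hcc2 := (ncf hp h17 hc'0).1.1
        have hU := hO.relU c' hc'0
        rw [EU] at hU
        simp only [h43, zero_mul, zero_add, hcc2, if_true, if_false] at hU
        exact hyu (by linarith)
    · -- `y` an odd multiple of `3`
      obtain ⟨hy4u, -, -, -, -⟩ := ttype_tables hyt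
      by_cases h1 : c = c'
      · subst c'
        have hG := hO.relIII d c hd0 hc
        rw [EG, EG] at hG
        simp only [h3d, hcc, if_true, if_false, ndc, nmdc, n31, nm31, h4u, hy4u] at hG
        exact ⟨(ttype_shift httype (by linarith)).1, rfl⟩
      · by_cases h2 : -c = c'
        · subst c'
          have hG := hO.relIII d c hd0 hc
          rw [EG, EG] at hG
          simp only [h3d, hcc, hcc', if_true, if_false, ndc, nmdc, ndmc, nmdmc, n31, nm31, n3m1,
            nm3m1, h4u, hy4u] at hG
          have key := (ttype_shift httype (by linarith)).2
          exact absurd (by rw [key, Prod.neg_mk]) hyx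
        · exfalso
          have A := hO.relIII d c hd0 hc
          have B := hO.relIII d (2 * c) hd0 h2c
          rw [EG, EG] at A B
          simp only [h3d, hcc, if_true, if_false, h1, h2, n31, nm31, n61, nm61, h4u, hy4u, zero_mul,
            zero_add, add_zero, mul_zero] at A B
          have br1 : ((if 3 * c = c' then (1 : ℤ) else 0) + (if -(3 * c) = c' then 1 else 0)) ≠ 0 := by
            intro h0; rw [h0] at A; exact httype (by linarith)
          have br2 : ((if 3 * (2 * c) = c' then (1 : ℤ) else 0) + (if -(3 * (2 * c)) = c' then 1 else 0)) ≠ 0 := by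
            intro h0; rw [h0] at B; exact httype (by linarith)
          rcases or_of_bracket_ne br1 with e1 | e1 <;> rcases or_of_bracket_ne br2 with e2 | e2
          · exact kb_ne hp h17 hc (i := 3) (j := 6) (by norm_num) (by norm_num) (by norm_num)
              (by push_cast; linear_combination e1 - e2)
          · exact kb_ne hp h17 hc (i := 3) (j := -6) (by norm_num) (by norm_num) (by norm_num)
              (by push_cast; linear_combination e1 - e2)
          · exact kb_ne hp h17 hc (i := -3) (j := 6) (by norm_num) (by norm_num) (by norm_num)
              (by push_cast; linear_combination e1 - e2)
          · exact kb_ne hp h17 hc (i := -3) (j := -6) (by norm_num) (by norm_num) (by norm_num)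
              (by push_cast; linear_combination e1 - e2)
    · -- `y` of even type: invisible to relation III
      exfalso
      have hG := hO.relIII d c hd0 hc
      rw [EG, EG] at hG
      simp only [h3d, hcc, if_true, if_false, ndc, nmdc, n31, nm31, h4u, hy4u, hy4t, zero_mul,
        zero_add] at hG
      exact httype (by linarith)

/-- More table facts: the companions `e ± 2π`, `−3e`, `6 − e` of an odd residue. [folklore] -/
private theorem delta_tables {e u : ZMod 12} (hu : u = 1 ∨ u = 5 ∨ u = 7 ∨ u = 11) :
    (chi43 e ≠ 0 → chi43 e + chi43 (e + 2 * u) + chi43 (e - 2 * u) ≠ 0) ∧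
    (chi4t e ≠ 0 → chi4u e + chi4u (e + 2 * u) + chi4u (e - 2 * u) + chi4u (-(3 * e)) - 2 * chi4t (-(3 * e)) ≠ 0) := by
  revert e u; decide

/-- `6 − e` for a unit `e`: opposite `χ₄χ₃`, same `χ₄`. [folklore] -/
private theorem six_sub_unit {e : ZMod 12} (he : chi43 e ≠ 0) : chi43 (6 - e) = -chi43 e ∧ chi4u (6 - e) = chi4u e := by
  revert e; decide

/-- `6 − e = e` for an odd multiple `e` of `3`. [folklore] -/
private theorem six_sub_ttype {e : ZMod 12} (he : chi4t e ≠ 0) : 6 - e = e := by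
  revert e; decide

/-! ### The wrong lifts `δ_v = {v, v + 2p, v − 2p, −3v}` violate the relations -/

/-- **No `δ`-configuration.** For `v = (e, c)` odd with `c ≠ 0`, the multiset `{v, v + 2p, v − 2p, −3v}` (in coordinates,
`2p = (2π, 0)`) does not satisfy the relations U and III. [folklore] -/
private theorem delta_not_rels (hp : p.Prime) (h17 : 17 ≤ p) {e : ZMod 12} (he : e.val % 2 = 1) {c : ZMod p} (hc : c ≠ 0)
    (hD : RelsOdd ({(e, c), (e + 2 * π, c), (e - 2 * π, c), (-(3 * e), -(3 * c))} : Multiset (ZMod 12 × ZMod p))) :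
    False := by
  haveI := Fact.mk hp
  have h5 : 5 ≤ p := by omega
  obtain ⟨h2c, h3c, -, h6c, -⟩ := mul_ne_zero_facts hp h17 hc
  obtain ⟨⟨hcc, hcc'⟩, ⟨n31, nm31, -, -⟩, ⟨n21, nm21, -, -⟩, ⟨n61, nm61, -, -⟩, -, -, -⟩ := ncf hp h17 hc
  have K : ∀ i j : ℤ, i ≠ j → |i| ≤ 8 → |j| ≤ 8 → (i : ZMod p) * c ≠ (j : ZMod p) * c :=
    fun i j hij hi hj ↦ kb_ne hp h17 hc hij hi hj
  -- atoms against the member coordinate `−3c`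
  have a0 : c ≠ 3 * c := fun h' ↦ K 1 3 (by norm_num) (by norm_num) (by norm_num) (by push_cast; linear_combination h')
  have a1 : -c ≠ 3 * c := fun h' ↦ K (-1) 3 (by norm_num) (by norm_num) (by norm_num) (by push_cast; linear_combination h')
  have a2 : -(3 * c) ≠ 3 * c := fun h' ↦ h6c (by linear_combination -h')
  have a3 : -(2 * c) ≠ 3 * c := fun h' ↦ K (-2) 3 (by norm_num) (by norm_num) (by norm_num) (by push_cast; linear_combination h')
  have a4 : (2 : ZMod p) * c ≠ 3 * c := fun h' ↦ K 2 3 (by norm_num) (by norm_num) (by norm_num) (by push_cast; linear_combination h')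
  have a5 : -(3 * (2 * c)) ≠ 3 * c := fun h' ↦
    K (-6) 3 (by norm_num) (by norm_num) (by norm_num) (by push_cast; linear_combination h')
  have a6 : (3 : ZMod p) * (2 * c) ≠ 3 * c := fun h' ↦
    K 6 3 (by norm_num) (by norm_num) (by norm_num) (by push_cast; linear_combination h')
  have hπ := pi_eq hp h5
  obtain ⟨tdU, tdT⟩ := delta_tables (e := e) hπ
  rcases odd_cases he with hunit | httype
  · have hU := hD.relU c hc
    simp only [Multiset.insert_eq_cons, cLU_cons, cLU_singleton, ← neg_eq_iff_eq_neg, neg_neg, if_true, if_false, hcc, n31,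
      a0, a1, add_zero, zero_add, mul_zero, mul_one, sub_zero, sub_self] at hU
    exact tdU hunit (by linarith)
  · have hG := hD.relIII c (2 * c) hc h2c
    simp only [Multiset.insert_eq_cons, cGam4, cU4_cons, cU4_singleton, cT4_cons, cT4_singleton, ← neg_eq_iff_eq_neg, neg_neg,
      if_true, if_false, hcc, n31, nm31, a0, a1, a2, n21, nm21, a3, a4, n61, nm61, a5, a6, add_zero, zero_add, mul_zero,
      mul_one, sub_zero] at hG
    exact tdT httype (by linarith)

/-! ### No `{x, 6p − x, z, 6p − z}` with four odd members -/

/-- **No half-period pairs.** A multiset `{x, 6p − x, z, 6p − z}` of four odd coordinate points (`6p = (6, 0)`), with `x` off the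
fibre `0` and `−x ∉ {z, 6p − z}`, does not satisfy the relations U and III. [folklore] -/
private theorem halfpair_odd (hp : p.Prime) (h17 : 17 ≤ p) {T : Multiset (ZMod 12 × ZMod p)} (hT : RelsOdd T) {e f : ZMod 12}
    {c c' : ZMod p} (hTe : T = {(e, c), (6 - e, -c), (f, c'), (6 - f, -c')}) (he : e.val % 2 = 1) (hf : f.val % 2 = 1)
    (hc : c ≠ 0) (hz1 : ((f, c') : ZMod 12 × ZMod p) ≠ -(e, c)) (hz2 : ((6 - f, -c') : ZMod 12 × ZMod p) ≠ -(e, c)) :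
    False := by
  haveI := Fact.mk hp
  obtain ⟨h2c, h3c, h4c, h6c, -⟩ := mul_ne_zero_facts hp h17 hc
  obtain ⟨⟨hcc, hcc'⟩, ⟨n31, nm31, -, -⟩, ⟨n21, nm21, -, -⟩, ⟨n61, nm61, -, -⟩, ⟨n41, nm41, -, -⟩, -, -⟩ := ncf hp h17 hc
  have K : ∀ i j : ℤ, i ≠ j → |i| ≤ 8 → |j| ≤ 8 → (i : ZMod p) * c ≠ (j : ZMod p) * c :=
    fun i j hij hi hj ↦ kb_ne hp h17 hc hij hi hj
  have h3 : (3 : ZMod p) ≠ 0 := fun h0 ↦ h3c (by rw [h0, zero_mul])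
  set d : ZMod p := (3 : ZMod p)⁻¹ * c with hd
  have h3d : 3 * d = c := by rw [hd, ← mul_assoc, mul_inv_cancel₀ h3, one_mul]
  have h6d : 3 * (2 * d) = 2 * c := by linear_combination 2 * h3d
  have h12d : 3 * (4 * d) = 4 * c := by linear_combination 4 * h3d
  have hd0 : d ≠ 0 := fun h0 ↦ hc (by rw [← h3d, h0, mul_zero])
  have h2d0 : 2 * d ≠ 0 := mul_ne_zero (fun h0 ↦ h2c (by rw [h0, zero_mul])) hd0
  have h4d0 : 4 * d ≠ 0 := mul_ne_zero (fun h0 ↦ h4c (by rw [h0, zero_mul])) hd0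
  have ndc : d ≠ c := fun h' ↦ n31 (by linear_combination (-3) * h' + h3d)
  have nmdc : -d ≠ c := fun h' ↦ nm31 (by linear_combination (3:ZMod p) * h' + h3d)
  have n2dc : 2 * d ≠ c := fun h' ↦ K 2 3 (by norm_num) (by norm_num) (by norm_num)
    (by push_cast; linear_combination (3 : ZMod p) * h' - 2 * h3d)
  have nm2dc : -(2 * d) ≠ c := fun h' ↦ K (-2) 3 (by norm_num) (by norm_num) (by norm_num)
    (by push_cast; linear_combination (3 : ZMod p) * h' + 2 * h3d)
  have n4dc : 4 * d ≠ c := fun h' ↦ K 4 3 (by norm_num) (by norm_num) (by norm_num)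
    (by push_cast; linear_combination (3 : ZMod p) * h' - 4 * h3d)
  have nm4dc : -(4 * d) ≠ c := fun h' ↦ K (-4) 3 (by norm_num) (by norm_num) (by norm_num)
    (by push_cast; linear_combination (3 : ZMod p) * h' + 4 * h3d)
  rcases odd_cases he with heu | het
  · -- `x` of unit type
    obtain ⟨h4ue, h4te, -, -, -⟩ := unit_tables heu
    obtain ⟨s43e, s4ue⟩ := six_sub_unit heu
    rcases odd_cases hf with hfu | hft
    · obtain ⟨h4uf, h4tf, -, -, -⟩ := unit_tables hfu
      obtain ⟨s43f, s4uf⟩ := six_sub_unit hfu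
      by_cases k1 : c = c'
      · subst c'
        have hU := hT.relU c hc
        have hG := hT.relIII c (2 * c) hc h2c
        rw [hTe] at hU hG
        simp only [Multiset.insert_eq_cons, cLU_cons, cLU_singleton, ← neg_eq_iff_eq_neg, neg_neg, if_true, if_false, hcc,
          s43e, s43f, add_zero, zero_add, mul_zero, mul_one, sub_zero, zero_sub, sub_self] at hU
        simp only [Multiset.insert_eq_cons, cGam4, cU4_cons, cU4_singleton, cT4_cons, cT4_singleton, ← neg_eq_iff_eq_neg,
          neg_neg, if_true, if_false, hcc, n31, nm31, n21, nm21, n61, nm61, s4ue, s4uf, h4te, h4tf, add_zero, zero_add, mul_zero, mul_one, sub_zero, zero_sub, sub_self] at hG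
        have key := unit_shift (e' := f) heu (by linarith) (by linarith)
        exact hz2 (by rw [key, Prod.neg_mk, show (6 : ZMod 12) - (e + 6) = -e by ring])
      · by_cases k2 : -c = c'
        · subst c'
          have hU := hT.relU c hc
          have hG := hT.relIII c (2 * c) hc h2c
          rw [hTe] at hU hG
          simp only [Multiset.insert_eq_cons, cLU_cons, cLU_singleton, ← neg_eq_iff_eq_neg, neg_neg, if_true, if_false, hcc,
            s43e, s43f, add_zero, zero_add, mul_zero, mul_one, sub_zero, zero_sub, sub_self] at hU
          simp only [Multiset.insert_eq_cons, cGam4, cU4_cons, cU4_singleton, cT4_cons, cT4_singleton, ← neg_eq_iff_eq_neg,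
            neg_neg, if_true, if_false, hcc, n31, nm31, n21, nm21, n61, nm61, s4ue, s4uf, h4te, h4tf, add_zero, zero_add, mul_zero, mul_one, sub_zero, zero_sub, sub_self] at hG
          have key := unit_neg (e' := f) heu (by linarith) (by linarith)
          exact hz1 (by rw [key, Prod.neg_mk])
        · have k4 : -c ≠ -c' := fun h' ↦ k1 (neg_inj.mp h')
          have k3 : c ≠ -c' := fun h' ↦ k2 (by rw [h', neg_neg])
          have hU := hT.relU c hc
          rw [hTe] at hU
          simp only [Multiset.insert_eq_cons, cLU_cons, cLU_singleton, ← neg_eq_iff_eq_neg, neg_neg, if_true, if_false, hcc,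
            k1, k2, s43e, add_zero, zero_add, mul_zero, mul_one, sub_zero, zero_sub, sub_self] at hU
          exact heu (by linarith)
    · -- `f` an odd multiple of `3`: invisible to relation U
      obtain ⟨-, h43f, -, -, -⟩ := ttype_tables hft
      have s6f := six_sub_ttype hft
      have hU := hT.relU c hc
      rw [hTe, s6f] at hU
      simp only [Multiset.insert_eq_cons, cLU_cons, cLU_singleton, ← neg_eq_iff_eq_neg, neg_neg, if_true, if_false, hcc,
        s43e, h43f, zero_mul, add_zero, add_zero, zero_add, mul_zero, mul_one, sub_zero, zero_sub, sub_self] at hU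
      exact heu (by linarith)
  · -- `x` an odd multiple of `3`: `6p − x = (e, −c)`
    obtain ⟨h4ue, h43e, -, -, -⟩ := ttype_tables het
    have s6e := six_sub_ttype het
    rw [s6e] at hTe
    rcases odd_cases hf with hfu | hft
    · obtain ⟨h4uf, h4tf, -, -, -⟩ := unit_tables hfu
      obtain ⟨s43f, s4uf⟩ := six_sub_unit hfu
      by_cases hc'0 : c' = 0
      · subst c'
        have hG := hT.relIII d c hd0 hc
        rw [hTe] at hG
        simp only [Multiset.insert_eq_cons, cGam4, cU4_cons, cU4_singleton, cT4_cons, cT4_singleton, ← neg_eq_iff_eq_neg,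
          neg_neg, neg_zero, neg_eq_zero, h3d, if_true, if_false, hcc, hd0, hc, h3c, ndc, nmdc, n31, nm31, h4ue, h4tf, zero_mul,
          add_zero, zero_add, add_zero, zero_add, mul_zero, mul_one, sub_zero, zero_sub, sub_self] at hG
        exact het (by linarith)
      · have hcc2 := (ncf hp h17 hc'0).1.1
        have hU := hT.relU c' hc'0
        rw [hTe] at hU
        simp only [Multiset.insert_eq_cons, cLU_cons, cLU_singleton, ← neg_eq_iff_eq_neg, neg_neg, if_true, if_false, hcc2,
          h43e, s43f, zero_mul, zero_add, add_zero, zero_add, mul_zero, mul_one, sub_zero, zero_sub, sub_self] at hU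
        exact hfu (by linarith)
    · obtain ⟨h4uf, h43f, -, -, -⟩ := ttype_tables hft
      have s6f := six_sub_ttype hft
      rw [s6f] at hTe hz2
      by_cases k1 : c = c'
      · subst c'
        have hG := hT.relIII d c hd0 hc
        rw [hTe] at hG
        simp only [Multiset.insert_eq_cons, cGam4, cU4_cons, cU4_singleton, cT4_cons, cT4_singleton, ← neg_eq_iff_eq_neg,
          neg_neg, h3d, if_true, if_false, hcc, ndc, nmdc, n31, nm31, h4ue, h4uf, zero_mul, zero_add, add_zero, zero_add, mul_zero, mul_one, sub_zero, zero_sub, sub_self] at hG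
        have key := (ttype_shift (e' := f) het (by linarith)).2
        exact hz2 (by rw [key, Prod.neg_mk])
      · by_cases k2 : -c = c'
        · subst c'
          have hG := hT.relIII d c hd0 hc
          rw [hTe] at hG
          simp only [Multiset.insert_eq_cons, cGam4, cU4_cons, cU4_singleton, cT4_cons, cT4_singleton, ← neg_eq_iff_eq_neg,
            neg_neg, h3d, if_true, if_false, hcc, ndc, nmdc, n31, nm31, h4ue, h4uf, zero_mul, zero_add, add_zero, zero_add, mul_zero, mul_one, sub_zero, zero_sub, sub_self] at hG
          have key := (ttype_shift (e' := f) het (by linarith)).2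
          exact hz1 (by rw [key, Prod.neg_mk])
        · exfalso
          have A := hT.relIII d (2 * d) hd0 h2d0
          have B := hT.relIII d (4 * d) hd0 h4d0
          rw [hTe] at A B
          simp only [Multiset.insert_eq_cons, cGam4, cU4_cons, cU4_singleton, cT4_cons, cT4_singleton, ← neg_eq_iff_eq_neg,
            neg_neg, h3d, h6d, h12d, if_true, if_false, hcc, k1, k2, ndc, nmdc, n2dc, nm2dc, n4dc, nm4dc, n21, nm21, n41, nm41,
            h4ue, h4uf, zero_mul, zero_add, add_zero, zero_add, mul_zero, mul_one, sub_zero, zero_sub, sub_self] at A B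
          have brA : ((if 2 * c = c' then (1 : ℤ) else 0) + (if -(2 * c) = c' then 1 else 0)) ≠ 0 := by
            intro h0
            have h0' : ((if -(2 * c) = c' then (1 : ℤ) else 0) + (if 2 * c = c' then 1 else 0)) = 0 := by linarith
            rw [h0, h0'] at A
            simp only [mul_zero, add_zero] at A
            exact het (by linarith)
          have brB : ((if 4 * c = c' then (1 : ℤ) else 0) + (if -(4 * c) = c' then 1 else 0)) ≠ 0 := by
            intro h0
            have h0' : ((if -(4 * c) = c' then (1 : ℤ) else 0) + (if 4 * c = c' then 1 else 0)) = 0 := by linarith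
            rw [h0, h0'] at B
            simp only [mul_zero, add_zero] at B
            exact het (by linarith)
          rcases or_of_bracket_ne brA with e1 | e1 <;> rcases or_of_bracket_ne brB with e2 | e2
          · exact K 2 4 (by norm_num) (by norm_num) (by norm_num) (by push_cast; linear_combination e1 - e2)
          · exact K 2 (-4) (by norm_num) (by norm_num) (by norm_num) (by push_cast; linear_combination e1 - e2)
          · exact K (-2) 4 (by norm_num) (by norm_num) (by norm_num) (by push_cast; linear_combination e1 - e2)
          · exact K (-2) (-4) (by norm_num) (by norm_num) (by norm_num) (by push_cast; linear_combination e1 - e2)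

/-! ### Two even members over opposite fibres are of `S`-type -/

/-- Even `f, f′` with opposite even tables and `f` of `E`- or `Q`-type: `f′ = −f`. [folklore] -/
private theorem even_neg {f f' : ZMod 12} (hf : f.val % 2 = 0) (hf' : f'.val % 2 = 0) (h1 : chi3e f + chi3e f' = 0)
    (h2 : chi3q f + chi3q f' = 0) (hne : chi3e f ≠ 0 ∨ chi3q f ≠ 0) : f' = -f := by
  revert f f'; decide

/-- An even residue with vanishing even tables is `0` or `6`. [folklore] -/
private theorem even_stype {f : ZMod 12} (hf : f.val % 2 = 0) (h1 : chi3e f = 0) (h2 : chi3q f = 0) : f = 0 ∨ f = 6 := by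
  revert f; decide

/-- **Two even members over opposite fibres.** If `T = {(e₁, 0), (e₂, 0), (f, c), (f′, −c)}` with `e₁, e₂` odd, `f, f′` even,
`c ≠ 0`, satisfies relation IV and `(f′, −c) ≠ −(f, c)`, then `f, f′ ∈ {0, 6}`. [folklore] -/
private theorem even_pair (hp : p.Prime) (h17 : 17 ≤ p) {T : Multiset (ZMod 12 × ZMod p)} (hT : Rels T)
    {e₁ e₂ f f' : ZMod 12} {c : ZMod p} (hTe : T = {(e₁, 0), (e₂, 0), (f, c), (f', -c)}) (he₁ : e₁.val % 2 = 1)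
    (he₂ : e₂.val % 2 = 1) (hf : f.val % 2 = 0) (hf' : f'.val % 2 = 0) (hc : c ≠ 0)
    (hz : ((f', -c) : ZMod 12 × ZMod p) ≠ -(f, c)) : (f = 0 ∨ f = 6) ∧ (f' = 0 ∨ f' = 6) := by
  haveI := Fact.mk hp
  obtain ⟨h2c, h3c, h4c, -, -⟩ := mul_ne_zero_facts hp h17 hc
  obtain ⟨⟨hcc, -⟩, -, ⟨n21, nm21, -, -⟩, -, ⟨n41, nm41, -, -⟩, -, -⟩ := ncf hp h17 hc
  obtain ⟨x3e₁, x3q₁⟩ := odd_tables he₁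
  obtain ⟨x3e₂, x3q₂⟩ := odd_tables he₂
  obtain ⟨-, -, -, h3uf⟩ := even_tables hf
  obtain ⟨-, -, -, h3uf'⟩ := even_tables hf'
  have h2 : (2 : ZMod p) ≠ 0 := fun h0 ↦ h2c (by rw [h0, zero_mul])
  -- `g' = c/4`, `g = c/2`
  set g' : ZMod p := (2 : ZMod p)⁻¹ * ((2 : ZMod p)⁻¹ * c) with hg'
  set g : ZMod p := (2 : ZMod p)⁻¹ * c with hg
  have h2g : 2 * g = c := by rw [hg, ← mul_assoc, mul_inv_cancel₀ h2, one_mul]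
  have h4g : 4 * g = 2 * c := by linear_combination 2 * h2g
  have h2g' : 2 * g' = g := by rw [hg', hg, ← mul_assoc, mul_inv_cancel₀ h2, one_mul]
  have h4g' : 4 * g' = c := by linear_combination 2 * h2g' + h2g
  have hg0 : g ≠ 0 := fun h0 ↦ hc (by rw [← h2g, h0, mul_zero])
  have hg'0 : g' ≠ 0 := fun h0 ↦ hg0 (by rw [← h2g', h0, mul_zero])
  have ngc : g ≠ c := fun h' ↦ n21 (by linear_combination (-2) * h' + h2g)
  have nmgc : -g ≠ c := fun h' ↦ h3c (by linear_combination (-2) * h' - h2g)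
  have A := hT.relIV g c hg0 hc
  have B := hT.relIV g' c hg'0 hc
  rw [hTe] at A B
  simp only [Multiset.insert_eq_cons, cGam3, cU3_cons, cU3_singleton, cE3_cons, cE3_singleton, cQ3_cons, cQ3_singleton,
    ← neg_eq_iff_eq_neg, neg_neg, neg_zero, neg_eq_zero, h2g, h4g, h2g', h4g', if_true, if_false, hcc, hg0, hg'0, hc, h2c,
    h4c, ngc, nmgc, n21, nm21, n41, nm41, x3e₁, x3q₁, x3e₂, x3q₂, h3uf, h3uf', zero_mul, add_zero, zero_add, mul_zero, mul_one,
    sub_zero, zero_sub, sub_self] at A B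
  have hE : chi3e f + chi3e f' = 0 := by linarith
  have hQ : chi3q f + chi3q f' = 0 := by linarith
  by_cases hne : chi3e f ≠ 0 ∨ chi3q f ≠ 0
  · exact absurd (by rw [even_neg hf hf' hE hQ hne, Prod.neg_mk]) hz
  · rw [not_or, not_ne_iff, not_ne_iff] at hne
    obtain ⟨h1, h2⟩ := hne
    rw [h1, zero_add] at hE
    rw [h2, zero_add] at hQ
    exact ⟨even_stype hf h1 h2, even_stype hf' hE hQ⟩

/-! ### Level `12p`: arithmetic, the transfer to level `6p`, pair removal, the doubling map -/

/-- `6p` as a residue modulo `12p` (Shioda's `m′ = m/2`). -/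
local notation "K12" => (((6 * p : ℕ)) : ZMod (12 * p))

/-- `6p + 6p = 0` in `ℤ/12p`. [folklore] -/
private theorem K_add_K : K12 + K12 = 0 := by
  have h : K12 + K12 = (((12 * p : ℕ)) : ZMod (12 * p)) := by push_cast; ring
  rw [h, ZMod.natCast_self]

/-- `2 · 6p = 0`. [folklore] -/
private theorem two_mul_K : (2 : ZMod (12 * p)) * K12 = 0 := by rw [two_mul, K_add_K]

/-- `−6p = 6p`. [folklore] -/
private theorem neg_K : -K12 = K12 := by linear_combination -(K_add_K (p := p))

/-- `⟨6p⟩ = 6p`. [folklore] -/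
private theorem val_K (hp : 0 < p) : (K12).val = 6 * p := by
  rw [ZMod.val_natCast, Nat.mod_eq_of_lt (by omega)]

/-- `6p ≠ 0`. [folklore] -/
private theorem K_ne_zero (hp : 0 < p) : K12 ≠ 0 := fun h ↦ by
  have := val_K hp; rw [h, ZMod.val_zero] at this; omega

/-- `⟨x + 6p⟩`: add `6p` and reduce. [folklore] -/
private theorem val_add_K [NeZero (12 * p)] (hp : 0 < p) (x : ZMod (12 * p)) :
    ((x + K12).val = x.val + 6 * p ∧ x.val < 6 * p) ∨ ((x + K12).val + 12 * p = x.val + 6 * p ∧ 6 * p ≤ x.val) := by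
  have hq := val_K hp
  have hx := ZMod.val_lt x
  by_cases h : x.val < 6 * p
  · left
    refine ⟨?_, h⟩
    rw [ZMod.val_add_of_lt (by rw [hq]; omega), hq]
  · right
    refine ⟨?_, by omega⟩
    have := ZMod.val_add_val_of_le (a := x) (b := K12) (by rw [hq]; omega)
    rw [hq] at this
    omega

/-- `⟨2x⟩`: double and reduce. [folklore] -/
private theorem val_two_mul [NeZero (12 * p)] (hp : 0 < p) (x : ZMod (12 * p)) :
    (((2 : ZMod (12 * p)) * x).val = 2 * x.val ∧ x.val < 6 * p) ∨
      (((2 : ZMod (12 * p)) * x).val + 12 * p = 2 * x.val ∧ 6 * p ≤ x.val) := by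
  have h2 : ((2 : ZMod (12 * p))).val = 2 := by
    rw [show (2 : ZMod (12 * p)) = ((2 : ℕ) : ZMod (12 * p)) by norm_cast, ZMod.val_natCast, Nat.mod_eq_of_lt (by omega)]
  have hx := ZMod.val_lt x
  rw [ZMod.val_mul, h2]
  by_cases h : x.val < 6 * p
  · left
    exact ⟨Nat.mod_eq_of_lt (by omega), h⟩
  · right
    refine ⟨?_, by omega⟩
    rw [Nat.mod_eq_sub_mod (by omega), Nat.mod_eq_of_lt (by omega)]
    omega

/-- `6p · x = 6p` for odd `x`, `= 0` for even `x`. [folklore] -/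
private theorem K_mul [NeZero (12 * p)] (x : ZMod (12 * p)) : K12 * x = if x.val % 2 = 1 then K12 else 0 := by
  have e : x = ((x.val : ℕ) : ZMod (12 * p)) := (ZMod.natCast_zmod_val x).symm
  have hd := Nat.div_add_mod x.val 2
  have h2 := two_mul_K (p := p)
  push_cast at h2
  split_ifs with h
  · rw [h] at hd
    conv_lhs => rw [e, ← hd]
    push_cast
    linear_combination (↑(x.val / 2) : ZMod (12 * p)) * h2
  · have h0 : x.val % 2 = 0 := by omega
    rw [h0, add_zero] at hd
    conv_lhs => rw [e, ← hd]
    push_cast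
    linear_combination (↑(x.val / 2) : ZMod (12 * p)) * h2

/-- A unit of `ℤ/12p` is odd. [folklore] -/
private theorem odd_of_isUnit {u : ZMod (12 * p)} (hu : IsUnit u) : u.val % 2 = 1 := by
  obtain ⟨u, rfl⟩ := hu
  have hc := ZMod.val_coe_unit_coprime u
  by_contra h
  have h2 : 2 ∣ (u : ZMod (12 * p)).val := Nat.dvd_of_mod_eq_zero (by omega)
  have : 2 ∣ Nat.gcd (u : ZMod (12 * p)).val (12 * p) := Nat.dvd_gcd h2 ⟨6 * p, by omega⟩
  rw [hc] at this
  omega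

/-- `1 + 6p` is a unit (an involution). [folklore] -/
private theorem isUnit_one_add_K : IsUnit (1 + K12 : ZMod (12 * p)) := by
  have hq2 : (K12 : ZMod (12 * p)) * K12 = 0 := by
    have : (K12 : ZMod (12 * p)) * K12 = ((3 * p : ℕ) : ZMod (12 * p)) * (((12 * p : ℕ)) : ZMod (12 * p)) := by
      push_cast; ring
    rw [this, ZMod.natCast_self, mul_zero]
  have h1 : (1 + K12 : ZMod (12 * p)) * (1 + K12) = 1 := by linear_combination hq2 + two_mul_K (p := p)
  exact ⟨⟨1 + K12, 1 + K12, h1, h1⟩, rfl⟩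

/-- Half the representative: `⟨w⟩/2` as a residue (used for even `w`). [folklore] -/
private def half (w : ZMod (12 * p)) : ZMod (12 * p) := ((w.val / 2 : ℕ) : ZMod (12 * p))

/-- `2 · (⟨w⟩/2) = w` for even `w`. [folklore] -/
private theorem two_mul_half [NeZero (12 * p)] {w : ZMod (12 * p)} (hw : w.val % 2 = 0) : (2 : ZMod (12 * p)) * half w = w := by
  have h := Nat.div_add_mod w.val 2
  rw [hw, add_zero] at h
  have e : (((2 * (w.val / 2) : ℕ)) : ZMod (12 * p)) = w := by rw [h, ZMod.natCast_zmod_val]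
  calc (2 : ZMod (12 * p)) * half w = (((2 * (w.val / 2) : ℕ)) : ZMod (12 * p)) := by unfold half; push_cast; ring
    _ = w := e

/-- `⟨w⟩/2 + ⟨w⟩/2 = w` for even `w`. [folklore] -/
private theorem half_add_half [NeZero (12 * p)] {w : ZMod (12 * p)} (hw : w.val % 2 = 0) : half w + half w = w := by
  rw [← two_mul, two_mul_half hw]

/-- The norm sum of a mapped multiset as a sum of representatives. [folklore] -/
private theorem mNormSum_map {X : Type*} (t : Multiset X) {k : ℕ} (g : X → ZMod k) :
    mNormSum (t.map g) = (t.map fun w ↦ (g w).val).sum := by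
  simp only [mNormSum, Multiset.map_map, Function.comp_def]

/-- The representative of the reduction modulo `6p`. [folklore] -/
private theorem val_castHom [NeZero (12 * p)] (hnm : 6 * p ∣ 12 * p) (y : ZMod (12 * p)) :
    (ZMod.castHom hnm (ZMod (6 * p)) y).val = y.val % (6 * p) := by
  rw [ZMod.castHom_apply, ZMod.cast_eq_val, ZMod.val_natCast]

/-- **`⟨y⟩ + ⟨y + 6p⟩ = 2⟨ȳ⟩ + 6p`** (`ȳ = y mod 6p`). [folklore] -/
private theorem val_add_val_add_K [NeZero (12 * p)] (hp : 0 < p) (hnm : 6 * p ∣ 12 * p) (y : ZMod (12 * p)) :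
    y.val + (y + K12).val = 2 * (ZMod.castHom hnm (ZMod (6 * p)) y).val + 6 * p := by
  rw [val_castHom]
  rcases val_add_K hp y with ⟨h, hlt⟩ | ⟨h, hle⟩
  · rw [Nat.mod_eq_of_lt hlt]; omega
  · rw [Nat.mod_eq_sub_mod hle, Nat.mod_eq_of_lt (by have := ZMod.val_lt y; omega)]; omega

/-- **`⟨2y⟩ = 2⟨ȳ⟩`**. [folklore] -/
private theorem val_two_mul_eq [NeZero (12 * p)] (hp : 0 < p) (hnm : 6 * p ∣ 12 * p) (y : ZMod (12 * p)) :
    ((2 : ZMod (12 * p)) * y).val = 2 * (ZMod.castHom hnm (ZMod (6 * p)) y).val := by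
  rw [val_castHom]
  rcases val_two_mul hp y with ⟨h, hlt⟩ | ⟨h, hle⟩
  · rw [Nat.mod_eq_of_lt hlt]; omega
  · rw [Nat.mod_eq_sub_mod hle, Nat.mod_eq_of_lt (by have := ZMod.val_lt y; omega)]; omega

/-- The reduction of an odd residue is non-zero. [folklore] -/
private theorem castHom_ne_zero_of_odd [NeZero (12 * p)] (hnm : 6 * p ∣ 12 * p) {w : ZMod (12 * p)} (hw : w.val % 2 = 1) :
    ZMod.castHom hnm (ZMod (6 * p)) w ≠ 0 := by
  intro h
  have hv := congrArg ZMod.val h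
  rw [val_castHom, ZMod.val_zero] at hv
  obtain ⟨k, hk⟩ := Nat.dvd_of_mod_eq_zero hv
  have : 2 ∣ w.val := ⟨3 * p * k, by rw [hk]; ring⟩
  omega

/-- The reduction of half a non-zero even residue is non-zero. [folklore] -/
private theorem castHom_half_ne_zero [NeZero (12 * p)] (hnm : 6 * p ∣ 12 * p) {w : ZMod (12 * p)} (hw0 : w ≠ 0)
    (hw : w.val % 2 = 0) : ZMod.castHom hnm (ZMod (6 * p)) (half w) ≠ 0 := by
  intro h
  have hv := congrArg ZMod.val h
  rw [val_castHom, ZMod.val_zero, half, ZMod.val_natCast, Nat.mod_mod_of_dvd _ ⟨2, by ring⟩] at hv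
  have hlt := ZMod.val_lt w
  have hdvd : 6 * p ∣ w.val / 2 := Nat.dvd_of_mod_eq_zero hv
  have h0' : w.val / 2 = 0 := Nat.eq_zero_of_dvd_of_lt hdvd (by omega)
  have h0 : w.val = 0 := by omega
  exact hw0 ((ZMod.val_eq_zero w).mp h0)

/-- The image of a unit under `unitsMap` is its reduction. [folklore] -/
private theorem coe_unitsMap (hnm : 6 * p ∣ 12 * p) (u : (ZMod (12 * p))ˣ) :
    ((ZMod.unitsMap hnm u : (ZMod (6 * p))ˣ) : ZMod (6 * p)) = ZMod.castHom hnm (ZMod (6 * p)) (u : ZMod (12 * p)) := by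
  simp [ZMod.unitsMap_def]

/-- **The transfer of a Hodge multiset of level `12p` is a Hodge multiset of level `6p`.** Split a multiset over `ℤ/12p` into
its odd part `s₁` and its even part `s₀`; then `T(s) = (s₁ mod 6p) + 2·((s₀/2) mod 6p)` (halve the even members, reduce
everything modulo `6p`, count the halved members twice) is a Hodge multiset over `ℤ/6p` whenever `s₁ + s₀` is one over `ℤ/12p`.
PROOF: for a unit `u` of `ℤ/12p` also `u(1 + 6p)` is a unit, and `u(1 + 6p)w = uw + 6p` for odd `w`, `= uw` for even `w`; adding
the two norm equations and using `⟨y⟩ + ⟨y + 6p⟩ = 2⟨ȳ⟩ + 6p`, `⟨2y⟩ = 2⟨ȳ⟩` gives the norm equation of `T(s)` at `ū`; every unit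
of `ℤ/6p` is such a `ū` (the same computation as `isHodgeMultiset_transfer_fourPrime`, the elementary shadow of the distribution
relation of the Bernoulli function). [cite: Aoki1983, Prop. 2.2] [cite: Shioda1979PJA, §1 eq. (2)] -/
theorem isHodgeMultiset_transfer_twelvePrime [NeZero (12 * p)] (hp : 0 < p) (hnm : 6 * p ∣ 12 * p)
    {so se : Multiset (ZMod (12 * p))} (hso : ∀ w ∈ so, w.val % 2 = 1) (hse : ∀ w ∈ se, w.val % 2 = 0)
    (hs : IsHodgeMultiset (so + se)) :
    IsHodgeMultiset (so.map (ZMod.castHom hnm (ZMod (6 * p))) +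
      (se.map fun w ↦ ZMod.castHom hnm (ZMod (6 * p)) (half w)) + se.map fun w ↦ ZMod.castHom hnm (ZMod (6 * p)) (half w)) := by
  classical
  set R := ZMod.castHom hnm (ZMod (6 * p)) with hR
  obtain ⟨⟨hne, hsum⟩, hnorm⟩ := hs
  refine ⟨⟨?_, ?_⟩, fun v ↦ ?_⟩
  · intro a ha
    rcases Multiset.mem_add.mp ha with ha | ha
    · rcases Multiset.mem_add.mp ha with ha | ha
      · obtain ⟨w, hw, rfl⟩ := Multiset.mem_map.mp ha
        exact castHom_ne_zero_of_odd hnm (hso w hw)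
      · obtain ⟨w, hw, rfl⟩ := Multiset.mem_map.mp ha
        exact castHom_half_ne_zero hnm (hne w (Multiset.mem_add.mpr (Or.inr hw))) (hse w hw)
    · obtain ⟨w, hw, rfl⟩ := Multiset.mem_map.mp ha
      exact castHom_half_ne_zero hnm (hne w (Multiset.mem_add.mpr (Or.inr hw))) (hse w hw)
  · have h1 : (so.map R).sum = R so.sum := (map_multiset_sum R so).symm
    have h2 : (se.map fun w ↦ R (half w)).sum + (se.map fun w ↦ R (half w)).sum = R se.sum := by
      rw [← Multiset.sum_map_add, map_multiset_sum]
      congr 1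
      refine Multiset.map_congr rfl fun w hw ↦ ?_
      rw [← RingHom.map_add, half_add_half (hse w hw)]
    rw [Multiset.sum_add, Multiset.sum_add, add_assoc, h1, h2, ← RingHom.map_add, ← Multiset.sum_add, hsum, RingHom.map_zero]
  · obtain ⟨u, hu⟩ := ZMod.unitsMap_surjective hnm v
    have hvu : (v : ZMod (6 * p)) = R u := by rw [← hu, coe_unitsMap]
    obtain ⟨w1, hw1⟩ := isUnit_one_add_K (p := p)
    have odd_u : (u : ZMod (12 * p)).val % 2 = 1 := odd_of_isUnit u.isUnit
    have hqu : K12 * (u : ZMod (12 * p)) = K12 := by rw [K_mul, if_pos odd_u]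
    have h1 := hnorm u
    have h2 := hnorm (u * w1)
    rw [Multiset.map_add, mNormSum_add, mNormSum_map, mNormSum_map, Multiset.card_add] at h1 h2
    have eso : (so.map fun w ↦ (((u * w1 : (ZMod (12 * p))ˣ) : ZMod (12 * p)) * w).val) =
        so.map fun w ↦ ((u : ZMod (12 * p)) * w + K12).val := by
      refine Multiset.map_congr rfl fun w hw ↦ ?_
      have hqw : K12 * w = K12 := by rw [K_mul, if_pos (hso w hw)]
      rw [Units.val_mul, hw1]
      congr 1
      linear_combination (u : ZMod (12 * p)) * hqw + hqu
    have ese : (se.map fun w ↦ (((u * w1 : (ZMod (12 * p))ˣ) : ZMod (12 * p)) * w).val) =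
        se.map fun w ↦ ((u : ZMod (12 * p)) * w).val := by
      refine Multiset.map_congr rfl fun w hw ↦ ?_
      have hqw : K12 * w = 0 := by rw [K_mul, if_neg (by rw [hse w hw]; omega)]
      rw [Units.val_mul, hw1]
      congr 1
      linear_combination (u : ZMod (12 * p)) * hqw
    rw [eso, ese] at h2
    have hO : (so.map fun w ↦ ((u : ZMod (12 * p)) * w).val).sum + (so.map fun w ↦ ((u : ZMod (12 * p)) * w + K12).val).sum =
        2 * (so.map fun w ↦ (R ((u : ZMod (12 * p)) * w)).val).sum + 6 * p * Multiset.card so := by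
      rw [← Multiset.sum_map_add]
      have : (so.map fun w ↦ ((u : ZMod (12 * p)) * w).val + ((u : ZMod (12 * p)) * w + K12).val) =
          so.map fun w ↦ 2 * (R ((u : ZMod (12 * p)) * w)).val + 6 * p :=
        Multiset.map_congr rfl fun w _ ↦ val_add_val_add_K hp hnm _
      rw [this, Multiset.sum_map_add, Multiset.sum_map_mul_left, Multiset.map_const', Multiset.sum_replicate, smul_eq_mul,
        mul_comm (Multiset.card so)]
    have hE : (se.map fun w ↦ ((u : ZMod (12 * p)) * w).val).sum =
        2 * (se.map fun w ↦ (R ((u : ZMod (12 * p)) * half w)).val).sum := by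
      rw [← Multiset.sum_map_mul_left]
      congr 1
      refine Multiset.map_congr rfl fun w hw ↦ ?_
      rw [← val_two_mul_eq hp hnm, mul_left_comm, two_mul_half (hse w hw)]
    simp only [Multiset.map_add, mNormSum_add, Multiset.map_map, mNormSum_map, Multiset.card_add, Multiset.card_map,
      Function.comp_apply]
    have tso : (so.map fun w ↦ ((v : ZMod (6 * p)) * R w).val) = so.map fun w ↦ (R ((u : ZMod (12 * p)) * w)).val := by
      refine Multiset.map_congr rfl fun w _ ↦ ?_
      rw [hvu, ← map_mul]
    have tse : (se.map fun w ↦ ((v : ZMod (6 * p)) * R (half w)).val) =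
        se.map fun w ↦ (R ((u : ZMod (12 * p)) * half w)).val := by
      refine Multiset.map_congr rfl fun w _ ↦ ?_
      rw [hvu, ← map_mul]
    rw [tso, tse]
    generalize Multiset.card so = cso at h1 h2 hO ⊢
    generalize Multiset.card se = cse at h1 h2 ⊢
    have hmn : 12 * p * (cso + cse) = 2 * (6 * p * cso) + 2 * (6 * p * cse) := by ring
    have hgoal : 6 * p * (cso + cse + cse) = 6 * p * cso + 2 * (6 * p * cse) := by ring
    rw [hgoal]
    omega

/-- **Pair removal.** A Hodge multiset minus a pair `{a, −a}` is a Hodge multiset (the norm of a pair is the level at every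
unit). [cite: Shioda1979PJA, §1 (elements of length 1)] -/
private theorem isHodgeMultiset_of_cons_cons_neg {n : ℕ} [NeZero n] {a : ZMod n} {τ : Multiset (ZMod n)}
    (h : IsHodgeMultiset (a ::ₘ (-a) ::ₘ τ)) : IsHodgeMultiset τ := by
  obtain ⟨⟨hne, hsum⟩, hnorm⟩ := h
  have ha : a ≠ 0 := hne a (Multiset.mem_cons_self _ _)
  refine ⟨⟨fun x hx ↦ hne x (Multiset.mem_cons_of_mem (Multiset.mem_cons_of_mem hx)), ?_⟩, fun t ↦ ?_⟩
  · simpa [Multiset.sum_cons] using hsum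
  · have h := hnorm t
    simp only [Multiset.map_cons, mNormSum_cons, Multiset.card_cons] at h
    have hta : ((t : ZMod n) * a) ≠ 0 := (t.isUnit.mul_right_eq_zero).not.mpr ha
    have hneg : ((t : ZMod n) * -a).val = n - ((t : ZMod n) * a).val := by
      rw [mul_neg, ZMod.neg_val, if_neg hta]
    have hlt := ZMod.val_lt ((t : ZMod n) * a)
    rw [hneg] at h
    have e : n * (Multiset.card τ + 1 + 1) = n * Multiset.card τ + 2 * n := by ring
    rw [e] at h
    omega

/-- **A Hodge pair sums to zero** (the congruence part of the definition). [folklore] -/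
private theorem eq_neg_of_isHodgeMultiset_pair {n : ℕ} {a b : ZMod n} (h : IsHodgeMultiset ({a, b} : Multiset (ZMod n))) :
    b = -a := by
  have := h.1.2
  simp only [Multiset.insert_eq_cons, Multiset.sum_cons, Multiset.sum_singleton] at this
  linear_combination this

/-- **Halving the multiplicities keeps the norm equations** (`T(s) = σ + σ`). [folklore] -/
private theorem norm_of_add_self {n : ℕ} {σ : Multiset (ZMod n)} (h : IsHodgeMultiset (σ + σ)) (t : (ZMod n)ˣ) :
    2 * mNormSum (σ.map fun a ↦ (t : ZMod n) * a) = n * Multiset.card σ := by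
  have := h.2 t
  rw [Multiset.map_add, mNormSum_add, Multiset.card_add,
    show n * (Multiset.card σ + Multiset.card σ) = 2 * (n * Multiset.card σ) by ring] at this
  omega

/-- `3p` as a residue modulo `6p` (Shioda's `m′` of the level `6p`). -/
local notation "K6" => (((3 * p : ℕ)) : ZMod (6 * p))

/-- `2p` as a residue modulo `6p` (Shioda's `m″` of the level `6p`). -/
local notation "D6" => (((2 * p : ℕ)) : ZMod (6 * p))

/-- `4p` as a residue modulo `12p` (Shioda's `m″ = m/3`). -/
local notation "D12" => (((4 * p : ℕ)) : ZMod (12 * p))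

/-- `2p` as a residue modulo `12p`. -/
local notation "E12" => (((2 * p : ℕ)) : ZMod (12 * p))

section Double

/-- The doubling map `t ↦ 2t` from `ℤ/6p` to `ℤ/12p` (on representatives). [folklore] -/
private def dbl (t : ZMod (6 * p)) : ZMod (12 * p) := ((2 * t.val : ℕ) : ZMod (12 * p))

/-- `dbl` is additive. [folklore] -/
private theorem dbl_add [NeZero (6 * p)] (a b : ZMod (6 * p)) : dbl (a + b) = dbl a + dbl b := by
  have key : ∃ k : ℕ, 2 * a.val + 2 * b.val = 2 * (a + b).val + 12 * p * k := by
    by_cases h : a.val + b.val < 6 * p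
    · exact ⟨0, by rw [ZMod.val_add_of_lt h]; ring⟩
    · refine ⟨1, ?_⟩
      have e := ZMod.val_add_val_of_le (not_lt.mp h)
      omega
  obtain ⟨k, hk⟩ := key
  have := congrArg (Nat.cast : ℕ → ZMod (12 * p)) hk
  rw [Nat.cast_add, Nat.cast_add, Nat.cast_mul ((12 * p : ℕ)), ZMod.natCast_self, zero_mul, add_zero] at this
  unfold dbl
  rw [this]

/-- `dbl 0 = 0`. [folklore] -/
private theorem dbl_zero : dbl (0 : ZMod (6 * p)) = 0 := by
  simp [dbl]

/-- `dbl (−a) = −dbl a`. [folklore] -/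
private theorem dbl_neg [NeZero (6 * p)] (a : ZMod (6 * p)) : dbl (-a) = -dbl a :=
  eq_neg_of_add_eq_zero_left (by rw [← dbl_add, neg_add_cancel, dbl_zero])

/-- `dbl (k a) = k dbl a`. [folklore] -/
private theorem dbl_natCast_mul [NeZero (6 * p)] (k : ℕ) (a : ZMod (6 * p)) :
    dbl ((k : ZMod (6 * p)) * a) = (k : ZMod (12 * p)) * dbl a := by
  induction k with
  | zero => simp [dbl_zero]
  | succ k ih => rw [Nat.cast_succ, Nat.cast_succ, add_mul, one_mul, dbl_add, ih, add_mul, one_mul]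

/-- `dbl (2a) = 2 dbl a`. [folklore] -/
private theorem dbl_two_mul [NeZero (6 * p)] (a : ZMod (6 * p)) : dbl (2 * a) = 2 * dbl a := by
  exact_mod_cast dbl_natCast_mul 2 a

/-- `dbl (3a) = 3 dbl a`. [folklore] -/
private theorem dbl_three_mul [NeZero (6 * p)] (a : ZMod (6 * p)) : dbl (3 * a) = 3 * dbl a := by
  exact_mod_cast dbl_natCast_mul 3 a

/-- `dbl (4a) = 4 dbl a`. [folklore] -/
private theorem dbl_four_mul [NeZero (6 * p)] (a : ZMod (6 * p)) : dbl (4 * a) = 4 * dbl a := by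
  exact_mod_cast dbl_natCast_mul 4 a

/-- `dbl (y mod 6p) = 2y`. [folklore] -/
private theorem dbl_castHom [NeZero (12 * p)] (hnm : 6 * p ∣ 12 * p) (y : ZMod (12 * p)) :
    dbl (ZMod.castHom hnm (ZMod (6 * p)) y) = 2 * y := by
  unfold dbl
  rw [val_castHom]
  have key : ∃ k : ℕ, 2 * y.val = 2 * (y.val % (6 * p)) + 12 * p * k := by
    have hlt := ZMod.val_lt y
    by_cases h : y.val < 6 * p
    · exact ⟨0, by rw [Nat.mod_eq_of_lt h]; ring⟩
    · refine ⟨1, ?_⟩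
      rw [Nat.mod_eq_sub_mod (not_lt.mp h), Nat.mod_eq_of_lt (by omega)]
      omega
  obtain ⟨k, hk⟩ := key
  have := congrArg (Nat.cast : ℕ → ZMod (12 * p)) hk
  rw [Nat.cast_add, Nat.cast_mul ((12 * p : ℕ)), ZMod.natCast_self, zero_mul, add_zero, Nat.cast_mul, Nat.cast_ofNat,
    ZMod.natCast_zmod_val] at this
  rw [← this]

/-- `dbl ((w/2) mod 6p) = w` for even `w`. [folklore] -/
private theorem dbl_castHom_half [NeZero (12 * p)] (hnm : 6 * p ∣ 12 * p) {w : ZMod (12 * p)} (hw : w.val % 2 = 0) :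
    dbl (ZMod.castHom hnm (ZMod (6 * p)) (half w)) = w := by
  rw [dbl_castHom hnm, two_mul_half hw]

/-- `⟨3p̄⟩ = 3p` at level `6p`. [folklore] -/
private theorem val_K6 (hp : 0 < p) : (K6).val = 3 * p := by
  rw [ZMod.val_natCast, Nat.mod_eq_of_lt (by omega)]

/-- `dbl 3p̄ = 6p`. [folklore] -/
private theorem dbl_K6 (hp : 0 < p) : dbl K6 = K12 := by
  unfold dbl
  rw [val_K6 hp, show 2 * (3 * p) = 6 * p by ring]

/-- `dbl 2p̄ = 4p`. [folklore] -/
private theorem dbl_D6 (hp : 0 < p) : dbl D6 = D12 := by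
  unfold dbl
  rw [ZMod.val_natCast, Nat.mod_eq_of_lt (by omega), show 2 * (2 * p) = 4 * p by ring]

/-- `3p̄ ≠ 0` at level `6p`. [folklore] -/
private theorem K6_ne_zero (hp : 0 < p) : K6 ≠ 0 := fun h ↦ by
  have h1 := congrArg ZMod.val h
  rw [val_K6 hp, ZMod.val_zero] at h1
  omega

/-- `−3p̄ = 3p̄` at level `6p`. [folklore] -/
private theorem neg_K6 : -K6 = K6 := by
  have h : K6 + K6 = (((6 * p : ℕ)) : ZMod (6 * p)) := by push_cast; ring
  rw [ZMod.natCast_self] at h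
  linear_combination -h

/-- `2z = 0` iff `z ∈ {0, 3p̄}` at level `6p`. [folklore] -/
private theorem two_mul_eq_zero_sixP [NeZero (6 * p)] (hp : 0 < p) {z : ZMod (6 * p)} :
    (2 : ZMod (6 * p)) * z = 0 ↔ z = 0 ∨ z = K6 := by
  constructor
  · intro h
    have hv := congrArg ZMod.val h
    have h2 : ((2 : ZMod (6 * p))).val = 2 := by
      rw [show (2 : ZMod (6 * p)) = ((2 : ℕ) : ZMod (6 * p)) by norm_cast, ZMod.val_natCast, Nat.mod_eq_of_lt (by omega)]
    rw [ZMod.val_mul, h2, ZMod.val_zero] at hv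
    have hlt := ZMod.val_lt z
    obtain ⟨k, hk⟩ := Nat.dvd_of_mod_eq_zero hv
    have hk2 : k < 2 := by
      by_contra hk2
      have : 6 * p * 2 ≤ 6 * p * k := Nat.mul_le_mul_left _ (by omega)
      omega
    interval_cases k
    · left
      apply ZMod.val_injective (6 * p)
      rw [ZMod.val_zero]; omega
    · right
      apply ZMod.val_injective (6 * p)
      rw [val_K6 hp]; omega
  · rintro (rfl | rfl)
    · rw [mul_zero]
    · linear_combination -(neg_K6 (p := p))

/-- The residue of the norm sum is the sum. [folklore] -/
private theorem natCast_mNormSum {n : ℕ} [NeZero n] (t : Multiset (ZMod n)) : ((mNormSum t : ℕ) : ZMod n) = t.sum := by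
  rw [mNormSum, Nat.cast_multiset_sum, Multiset.map_map]
  have : (t.map (Nat.cast ∘ ZMod.val) : Multiset (ZMod n)) = t.map id :=
    Multiset.map_congr rfl fun a _ ↦ ZMod.natCast_zmod_val a
  rw [this, Multiset.map_id]

/-- Parity at level `6p`: the reduction keeps the parity of the representative. [folklore] -/
private theorem val_castHom_mod_two [NeZero (12 * p)] (hnm : 6 * p ∣ 12 * p) (y : ZMod (12 * p)) :
    (ZMod.castHom hnm (ZMod (6 * p)) y).val % 2 = y.val % 2 := by
  rw [val_castHom, Nat.mod_mod_of_dvd _ (⟨3 * p, by ring⟩ : 2 ∣ 6 * p)]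

/-- Parity at level `6p`: negation keeps parity. [folklore] -/
private theorem val_neg_mod_two_six [NeZero (6 * p)] (a : ZMod (6 * p)) : (-a).val % 2 = a.val % 2 := by
  rw [ZMod.neg_val]
  split_ifs with h
  · rw [h, ZMod.val_zero]
  · have := ZMod.val_lt a
    omega

/-- Parity at level `6p`: a `k`-multiple with `k` even is even. [folklore] -/
private theorem val_two_mul_mod_two_six [NeZero (6 * p)] (a : ZMod (6 * p)) : ((2 : ZMod (6 * p)) * a).val % 2 = 0 := by
  have h2 : ((2 : ZMod (6 * p))).val % 2 = 0 := by
    rw [show (2 : ZMod (6 * p)) = ((2 : ℕ) : ZMod (6 * p)) by norm_cast, ZMod.val_natCast]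
    rcases Nat.lt_or_ge 2 (6 * p) with h | h
    · rw [Nat.mod_eq_of_lt h]
    · have : 6 * p = 0 ∨ 6 * p = 1 ∨ 6 * p = 2 := by omega
      rcases this with h0 | h0 | h0
      · exact absurd h0 (NeZero.ne _)
      · omega
      · rw [h0]
  rw [ZMod.val_mul, Nat.mod_mod_of_dvd _ ⟨3 * p, by ring⟩, Nat.mul_mod, h2, zero_mul, Nat.zero_mod]

end Double

/-! ### Indices: pair-freeness of explicit quadruples -/

/-- Two distinct positions of a tuple give a member of the value multiset and a member of its erasure. [folklore] -/
private theorem apply_mem_erase_of_ne {K : ℕ} {X : Type*} [DecidableEq X] (Z : Fin K → X) {i j : Fin K} (hij : i ≠ j) :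
    Z j ∈ (univ.val.map Z).erase (Z i) := by
  by_cases h : Z j = Z i
  · rw [h, ← Multiset.count_pos, Multiset.count_erase_self]
    have h2 : 2 ≤ count (Z i) (univ.val.map Z) := by
      rw [Multiset.count_map]
      have hsub : ({i, j} : Finset (Fin K)).val ≤ univ.val.filter fun k ↦ Z i = Z k := by
        rw [Multiset.le_iff_subset (Finset.nodup _)]
        intro k hk
        rw [Finset.mem_val, Finset.mem_insert, Finset.mem_singleton] at hk
        rw [Multiset.mem_filter]
        rcases hk with rfl | rfl
        · exact ⟨Finset.mem_univ_val _, rfl⟩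
        · exact ⟨Finset.mem_univ_val _, h.symm⟩
      calc 2 = Multiset.card ({i, j} : Finset (Fin K)).val := by rw [Finset.card_val, Finset.card_pair hij]
        _ ≤ _ := Multiset.card_le_card hsub
    omega
  · exact (Multiset.mem_erase_of_ne h).mpr (Multiset.mem_map.mpr ⟨j, Finset.mem_univ_val j, rfl⟩)

/-- Indecomposability of a tuple in terms of its multiset of values. [folklore] -/
private theorem pairfree_of_fun {n : ℕ} {α : Fin 4 → ZMod n} (hind : ∀ i j : Fin 4, i ≠ j → α i + α j ≠ 0) :
    ∀ a ∈ univ.val.map α, ∀ b ∈ (univ.val.map α).erase a, a + b ≠ 0 := by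
  classical
  intro a ha b hb hab
  obtain ⟨i, -, rfl⟩ := Multiset.mem_map.mp ha
  by_cases hba : b = α i
  · have h2 : 2 ≤ count (α i) (univ.val.map α) := by
      have := Multiset.count_pos.mpr (hba ▸ hb)
      rw [Multiset.count_erase_self] at this
      omega
    rw [count_univ_val_map] at h2
    obtain ⟨j, hj, k, hk, hjk⟩ := Finset.one_lt_card.mp h2
    simp only [Finset.mem_filter, Finset.mem_univ, true_and] at hj hk
    exact hind j k hjk (by rw [hj, hk, ← hba]; nth_rw 1 [hba]; exact hab)
  · have hb' : b ∈ univ.val.map α := Multiset.mem_of_mem_erase hb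
    obtain ⟨j, -, rfl⟩ := Multiset.mem_map.mp hb'
    exact hind i j (fun e ↦ hba (by rw [e])) hab

/-- The value multiset of `![a, b, c, d]`. [folklore] -/
private theorem univ_val_map_four {X : Type*} (a b c d : X) : univ.val.map ![a, b, c, d] = {a, b, c, d} := by
  simp; rfl

/-- **Parity count.** A multiset over `ℤ/12p` with sum `0` has an even number of odd entries. [folklore] -/
private theorem even_card_filter_odd [NeZero (12 * p)] {s : Multiset (ZMod (12 * p))} (hs : s.sum = 0) :
    Even (Multiset.card (s.filter fun a ↦ a.val % 2 = 1)) := by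
  have hsum : 12 * p ∣ (s.map ZMod.val).sum := by
    rw [← ZMod.natCast_eq_zero_iff, Nat.cast_multiset_sum, Multiset.map_map]
    have : (s.map (Nat.cast ∘ ZMod.val) : Multiset (ZMod (12 * p))) = s.map id :=
      Multiset.map_congr rfl fun a _ ↦ ZMod.natCast_zmod_val a
    rw [this, Multiset.map_id, hs]
  have h2 : 2 ∣ (s.map ZMod.val).sum := Nat.dvd_trans ⟨6 * p, by ring⟩ hsum
  have key : ∀ t : Multiset (ZMod (12 * p)),
      (t.map ZMod.val).sum % 2 = Multiset.card (t.filter fun a ↦ a.val % 2 = 1) % 2 := by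
    intro t
    induction t using Multiset.induction_on with
    | empty => simp
    | cons a t ih =>
      rw [Multiset.map_cons, Multiset.sum_cons, Multiset.filter_cons, Multiset.card_add, Nat.add_mod, ih]
      split_ifs with ha
      · rw [Multiset.card_singleton]
        omega
      · rw [Multiset.card_zero]
        omega
  have := key s
  rw [Nat.even_iff]
  omega

/-! ### Case I: no odd member — the doubled standard elements of level `6p` -/

/-- **All members even:** `T(s) = 2·σ` with `σ` a pair-free Hodge `4`-multiset of level `6p`, which the level-`6p` theorem
classifies; doubling back, `s = {x, x + 6p, −2x, 6p}`, `{x, x + 6p, 2x + 6p, −4x}` or `{x, x + 4p, x + 8p, −3x}` with `x = 2y`.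
[cite: Shioda1982PicardFermat, §2 p. 726 (𝔍²ₘ(d) ≅ 𝔍²_{m/d}(1)) and Prop. 4 (Q′) p. 729] -/
private theorem case_all_even [NeZero (12 * p)] (hp : p.Prime) (h17 : 17 ≤ p) {s : Multiset (ZMod (12 * p))}
    (hs : IsHodgeMultiset s) (hcard : Multiset.card s = 4) (hpf : ∀ a ∈ s, ∀ b ∈ s.erase a, a + b ≠ 0)
    (hev : ∀ w ∈ s, w.val % 2 = 0) :
    ∃ x : ZMod (12 * p), s = {x, x + K12, -(2 * x), K12} ∨ s = {x, x + K12, 2 * x + K12, -(4 * x)} ∨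
      s = {x, x + D12, x + 2 * D12, -(3 * x)} := by
  classical
  have hp0 := hp.pos
  haveI : NeZero (6 * p) := ⟨by omega⟩
  have hnm : 6 * p ∣ 12 * p := ⟨2, by ring⟩
  set R := ZMod.castHom hnm (ZMod (6 * p)) with hR
  -- enumerate `s`
  obtain ⟨z1, hz1⟩ := Multiset.card_pos_iff_exists_mem.mp (by omega : 0 < Multiset.card s)
  have hct : Multiset.card (s.erase z1) = 3 := by rw [Multiset.card_erase_of_mem hz1, hcard]; rfl
  obtain ⟨z2, z3, z4, ht⟩ := Multiset.card_eq_three.mp hct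
  have hsZ : s = {z1, z2, z3, z4} := by rw [← Multiset.cons_erase hz1, ht]; rfl
  set Z : Fin 4 → ZMod (12 * p) := ![z1, z2, z3, z4] with hZ
  have hZs : univ.val.map Z = s := by rw [hsZ, hZ, univ_val_map_four]
  have hZev : ∀ i, (Z i).val % 2 = 0 := fun i ↦ hev _ (by rw [← hZs]; exact Multiset.mem_map.mpr ⟨i, Finset.mem_univ_val i, rfl⟩)
  -- the transfer `T(s) = σ + σ`
  have hT := isHodgeMultiset_transfer_twelvePrime hp0 hnm (so := 0) (se := s) (by simp) hev (by simpa using hs)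
  rw [Multiset.map_zero, zero_add] at hT
  set σ := s.map fun w ↦ R (half w) with hσ
  have hc4 : Multiset.card σ = 4 := by rw [hσ, Multiset.card_map, hcard]
  have hσH : IsHodgeMultiset σ := by
    have hnorm' := norm_of_add_self hT
    refine ⟨⟨fun a ha ↦ hT.1.1 a (Multiset.mem_add.mpr (Or.inl ha)), ?_⟩, hnorm'⟩
    have h1 := hnorm' 1
    simp only [Units.val_one, one_mul, Multiset.map_id', hc4] at h1
    have hN : mNormSum σ = 2 * (6 * p) := by omega
    have := natCast_mNormSum σ
    rw [hN, show ((2 * (6 * p) : ℕ) : ZMod (6 * p)) = 2 * ((6 * p : ℕ) : ZMod (6 * p)) by push_cast; ring,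
      ZMod.natCast_self, mul_zero] at this
    exact this.symm
  -- `σ` is pair-free (double back)
  set β : Fin 4 → ZMod (6 * p) := fun i ↦ R (half (Z i)) with hβ
  have hβσ : univ.val.map β = σ := by rw [hσ, ← hZs, Multiset.map_map]; rfl
  have hβind : ∀ i j : Fin 4, i ≠ j → β i + β j ≠ 0 := by
    intro i j hij h
    have h' := congrArg dbl h
    rw [dbl_add, dbl_zero, hβ] at h'
    simp only at h'
    rw [dbl_castHom_half hnm (hZev i), dbl_castHom_half hnm (hZev j)] at h'
    exact hpf (Z i) (by rw [← hZs]; exact Multiset.mem_map.mpr ⟨i, Finset.mem_univ_val i, rfl⟩) (Z j)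
      (hZs ▸ apply_mem_erase_of_ne Z hij) h'
  have hσpf : ∀ a ∈ σ, ∀ b ∈ σ.erase a, a + b ≠ 0 := by rw [← hβσ]; exact pairfree_of_fun hβind
  -- the classification at level `6p`
  obtain ⟨y, hy⟩ := classify_hodgeMultiset_sixPrime hp h17 hσH hc4 hσpf
  -- `s = σ.map dbl`
  have hsd : s = σ.map dbl := by
    rw [hσ, Multiset.map_map]
    conv_lhs => rw [← Multiset.map_id s]
    refine Multiset.map_congr rfl fun w hw ↦ ?_
    simp only [Function.comp_apply, id]
    rw [dbl_castHom_half hnm (hev w hw)]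
  refine ⟨dbl y, ?_⟩
  rcases hy with e | e | e
  · left
    rw [hsd, e]
    simp only [Multiset.insert_eq_cons, Multiset.map_cons, Multiset.map_singleton, dbl_add, dbl_neg, dbl_two_mul, dbl_K6 hp0]
  · right; left
    rw [hsd, e]
    simp only [Multiset.insert_eq_cons, Multiset.map_cons, Multiset.map_singleton, dbl_add, dbl_neg, dbl_two_mul,
      dbl_four_mul, dbl_K6 hp0]
  · right; right
    rw [hsd, e]
    simp only [Multiset.insert_eq_cons, Multiset.map_cons, Multiset.map_singleton, dbl_add, dbl_neg, dbl_two_mul,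
      dbl_three_mul, dbl_D6 hp0]

/-! ### Small multiset and coordinate helpers -/

/-- `{a, b} + {c, d} = {a, b, c, d}`. [folklore] -/
private theorem pair_add_pair {X : Type*} (a b c d : X) : ({a, b} : Multiset X) + {c, d} = {a, b, c, d} := by
  simp only [Multiset.insert_eq_cons, Multiset.cons_add, Multiset.singleton_add]

/-- A `4`-multiset whose six pairwise sums are non-zero is pair-free. [folklore] -/
private theorem pairfree_quad {n : ℕ} {a b c d : ZMod n} (hab : a + b ≠ 0) (hac : a + c ≠ 0) (had : a + d ≠ 0)
    (hbc : b + c ≠ 0) (hbd : b + d ≠ 0) (hcd : c + d ≠ 0) :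
    ∀ u ∈ ({a, b, c, d} : Multiset (ZMod n)), ∀ v ∈ (({a, b, c, d} : Multiset (ZMod n))).erase u, u + v ≠ 0 := by
  rw [← univ_val_map_four]
  refine pairfree_of_fun fun i j hij h ↦ ?_
  fin_cases i <;> fin_cases j <;> simp at hij h <;>
    first
    | exact hab (by linear_combination h)
    | exact hac (by linear_combination h)
    | exact had (by linear_combination h)
    | exact hbc (by linear_combination h)
    | exact hbd (by linear_combination h)
    | exact hcd (by linear_combination h)

/-- Pull a member back through `Multiset.map`. [folklore] -/
private theorem exists_cons_of_map_eq_cons {X Y : Type*} [DecidableEq X] [DecidableEq Y] (f : X → Y) {s : Multiset X}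
    {b : Y} {t : Multiset Y} (h : s.map f = b ::ₘ t) : ∃ a s', s = a ::ₘ s' ∧ f a = b ∧ s'.map f = t := by
  have hb : b ∈ s.map f := by rw [h]; exact Multiset.mem_cons_self _ _
  obtain ⟨a, ha, hfa⟩ := Multiset.mem_map.mp hb
  refine ⟨a, s.erase a, (Multiset.cons_erase ha).symm, hfa, ?_⟩
  rw [Multiset.map_erase_of_mem _ _ ha, h, hfa, Multiset.erase_cons_head]

/-- The parity of the first coordinate is the parity of the residue. [folklore] -/
private theorem fst_val_mod_two (h : Nat.Coprime 12 p) [NeZero (12 * p)] (w : ZMod (12 * p)) :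
    (crt h w).1.val % 2 = w.val % 2 := by
  rw [crt_fst, ZMod.val_natCast, Nat.mod_mod_of_dvd _ (by norm_num : 2 ∣ 12)]

/-- `pt 1 1 = 1`. [folklore] -/
private theorem pt_one (h : Nat.Coprime 12 p) : pt h 1 1 = 1 := by
  show (crt h).symm (1, 1) = 1
  exact _root_.map_one (crt h).symm

/-- `pt u 1` is a unit for `u² = 1`. [folklore] -/
private theorem isUnit_pt (h : Nat.Coprime 12 p) {u : ZMod 12} (hu : u * u = 1) : IsUnit (pt h u 1) :=
  IsUnit.of_mul_eq_one (pt h u 1) (by rw [pt_mul, hu, mul_one, pt_one])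

/-- The kernel of the reduction `ℤ/12p → ℤ/6p` is `{0, 6p}`. [folklore] -/
private theorem castHom_eq_zero_iff [NeZero (12 * p)] (hp : 0 < p) (hnm : 6 * p ∣ 12 * p) {w : ZMod (12 * p)} :
    ZMod.castHom hnm (ZMod (6 * p)) w = 0 ↔ w = 0 ∨ w = K12 := by
  haveI : NeZero (6 * p) := ⟨by omega⟩
  constructor
  · intro h0
    have hv := congrArg ZMod.val h0
    rw [val_castHom, ZMod.val_zero] at hv
    have hlt := ZMod.val_lt w
    obtain ⟨k, hk⟩ := Nat.dvd_of_mod_eq_zero hv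
    have hk2 : k < 2 := by
      by_contra hk2
      have : 6 * p * 2 ≤ 6 * p * k := Nat.mul_le_mul_left _ (by omega)
      omega
    interval_cases k
    · left
      apply ZMod.val_injective (12 * p)
      rw [ZMod.val_zero]; omega
    · right
      apply ZMod.val_injective (12 * p)
      rw [val_K hp]; omega
  · rintro (rfl | rfl)
    · exact _root_.map_zero _
    · rw [map_natCast, show ((6 * p : ℕ) : ZMod (6 * p)) = 0 from ZMod.natCast_self _]

/-- Two residues with the same reduction mod `6p` differ by `0` or `6p`. [folklore] -/
private theorem lift_eq [NeZero (12 * p)] (hp : 0 < p) (hnm : 6 * p ∣ 12 * p) {a b : ZMod (12 * p)}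
    (h : ZMod.castHom hnm (ZMod (6 * p)) a = ZMod.castHom hnm (ZMod (6 * p)) b) : a = b ∨ a = b + K12 := by
  have : ZMod.castHom hnm (ZMod (6 * p)) (a - b) = 0 := by rw [_root_.map_sub, h, sub_self]
  rcases (castHom_eq_zero_iff hp hnm).mp this with e | e
  · left; linear_combination e
  · right; linear_combination e

/-- The coordinates of a `δ`-quadruple `{v, v + 2p, v − 2p, −3v}`, `v = pt(e, c)`. [folklore] -/
private theorem map_crt_delta (h : Nat.Coprime 12 p) [NeZero (12 * p)] (e : ZMod 12) (c : ZMod p) :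
    Multiset.map (crt h) {pt h e c, pt h e c + E12, pt h e c - E12, -(3 * pt h e c)} =
      {(e, c), (e + 2 * π, c), (e - 2 * π, c), (-(3 * e), -(3 * c))} := by
  rw [natCast_mul_P h 2, Nat.cast_ofNat, pt_add, pt_sub,
    show (3 : ZMod (12 * p)) = ((3 : ℕ) : ZMod (12 * p)) by norm_num, natCast_mul_pt, neg_pt]
  simp only [Multiset.insert_eq_cons, Multiset.map_cons, Multiset.map_singleton, crt_pt, add_zero, sub_zero, Nat.cast_ofNat]

/-! ### Case 0: all members in the fibre `0` — the level `12` -/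

/-- The level-`12` multiset `{k₁, k₂, k₃, −(k₁ + k₂ + k₃)}`. [folklore] -/
private def lev (k₁ k₂ k₃ : ZMod 12) : Multiset (ZMod 12) := {k₁, k₂, k₃, -(k₁ + k₂ + k₃)}

set_option maxHeartbeats 0 in
set_option synthInstance.maxHeartbeats 0 in
set_option synthInstance.maxSize 4096 in
/-- **The pair-free Hodge quadruples of level `12`** (kernel enumeration of the `12³` triples; `16` multisets): a `4`-multiset of
non-zero residues mod `12` with `Σ = 0`, satisfying the four norm equations `Σ⟨u k⟩ = 24` (`u = 1, 5, 7, 11`) and without a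
pair is `{k, k + 6, −2k, 6}`, `{k, k + 6, 2k + 6, −4k}`, `{k, k + 4, k + 8, −3k}`, or a unit multiple `u·{1, 4, 9, 10}`,
`u·{1, 6, 8, 9}` of one of the two representatives printed in Tabelle 1 at `N = 12`.
[cite: MeyerNeutsch1981Fermatquadrupel, Tabelle 1 p. 54 (N = 12)] [cite: Shioda1982PicardFermat, table p. 727 (m = 12)] -/
private theorem level_twelve_pairfree : ∀ k₁ k₂ k₃ : ZMod 12,
    (∀ a ∈ lev k₁ k₂ k₃, a ≠ 0) → ((lev k₁ k₂ k₃).map ZMod.val).sum = 24 →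
    (∀ a ∈ lev k₁ k₂ k₃, ∀ b ∈ (lev k₁ k₂ k₃).erase a, a + b ≠ 0) →
    ((lev k₁ k₂ k₃).map fun k ↦ (5 * k).val).sum = 24 →
    ((lev k₁ k₂ k₃).map fun k ↦ (7 * k).val).sum = 24 →
    ((lev k₁ k₂ k₃).map fun k ↦ (11 * k).val).sum = 24 →
    ∃ k : ZMod 12, lev k₁ k₂ k₃ = {k, k + 6, -(2 * k), 6} ∨ lev k₁ k₂ k₃ = {k, k + 6, 2 * k + 6, -(4 * k)} ∨
      lev k₁ k₂ k₃ = {k, k + 4, k + 8, -(3 * k)} ∨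
      (k * k = 1 ∧ (lev k₁ k₂ k₃ = {k, 4 * k, 9 * k, 10 * k} ∨ lev k₁ k₂ k₃ = {k, 6 * k, 8 * k, 9 * k})) := by
  unfold lev
  decide +kernel

/-- The units of `ℤ/12` by representative. [folklore] -/
private theorem unit_val {k : ZMod 12} (hk : k * k = 1) : k.val = 1 ∨ k.val = 5 ∨ k.val = 7 ∨ k.val = 11 := by
  revert k; decide

/-- `φ k = pt(kπ, 0)`: the multiple `⟨k⟩·p` of `p` in `ℤ/12p`. [folklore] -/
private def phi (h : Nat.Coprime 12 p) (k : ZMod 12) : ZMod (12 * p) := pt h (k * π) 0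

/-- `φ` is additive. [folklore] -/
private theorem phi_add (h : Nat.Coprime 12 p) (a b : ZMod 12) : phi h (a + b) = phi h a + phi h b := by
  unfold phi; rw [add_mul, pt_add, add_zero]

/-- `φ(−a) = −φ a`. [folklore] -/
private theorem phi_neg (h : Nat.Coprime 12 p) (a : ZMod 12) : phi h (-a) = -phi h a := by
  unfold phi; rw [neg_pt, neg_zero, neg_mul]

/-- `φ(n a) = n φ a`. [folklore] -/
private theorem phi_natCast_mul (h : Nat.Coprime 12 p) (n : ℕ) (a : ZMod 12) :
    phi h (n * a) = (n : ZMod (12 * p)) * phi h a := by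
  unfold phi; rw [natCast_mul_pt, mul_zero, mul_assoc]

/-- `φ(2a) = 2φ a`. [folklore] -/
private theorem phi_two_mul (h : Nat.Coprime 12 p) (a : ZMod 12) : phi h (2 * a) = 2 * phi h a := by
  exact_mod_cast phi_natCast_mul h 2 a

/-- `φ(3a) = 3φ a`. [folklore] -/
private theorem phi_three_mul (h : Nat.Coprime 12 p) (a : ZMod 12) : phi h (3 * a) = 3 * phi h a := by
  exact_mod_cast phi_natCast_mul h 3 a

/-- `φ(4a) = 4φ a`. [folklore] -/
private theorem phi_four_mul (h : Nat.Coprime 12 p) (a : ZMod 12) : phi h (4 * a) = 4 * phi h a := by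
  exact_mod_cast phi_natCast_mul h 4 a

/-- `φ(6a) = 6φ a`. [folklore] -/
private theorem phi_six_mul (h : Nat.Coprime 12 p) (a : ZMod 12) : phi h (6 * a) = 6 * phi h a := by
  exact_mod_cast phi_natCast_mul h 6 a

/-- `φ(8a) = 8φ a`. [folklore] -/
private theorem phi_eight_mul (h : Nat.Coprime 12 p) (a : ZMod 12) : phi h (8 * a) = 8 * phi h a := by
  exact_mod_cast phi_natCast_mul h 8 a

/-- `φ(9a) = 9φ a`. [folklore] -/
private theorem phi_nine_mul (h : Nat.Coprime 12 p) (a : ZMod 12) : phi h (9 * a) = 9 * phi h a := by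
  exact_mod_cast phi_natCast_mul h 9 a

/-- `φ(10a) = 10φ a`. [folklore] -/
private theorem phi_ten_mul (h : Nat.Coprime 12 p) (a : ZMod 12) : phi h (10 * a) = 10 * phi h a := by
  exact_mod_cast phi_natCast_mul h 10 a

/-- `φ 6 = 6p`. [folklore] -/
private theorem phi_six (h : Nat.Coprime 12 p) [NeZero (12 * p)] (hp : p.Prime) (h5 : 5 ≤ p) : phi h 6 = K12 := by
  unfold phi; rw [(pi_facts hp h5).2, sixP_eq_pt h hp h5]

/-- `φ 4 = 4p`. [folklore] -/
private theorem phi_four (h : Nat.Coprime 12 p) [NeZero (12 * p)] : phi h 4 = D12 := by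
  unfold phi; rw [natCast_mul_P h 4, Nat.cast_ofNat]

/-- `φ 8 = 2·4p`. [folklore] -/
private theorem phi_eight (h : Nat.Coprime 12 p) [NeZero (12 * p)] : phi h 8 = 2 * D12 := by
  rw [show (8 : ZMod 12) = 2 * 4 by decide, phi_two_mul, phi_four]

/-- `φ k = ⟨k⟩p`. [folklore] -/
private theorem phi_eq_natCast (h : Nat.Coprime 12 p) [NeZero (12 * p)] (k : ZMod 12) :
    phi h k = ((k.val * p : ℕ) : ZMod (12 * p)) := by
  unfold phi; rw [natCast_mul_P h, ZMod.natCast_zmod_val]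

/-- `⟨φ k⟩ = ⟨k⟩ p`. [folklore] -/
private theorem val_phi (h : Nat.Coprime 12 p) [NeZero (12 * p)] (hp : 0 < p) (k : ZMod 12) : (phi h k).val = k.val * p := by
  rw [phi_eq_natCast, ZMod.val_natCast, Nat.mod_eq_of_lt (by have := ZMod.val_lt k; nlinarith)]

/-- `ψ w = (w mod 12)·π`, an additive map `ℤ/12p → ℤ/12` inverting `φ` on the fibre `0`. [folklore] -/
private def psi (h : Nat.Coprime 12 p) : ZMod (12 * p) →+ ZMod 12 where
  toFun w := (crt h w).1 * π
  map_zero' := by simp only [_root_.map_zero, Prod.fst_zero, zero_mul]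
  map_add' a b := by simp only [_root_.map_add, Prod.fst_add, add_mul]

/-- Unfolding `ψ`. [folklore] -/
private theorem psi_apply (h : Nat.Coprime 12 p) (w : ZMod (12 * p)) : psi h w = (crt h w).1 * π := rfl

/-- `φ(ψ w) = w` on the fibre `0`. [folklore] -/
private theorem phi_psi (h : Nat.Coprime 12 p) [NeZero (12 * p)] (hp : p.Prime) (h5 : 5 ≤ p) {w : ZMod (12 * p)}
    (hw : (crt h w).2 = 0) : phi h (psi h w) = w := by
  rw [psi_apply, phi, mul_assoc, (pi_facts hp h5).1, mul_one]
  conv_rhs => rw [← pt_crt h w, hw]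

/-- On the fibre `0`, `ψ w = 0` forces `w = 0`. [folklore] -/
private theorem eq_zero_of_psi (h : Nat.Coprime 12 p) [NeZero (12 * p)] (hp : p.Prime) (h5 : 5 ≤ p) {w : ZMod (12 * p)}
    (hw : (crt h w).2 = 0) (h0 : psi h w = 0) : w = 0 := by
  rw [← phi_psi h hp h5 hw, h0, phi, zero_mul, pt_zero]

/-- **All members in the fibre `0`** (multiples of `p`): `s = φ(M)` for a pair-free Hodge quadruple `M` of level `12` (the norm
equation of `s` at the unit `pt(u, 1)` is the norm equation of `M` at `u`), read off from `level_twelve_pairfree`.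
[cite: Shioda1982PicardFermat, §2 p. 726 (𝔍²ₘ(d) ≅ 𝔍²_{m/d}(1)) and table p. 727 (m = 12)] [cite: MeyerNeutsch1981Fermatquadrupel, Tabelle 1 p. 54 (N = 12)] -/
private theorem fibre_zero (h : Nat.Coprime 12 p) [NeZero (12 * p)] (hp : p.Prime) (h17 : 17 ≤ p)
    {s : Multiset (ZMod (12 * p))} (hs : IsHodgeMultiset s) (hcard : Multiset.card s = 4)
    (hind : ∀ a ∈ s, ∀ b ∈ s.erase a, a + b ≠ 0) (h0 : ∀ w ∈ s, (crt h w).2 = 0) :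
    ∃ x : ZMod (12 * p), s = {x, x + K12, -(2 * x), K12} ∨ s = {x, x + K12, 2 * x + K12, -(4 * x)} ∨
      s = {x, x + D12, x + 2 * D12, -(3 * x)} ∨
      ((∃ t : ℕ, (t = 1 ∨ t = 5 ∨ t = 7 ∨ t = 11) ∧ x = ((t * p : ℕ) : ZMod (12 * p))) ∧
        (s = {x, 4 * x, 9 * x, 10 * x} ∨ s = {x, 6 * x, 8 * x, 9 * x})) := by
  classical
  have h5 : 5 ≤ p := by omega
  have hp0 := hp.pos
  set M := s.map (psi h) with hM
  have hsM : s = M.map (phi h) := by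
    rw [hM, Multiset.map_map]
    conv_lhs => rw [← Multiset.map_id s]
    refine Multiset.map_congr rfl fun w hw ↦ ?_
    simp only [Function.comp_apply, id]
    exact (phi_psi h hp h5 (h0 w hw)).symm
  have hcM : Multiset.card M = 4 := by rw [hM, Multiset.card_map, hcard]
  -- (i) non-zero
  have hM0 : ∀ a ∈ M, a ≠ 0 := by
    intro a ha ha0
    rw [hM] at ha
    obtain ⟨w, hw, rfl⟩ := Multiset.mem_map.mp ha
    exact hs.1.1 w hw (eq_zero_of_psi h hp h5 (h0 w hw) ha0)
  -- (ii) no pair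
  have hMpf : ∀ a ∈ M, ∀ b ∈ M.erase a, a + b ≠ 0 := by
    intro a ha b hb hab
    rw [hM] at ha
    obtain ⟨w, hw, rfl⟩ := Multiset.mem_map.mp ha
    rw [hM, ← Multiset.map_erase_of_mem _ _ hw] at hb
    obtain ⟨w', hw', rfl⟩ := Multiset.mem_map.mp hb
    have hw's : w' ∈ s := Multiset.mem_of_mem_erase hw'
    refine hind w hw w' hw' (eq_zero_of_psi h hp h5 ?_ ?_)
    · rw [_root_.map_add, Prod.snd_add, h0 w hw, h0 w' hw's, add_zero]
    · rw [_root_.map_add, hab]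
  -- (iii) the norm equations at the units `pt(u, 1)`
  have hnormM : ∀ u : ZMod 12, u * u = 1 → (M.map fun k ↦ (u * k).val).sum = 24 := by
    intro u hu
    obtain ⟨t, ht⟩ := isUnit_pt h hu
    have key := hs.2 t
    rw [hcard, hsM, Multiset.map_map] at key
    have e : (M.map ((fun x ↦ (t : ZMod (12 * p)) * x) ∘ phi h)) = M.map (fun k ↦ phi h (u * k)) := by
      refine Multiset.map_congr rfl fun k _ ↦ ?_
      simp only [Function.comp_apply, ht, phi]
      rw [pt_mul, one_mul, mul_assoc]
    rw [e, mNormSum, Multiset.map_map] at key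
    have e2 : (M.map (ZMod.val ∘ fun k ↦ phi h (u * k))) = M.map (fun k ↦ (u * k).val * p) := by
      refine Multiset.map_congr rfl fun k _ ↦ ?_
      simp only [Function.comp_apply, val_phi h hp0]
    rw [e2, Multiset.sum_map_mul_right] at key
    have : (M.map fun k ↦ (u * k).val).sum * p = 24 * p := by linarith
    exact Nat.eq_of_mul_eq_mul_right hp0 this
  -- (iv) enumerate `M` and apply `level_twelve_pairfree`
  obtain ⟨k₁, hk₁⟩ := Multiset.card_pos_iff_exists_mem.mp (by omega : 0 < Multiset.card M)
  have hct : Multiset.card (M.erase k₁) = 3 := by rw [Multiset.card_erase_of_mem hk₁, hcM]; rfl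
  obtain ⟨k₂, k₃, k₄, ht⟩ := Multiset.card_eq_three.mp hct
  have hMk : M = {k₁, k₂, k₃, k₄} := by rw [← Multiset.cons_erase hk₁, ht]; rfl
  have hsum : M.sum = 0 := by rw [hM, ← map_multiset_sum, hs.1.2, _root_.map_zero]
  have hk₄ : k₄ = -(k₁ + k₂ + k₃) := by
    rw [hMk] at hsum
    simp only [Multiset.insert_eq_cons, Multiset.sum_cons, Multiset.sum_singleton] at hsum
    linear_combination hsum
  have hML : M = lev k₁ k₂ k₃ := by rw [hMk, hk₄]; rfl
  rw [hML] at hM0 hMpf hnormM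
  have h1 := hnormM 1 (one_mul 1)
  simp only [one_mul] at h1
  obtain ⟨k, hk⟩ := level_twelve_pairfree k₁ k₂ k₃ hM0 h1 hMpf (hnormM 5 (by decide)) (hnormM 7 (by decide))
    (hnormM 11 (by decide))
  refine ⟨phi h k, ?_⟩
  rw [hsM, hML]
  rcases hk with e | e | e | ⟨hkk, e⟩
  · left
    rw [e]
    simp only [Multiset.insert_eq_cons, Multiset.map_cons, Multiset.map_singleton, phi_add, phi_neg, phi_two_mul,
      phi_six h hp h5]
  · right; left
    rw [e]
    simp only [Multiset.insert_eq_cons, Multiset.map_cons, Multiset.map_singleton, phi_add, phi_neg, phi_two_mul,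
      phi_four_mul, phi_six h hp h5]
  · right; right; left
    rw [e]
    simp only [Multiset.insert_eq_cons, Multiset.map_cons, Multiset.map_singleton, phi_add, phi_neg, phi_three_mul,
      phi_four, phi_eight]
  · right; right; right
    refine ⟨⟨k.val, unit_val hkk, phi_eq_natCast h k⟩, ?_⟩
    rcases e with e | e
    · left
      rw [e]
      simp only [Multiset.insert_eq_cons, Multiset.map_cons, Multiset.map_singleton, phi_four_mul, phi_nine_mul,
        phi_ten_mul]
    · right
      rw [e]
      simp only [Multiset.insert_eq_cons, Multiset.map_cons, Multiset.map_singleton, phi_six_mul, phi_eight_mul,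
        phi_nine_mul]

/-! ### Case II: two odd members -/

/-- **Two odd members, one off the fibre `0`:** the odd members are `x, x + 6p` (`period_two`), `T(s) = 2·{x̄, ẑ, ŵ}` and
`{x̄, ẑ, ŵ, 3p}` is a Hodge quadruple of level `6p`; it has a pair exactly when `s = α_x`, and otherwise it is `A_y` with
`y ∈ {x̄, x̄ + 3p}` (`B_y`, `C_y` cannot contain `3p` next to the class `x̄ ∉ pℤ/6p`), i.e. `s = β_x`.
[cite: Shioda1982PicardFermat, Prop. 4 (Q′) p. 729] [cite: AokiShioda1983, §2 Theorem (𝔅²ₘ) (ii) a), b), p. 3] -/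
private theorem case_two_odd (h : Nat.Coprime 12 p) [NeZero (12 * p)] (hp : p.Prime) (h17 : 17 ≤ p)
    {s : Multiset (ZMod (12 * p))} (hs : IsHodgeMultiset s) (hpf : ∀ a ∈ s, ∀ b ∈ s.erase a, a + b ≠ 0)
    {x y z w : ZMod (12 * p)} (hsx : s = {x, y, z, w}) (hx1 : x.val % 2 = 1) (hz0 : z.val % 2 = 0)
    (hw0 : w.val % 2 = 0) (hxc : (crt h x).2 ≠ 0) :
    s = {x, x + K12, -(2 * x), K12} ∨ s = {x, x + K12, 2 * x + K12, -(4 * x)} := by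
  classical
  haveI := Fact.mk hp
  have hp0 := hp.pos
  have hp2 : p % 2 = 1 := Nat.odd_iff.mp (hp.odd_of_ne_two (by omega))
  have h5 : 5 ≤ p := by omega
  haveI : NeZero (6 * p) := ⟨by omega⟩
  have hnm : 6 * p ∣ 12 * p := ⟨2, by ring⟩
  have hx : x ∈ s := by rw [hsx]; simp
  have hy : y ∈ s.erase x := by rw [hsx, Multiset.insert_eq_cons, Multiset.erase_cons_head]; simp
  have hz : z ∈ s := by rw [hsx]; simp
  have hw : w ∈ s := by rw [hsx]; simp
  have hz_ne : z ≠ 0 := hs.1.1 z hz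
  have hw_ne : w ≠ 0 := hs.1.1 w hw
  -- Step 1: `y = x + 6p` by the relations U, III on the odd part `{crt x, crt y}`
  have hRel := rels_of_isHodgeMultiset h hp h17 hs
  have hsw : s = {z, w, x, y} := by
    rw [hsx]; simp only [Multiset.insert_eq_cons, ← Multiset.singleton_add]; abel
  rw [hsw] at hRel
  simp only [Multiset.insert_eq_cons, Multiset.map_cons, Multiset.map_singleton] at hRel
  have hO := (hRel.odd.of_cons_even (by rw [fst_val_mod_two]; exact hz0)).of_cons_even
    (by rw [fst_val_mod_two]; exact hw0)
  have hex : (crt h x).1.val % 2 = 1 := by rw [fst_val_mod_two]; exact hx1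
  have hyx : (((crt h y).1, (crt h y).2) : ZMod 12 × ZMod p) ≠ -((crt h x).1, (crt h x).2) := by
    rw [Prod.mk.eta, Prod.mk.eta, ← _root_.map_neg, (crt h).injective.ne_iff]
    intro e; exact hpf x hx y hy (by rw [e, add_neg_cancel])
  obtain ⟨he', hc'⟩ := period_two hp h17 hO (e := (crt h x).1) (c := (crt h x).2) (e' := (crt h y).1)
    (c' := (crt h y).2) (by simp only [Prod.mk.eta, Multiset.insert_eq_cons]) hex hxc hyx
  have hyK : y = x + K12 := by
    have e1 : pt h ((crt h x).1 + 6) (crt h x).2 = pt h (crt h x).1 (crt h x).2 + pt h 6 0 := by rw [pt_add, add_zero]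
    rw [← pt_crt h y, he', hc', e1, pt_crt, sixP_eq_pt h hp h5]
  subst hyK
  -- Step 2: the transfer `T(s) = 2·{x̄, ẑ, ŵ}`
  have hxK1 : (x + K12).val % 2 = 1 := by
    rcases val_add_K hp0 x with ⟨e, -⟩ | ⟨e, -⟩ <;> omega
  have hsplit : s = ({x, x + K12} : Multiset (ZMod (12 * p))) + {z, w} := by rw [hsx, pair_add_pair]
  have hT := isHodgeMultiset_transfer_twelvePrime hp0 hnm (so := {x, x + K12}) (se := {z, w})
    (by intro v hv; simp only [Multiset.insert_eq_cons, Multiset.mem_cons, Multiset.mem_singleton] at hv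
        rcases hv with rfl | rfl <;> assumption)
    (by intro v hv; simp only [Multiset.insert_eq_cons, Multiset.mem_cons, Multiset.mem_singleton] at hv
        rcases hv with rfl | rfl <;> assumption)
    (hsplit ▸ hs)
  have hRK : ZMod.castHom hnm (ZMod (6 * p)) (x + K12) = ZMod.castHom hnm (ZMod (6 * p)) x := by
    rw [_root_.map_add, map_natCast, ZMod.natCast_self, add_zero]
  simp only [Multiset.insert_eq_cons, Multiset.map_cons, Multiset.map_singleton, hRK] at hT
  set xb := ZMod.castHom hnm (ZMod (6 * p)) x with hxb
  set zt := ZMod.castHom hnm (ZMod (6 * p)) (half z) with hzt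
  set wt := ZMod.castHom hnm (ZMod (6 * p)) (half w) with hwt
  have hxb0 : xb ≠ 0 := castHom_ne_zero_of_odd hnm hx1
  have hzt0 : zt ≠ 0 := castHom_half_ne_zero hnm hz_ne hz0
  have hwt0 : wt ≠ 0 := castHom_half_ne_zero hnm hw_ne hw0
  have hK60 : K6 ≠ 0 := K6_ne_zero hp0
  have hxodd : xb.val % 2 = 1 := by rw [hxb, val_castHom_mod_two hnm, hx1]
  -- `x̄ ∉ pℤ/6p`
  set ρ := ZMod.castHom (dvd_mul_left p 6) (ZMod p) with hρ
  have hρR : ∀ v : ZMod (12 * p), ρ (ZMod.castHom hnm (ZMod (6 * p)) v) = (crt h v).2 := by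
    intro v
    rw [crt_snd, hρ, ZMod.castHom_apply, ZMod.cast_eq_val, val_castHom, ZMod.natCast_eq_natCast_iff',
      Nat.mod_mod_of_dvd _ (dvd_mul_left p 6)]
  have hρK : ρ K6 = 0 := by rw [map_natCast, Nat.cast_mul, ZMod.natCast_self, mul_zero]
  have hρD : ρ D6 = 0 := by rw [map_natCast, Nat.cast_mul, ZMod.natCast_self, mul_zero]
  have hxbρ : ρ xb ≠ 0 := by rw [hxb, hρR]; exact hxc
  have hxbK : xb ≠ K6 := fun e ↦ hxbρ (by rw [e, hρK])
  -- norms and sum of `{x̄, ẑ, ŵ}`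
  obtain ⟨⟨-, hTsum⟩, hTnorm⟩ := hT
  have hA : ∀ v : (ZMod (6 * p))ˣ,
      ((v : ZMod (6 * p)) * xb).val + ((v : ZMod (6 * p)) * zt).val + ((v : ZMod (6 * p)) * wt).val = 9 * p := by
    intro v
    have e := hTnorm v
    simp only [Multiset.map_add, Multiset.map_cons, Multiset.map_singleton, mNormSum_add, mNormSum_cons,
      Multiset.card_add, Multiset.card_cons, Multiset.card_singleton] at e
    simp only [mNormSum, Multiset.map_singleton, Multiset.sum_singleton] at e
    omega
  have hsum3 : xb + zt + wt = K6 := by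
    have h2 : (2 : ZMod (6 * p)) * (xb + zt + wt) = 0 := by
      simp only [Multiset.sum_add, Multiset.sum_cons, Multiset.sum_singleton] at hTsum
      linear_combination hTsum
    rcases (two_mul_eq_zero_sixP hp0).mp h2 with e | e
    · exfalso
      have h1 := hA 1
      simp only [Units.val_one, one_mul] at h1
      have hcast : (((xb.val + zt.val + wt.val : ℕ)) : ZMod (6 * p)) = xb + zt + wt := by
        push_cast; simp only [ZMod.natCast_zmod_val]
      rw [h1, e, show ((9 * p : ℕ) : ZMod (6 * p)) = K6 + ((6 * p : ℕ) : ZMod (6 * p)) by push_cast; ring,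
        ZMod.natCast_self, add_zero] at hcast
      exact hK60 hcast
    · exact e
  -- `τ = {x̄, ẑ, ŵ, 3p}` is a Hodge quadruple of level `6p`
  have hτ : IsHodgeMultiset ({xb, zt, wt, K6} : Multiset (ZMod (6 * p))) := by
    refine ⟨⟨?_, ?_⟩, fun v ↦ ?_⟩
    · intro a ha
      simp only [Multiset.insert_eq_cons, Multiset.mem_cons, Multiset.mem_singleton] at ha
      rcases ha with rfl | rfl | rfl | rfl <;> assumption
    · simp only [Multiset.insert_eq_cons, Multiset.sum_cons, Multiset.sum_singleton]
      linear_combination hsum3 - neg_K6 (p := p)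
    · have hvK : ((v : ZMod (6 * p)) * K6).val = 3 * p := by
        rw [unit_mul_natCast_half (m := 6 * p) (K := 3 * p) (by ring) v, val_K6 hp0]
      simp only [Multiset.insert_eq_cons, Multiset.map_cons, Multiset.map_singleton, mNormSum_cons, Multiset.card_cons,
        Multiset.card_singleton]
      simp only [mNormSum, Multiset.map_singleton, Multiset.sum_singleton, hvK]
      have := hA v
      omega
  -- the doubles
  have hdx : dbl xb = 2 * x := dbl_castHom hnm x
  have hdz : dbl zt = z := dbl_castHom_half hnm hz0
  have hdw : dbl wt = w := dbl_castHom_half hnm hw0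
  have hdK : dbl K6 = K12 := dbl_K6 hp0
  -- (i) `τ` has a pair: `s = α_x`
  by_cases h1 : xb + zt = 0
  · left
    have ezt : zt = -xb := by linear_combination h1
    have ewt : wt = K6 := by linear_combination hsum3 - h1
    have ez : z = -(2 * x) := by rw [← hdz, ezt, dbl_neg, hdx]
    have ew : w = K12 := by rw [← hdw, ewt, hdK]
    rw [hsx, ez, ew]
  by_cases h2 : xb + wt = 0
  · left
    have ewt : wt = -xb := by linear_combination h2
    have ezt : zt = K6 := by linear_combination hsum3 - h2
    have ez : z = K12 := by rw [← hdz, ezt, hdK]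
    have ew : w = -(2 * x) := by rw [← hdw, ewt, dbl_neg, hdx]
    rw [hsx, ez, ew]
    simp only [Multiset.insert_eq_cons, ← Multiset.singleton_add]; abel
  -- (ii) `τ` is pair-free: `τ = A_y`, `y ∈ {x̄, x̄ + 3p}`, and `s = β_x`
  right
  have h3 : zt + wt ≠ 0 := fun e ↦ hxbK (by linear_combination hsum3 - e)
  have h4 : zt ≠ K6 := fun e ↦ h2 (by linear_combination hsum3 - e)
  have h5' : wt ≠ K6 := fun e ↦ h1 (by linear_combination hsum3 - e)
  have hτpf : ∀ a ∈ ({xb, zt, wt, K6} : Multiset (ZMod (6 * p))), ∀ b ∈ (({xb, zt, wt, K6} : Multiset (ZMod (6 * p)))).erase a,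
      a + b ≠ 0 :=
    pairfree_quad h1 h2 (fun e ↦ hxbK (by linear_combination e + neg_K6 (p := p))) h3
      (fun e ↦ h4 (by linear_combination e + neg_K6 (p := p))) (fun e ↦ h5' (by linear_combination e + neg_K6 (p := p)))
  have hc4 : Multiset.card ({xb, zt, wt, K6} : Multiset (ZMod (6 * p))) = 4 := rfl
  obtain ⟨y, hy⟩ := classify_hodgeMultiset_sixPrime hp h17 hτ hc4 hτpf
  rcases hy with e | e | e
  · -- type A: cancel `3p`
    have e3 : ({xb, zt, wt} : Multiset (ZMod (6 * p))) = {y, y + K6, -(2 * y)} := by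
      have e' : ({xb, zt, wt} : Multiset (ZMod (6 * p))) + {K6} = {y, y + K6, -(2 * y)} + {K6} := by
        simpa only [Multiset.insert_eq_cons, Multiset.cons_add, Multiset.singleton_add] using e
      exact add_right_cancel e'
    have hxmem3 : xb ∈ ({y, y + K6, -(2 * y)} : Multiset (ZMod (6 * p))) := by rw [← e3]; simp
    simp only [Multiset.insert_eq_cons, Multiset.mem_cons, Multiset.mem_singleton] at hxmem3
    obtain ⟨y', e4, hy'⟩ : ∃ y' : ZMod (6 * p),
        ({xb, zt, wt} : Multiset (ZMod (6 * p))) = {y', y' + K6, -(2 * y')} ∧ xb = y' := by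
      rcases hxmem3 with e4 | e4 | e4
      · exact ⟨y, e3, e4⟩
      · refine ⟨y + K6, ?_, e4⟩
        rw [e3, show y + K6 + K6 = y by linear_combination -(neg_K6 (p := p)),
          show -(2 * (y + K6)) = -(2 * y) by linear_combination neg_K6 (p := p)]
        simp only [Multiset.insert_eq_cons, ← Multiset.singleton_add]; abel
      · exfalso
        rw [e4, val_neg_mod_two_six, val_two_mul_mod_two_six] at hxodd
        omega
    rw [← hy'] at e4
    have e5 : ({zt, wt} : Multiset (ZMod (6 * p))) = {xb + K6, -(2 * xb)} := by
      simp only [Multiset.insert_eq_cons] at e4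
      exact (Multiset.cons_inj_right _).mp e4
    have e6 := congrArg (Multiset.map dbl) e5
    simp only [Multiset.insert_eq_cons, Multiset.map_cons, Multiset.map_singleton, hdz, hdw, dbl_add, dbl_neg,
      dbl_two_mul, hdx, hdK] at e6
    rw [hsx, show -(4 * x) = -(2 * (2 * x)) by ring]
    simp only [Multiset.insert_eq_cons]
    rw [e6]
  · -- type B: `3p ∈ B_y` is impossible
    exfalso
    have hmem : K6 ∈ ({y, y + K6, 2 * y + K6, -(4 * y)} : Multiset (ZMod (6 * p))) := by rw [← e]; simp
    have hne : ∀ a ∈ ({y, y + K6, 2 * y + K6, -(4 * y)} : Multiset (ZMod (6 * p))), a ≠ 0 := by rw [← e]; exact hτ.1.1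
    have hy0 : y ≠ 0 := hne y (by simp)
    have hyK0 : y + K6 ≠ 0 := hne (y + K6) (by simp)
    simp only [Multiset.insert_eq_cons, Multiset.mem_cons, Multiset.mem_singleton] at hmem
    rcases hmem with e' | e' | e' | e'
    · exact hyK0 (by rw [← e']; linear_combination -(neg_K6 (p := p)))
    · exact hy0 (by linear_combination -e')
    · have h2y : (2 : ZMod (6 * p)) * y = 0 := by linear_combination -e'
      rcases (two_mul_eq_zero_sixP hp0).mp h2y with e'' | e''
      · exact hy0 e''
      · exact hyK0 (by rw [e'']; linear_combination -(neg_K6 (p := p)))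
    · have : (K6).val % 2 = (-(4 * y)).val % 2 := by rw [e']
      rw [val_K6 hp0, val_neg_mod_two_six, show (4 : ZMod (6 * p)) * y = 2 * (2 * y) by ring,
        val_two_mul_mod_two_six] at this
      omega
  · -- type C: `3p ∈ C_y` forces `y ∈ pℤ/6p`, but `x̄ ∈ C_y` is not in `pℤ/6p`
    exfalso
    have hmem : K6 ∈ ({y, y + D6, y + 2 * D6, -(3 * y)} : Multiset (ZMod (6 * p))) := by rw [← e]; simp
    have hxmem' : xb ∈ ({y, y + D6, y + 2 * D6, -(3 * y)} : Multiset (ZMod (6 * p))) := by rw [← e]; simp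
    have hρy : ρ y = 0 := by
      simp only [Multiset.insert_eq_cons, Multiset.mem_cons, Multiset.mem_singleton] at hmem
      rcases hmem with e' | e' | e' | e'
      · rw [← e', hρK]
      · have := congrArg ρ e'
        rw [hρK, _root_.map_add, hρD, add_zero] at this
        exact this.symm
      · have := congrArg ρ e'
        rw [hρK, _root_.map_add, _root_.map_mul, map_ofNat, hρD, mul_zero, add_zero] at this
        exact this.symm
      · have := congrArg ρ e'
        rw [hρK, _root_.map_neg, _root_.map_mul, map_ofNat] at this
        have h' : (3 : ZMod p) * ρ y = 0 := by linear_combination this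
        by_contra hy
        exact (mul_ne_zero_facts hp h17 hy).2.1 h'
    apply hxbρ
    simp only [Multiset.insert_eq_cons, Multiset.mem_cons, Multiset.mem_singleton] at hxmem'
    rcases hxmem' with e' | e' | e' | e' <;> rw [e'] <;>
      simp only [_root_.map_add, _root_.map_neg, _root_.map_mul, map_ofNat, hρy, hρD, mul_zero, add_zero, neg_zero]

/-- **Two odd members, both in the fibre `0`:** impossible. The even members are then `pt(f, c)`, `pt(f′, −c)` with
`f, f′ ∈ {0, 6}` (relation IV, `even_pair`), so the unit `t = pt(1, −1)` fixes the odd members and negates the even ones;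
comparing the norm equations at `1` and `t` gives `⟨x⟩ + ⟨y⟩ = 12p`, i.e. `y = −x`. [cite: Aoki1983, Prop. 2.2] -/
private theorem case_two_odd_fibre (h : Nat.Coprime 12 p) [NeZero (12 * p)] (hp : p.Prime) (h17 : 17 ≤ p)
    {s : Multiset (ZMod (12 * p))} (hs : IsHodgeMultiset s) (hpf : ∀ a ∈ s, ∀ b ∈ s.erase a, a + b ≠ 0)
    {x y z w : ZMod (12 * p)} (hsx : s = {x, y, z, w}) (hx1 : x.val % 2 = 1) (hy1 : y.val % 2 = 1)
    (hz0 : z.val % 2 = 0) (hw0 : w.val % 2 = 0) (hxc : (crt h x).2 = 0) (hyc : (crt h y).2 = 0)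
    (hzc : (crt h z).2 ≠ 0) : False := by
  classical
  haveI := Fact.mk hp
  have hx : x ∈ s := by rw [hsx]; simp
  have hy : y ∈ s.erase x := by rw [hsx, Multiset.insert_eq_cons, Multiset.erase_cons_head]; simp
  have hz : z ∈ s := by rw [hsx]; simp
  have hw : w ∈ s := by rw [hsx]; simp
  have hwz : w ∈ s.erase z := by
    rw [hsx, show ({x, y, z, w} : Multiset (ZMod (12 * p))) = {z, x, y, w} by
      simp only [Multiset.insert_eq_cons, ← Multiset.singleton_add]; abel, Multiset.insert_eq_cons,
      Multiset.erase_cons_head]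
    simp
  have hz_ne : z ≠ 0 := hs.1.1 z hz
  have hw_ne : w ≠ 0 := hs.1.1 w hw
  -- coordinates
  obtain ⟨e₁, rfl⟩ : ∃ e₁, x = pt h e₁ 0 := ⟨(crt h x).1, by conv_lhs => rw [← pt_crt h x, hxc]⟩
  obtain ⟨e₂, rfl⟩ : ∃ e₂, y = pt h e₂ 0 := ⟨(crt h y).1, by conv_lhs => rw [← pt_crt h y, hyc]⟩
  obtain ⟨f, c, rfl⟩ : ∃ f c, z = pt h f c := ⟨_, _, (pt_crt h z).symm⟩
  obtain ⟨f', c', rfl⟩ : ∃ f' c', w = pt h f' c' := ⟨_, _, (pt_crt h w).symm⟩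
  simp only [crt_pt] at hzc
  have hc' : c' = -c := by
    have := congrArg (fun v ↦ (crt h v).2) hs.1.2
    simp only [hsx, Multiset.insert_eq_cons, Multiset.sum_cons, Multiset.sum_singleton, _root_.map_add, Prod.snd_add, crt_pt,
      _root_.map_zero, Prod.snd_zero] at this
    linear_combination this
  subst hc'
  have he₁ : e₁.val % 2 = 1 := by rwa [val_pt_mod_two] at hx1
  have he₂ : e₂.val % 2 = 1 := by rwa [val_pt_mod_two] at hy1
  have hf : f.val % 2 = 0 := by rwa [val_pt_mod_two] at hz0
  have hf' : f'.val % 2 = 0 := by rwa [val_pt_mod_two] at hw0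
  -- relation IV: `f, f′ ∈ {0, 6}`
  have hRel := rels_of_isHodgeMultiset h hp h17 hs
  rw [hsx] at hRel
  simp only [Multiset.insert_eq_cons, Multiset.map_cons, Multiset.map_singleton, crt_pt] at hRel
  have hzw : ((f', -c) : ZMod 12 × ZMod p) ≠ -(f, c) := by
    intro e
    apply hpf _ hz _ hwz
    rw [Prod.neg_mk, Prod.mk.injEq] at e
    rw [e.1, ← neg_pt, add_neg_cancel]
  obtain ⟨hf6, hf'6⟩ := even_pair hp h17 hRel rfl he₁ he₂ hf hf' hzc hzw
  -- the unit `t = pt(1, −1)` and the two norm equations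
  have hu : IsUnit (pt h 1 (-1)) :=
    IsUnit.of_mul_eq_one (pt h 1 (-1)) (by rw [pt_mul, mul_one, neg_mul_neg, mul_one, pt_one])
  obtain ⟨t, ht⟩ := hu
  have n1 := hs.2 1
  have nt := hs.2 t
  rw [hsx] at n1 nt
  simp only [Units.val_one, one_mul, Multiset.map_id', Multiset.insert_eq_cons, Multiset.map_cons,
    Multiset.map_singleton, Multiset.card_cons, Multiset.card_singleton, mNormSum_cons, ht, pt_mul, mul_zero,
    neg_one_mul, neg_zero, neg_neg] at n1 nt
  simp only [mNormSum, Multiset.map_singleton, Multiset.sum_singleton] at n1 nt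
  have hnegf : -f = f := by rcases hf6 with rfl | rfl <;> decide
  have hnegf' : -f' = f' := by rcases hf'6 with rfl | rfl <;> decide
  have ez : pt h f (-c) = -(pt h f c) := by rw [neg_pt, hnegf]
  have ew : pt h f' c = -(pt h f' (-c)) := by rw [neg_pt, hnegf', neg_neg]
  rw [ez, ew, ZMod.neg_val, if_neg hz_ne, ZMod.neg_val, if_neg hw_ne] at nt
  have hlt1 := ZMod.val_lt (pt h f c)
  have hlt2 := ZMod.val_lt (pt h f' (-c))
  have hxy : (pt h e₁ 0).val + (pt h e₂ 0).val = 12 * p := by omega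
  apply hpf _ hx _ hy
  have : (((pt h e₁ 0).val + (pt h e₂ 0).val : ℕ) : ZMod (12 * p)) = 0 := by rw [hxy]; exact ZMod.natCast_self _
  rw [Nat.cast_add, ZMod.natCast_zmod_val, ZMod.natCast_zmod_val] at this
  exact this

/-! ### Case III: four odd members -/

/-- **All members odd, one off the fibre `0`:** `s̄ = s mod 6p` is a Hodge quadruple of level `6p` with odd members. If `s̄` has
no pair it is `C_y` (types `A`, `B` have an even member) and `s` is one of the four lifts of `C_y` with `Σ = 0`: `γ_u` itself,
or a `δ`-quadruple `{v, v + 2p, v − 2p, −3v}`, which violates the relations U/III (`delta_not_rels`); if `s̄` has a pair then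
`s = {u₁, 6p − u₁, u₃, 6p − u₃}`, which violates them too (`halfpair_odd`).
[cite: Shioda1982PicardFermat, Prop. 4 (Q′) p. 729] [cite: AokiShioda1983, §2 Theorem (𝔅²ₘ) (ii) c), p. 3] [cite: Aoki1983, Prop. 2.2] -/
private theorem case_all_odd (h : Nat.Coprime 12 p) [NeZero (12 * p)] (hp : p.Prime) (h17 : 17 ≤ p)
    {s : Multiset (ZMod (12 * p))} (hs : IsHodgeMultiset s) (hcard : Multiset.card s = 4)
    (hpf : ∀ a ∈ s, ∀ b ∈ s.erase a, a + b ≠ 0) (hodd : ∀ w ∈ s, w.val % 2 = 1) (hex : ∃ w ∈ s, (crt h w).2 ≠ 0) :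
    ∃ x : ZMod (12 * p), s = {x, x + D12, x + 2 * D12, -(3 * x)} := by
  classical
  haveI := Fact.mk hp
  have hp0 := hp.pos
  have h5 : 5 ≤ p := by omega
  haveI : NeZero (6 * p) := ⟨by omega⟩
  have hnm : 6 * p ∣ 12 * p := ⟨2, by ring⟩
  have hT := isHodgeMultiset_transfer_twelvePrime hp0 hnm (so := s) (se := 0) hodd (by simp) (by simpa using hs)
  simp only [Multiset.map_zero, add_zero] at hT
  have hc4 : Multiset.card (s.map (ZMod.castHom hnm (ZMod (6 * p)))) = 4 := by rw [Multiset.card_map, hcard]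
  have hRel := (rels_of_isHodgeMultiset h hp h17 hs).odd
  have hRodd : ∀ a ∈ s.map (ZMod.castHom hnm (ZMod (6 * p))), a.val % 2 = 1 := by
    intro a ha
    obtain ⟨w, hw, rfl⟩ := Multiset.mem_map.mp ha
    rw [val_castHom_mod_two hnm, hodd w hw]
  have P12 : (12 : ZMod (12 * p)) * (p : ZMod (12 * p)) = 0 := by
    have : (((12 * p : ℕ)) : ZMod (12 * p)) = 0 := ZMod.natCast_self _
    push_cast at this; exact this
  have hE : E12 = 2 * (p : ZMod (12 * p)) := by push_cast; ring
  have hD : D12 = 4 * (p : ZMod (12 * p)) := by push_cast; ring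
  have hK : K12 = 6 * (p : ZMod (12 * p)) := by push_cast; ring
  by_cases hpair : ∀ a ∈ s.map (ZMod.castHom hnm (ZMod (6 * p))),
      ∀ b ∈ (s.map (ZMod.castHom hnm (ZMod (6 * p)))).erase a, a + b ≠ 0
  · obtain ⟨y, hy⟩ := classify_hodgeMultiset_sixPrime hp h17 hT hc4 hpair
    rcases hy with e | e | e
    · exfalso
      have := hRodd (-(2 * y)) (by rw [e]; simp)
      rw [val_neg_mod_two_six, val_two_mul_mod_two_six] at this
      omega
    · exfalso
      have := hRodd (-(4 * y)) (by rw [e]; simp)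
      rw [val_neg_mod_two_six, show (4 : ZMod (6 * p)) * y = 2 * (2 * y) by ring, val_two_mul_mod_two_six] at this
      omega
    · -- `s̄ = C_y`: pull the four members back
      simp only [Multiset.insert_eq_cons] at e
      obtain ⟨x₁, s₁, hs₁, hx₁, e₁⟩ := exists_cons_of_map_eq_cons (ZMod.castHom hnm (ZMod (6 * p))) e
      obtain ⟨x₂, s₂, hs₂, hx₂, e₂⟩ := exists_cons_of_map_eq_cons (ZMod.castHom hnm (ZMod (6 * p))) e₁
      obtain ⟨x₃, s₃, hs₃, hx₃, e₃⟩ := exists_cons_of_map_eq_cons (ZMod.castHom hnm (ZMod (6 * p))) e₂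
      rw [← Multiset.cons_zero] at e₃
      obtain ⟨x₄, s₄, hs₄, hx₄, e₄⟩ := exists_cons_of_map_eq_cons (ZMod.castHom hnm (ZMod (6 * p))) e₃
      have hs₄0 : s₄ = 0 := Multiset.map_eq_zero.mp e₄
      have hsx : s = {x₁, x₂, x₃, x₄} := by rw [hs₁, hs₂, hs₃, hs₄, hs₄0]; rfl
      have hRE : ZMod.castHom hnm (ZMod (6 * p)) E12 = D6 := map_natCast _ (2 * p)
      have h₂ := lift_eq hp0 hnm (a := x₂) (b := x₁ + E12) (by rw [_root_.map_add, hx₁, hRE, hx₂])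
      have h₃ := lift_eq hp0 hnm (a := x₃) (b := x₁ + 2 * E12) (by rw [_root_.map_add, _root_.map_mul, map_ofNat, hx₁, hRE, hx₃])
      have h₄ := lift_eq hp0 hnm (a := x₄) (b := -(3 * x₁)) (by rw [_root_.map_neg, _root_.map_mul, map_ofNat, hx₁, hx₄])
      have hsum := hs.1.2
      rw [hsx] at hsum
      simp only [Multiset.insert_eq_cons, Multiset.sum_cons, Multiset.sum_singleton] at hsum
      -- the four lifts with `Σ = 0`: `γ` or `δ`
      have hγδ : s = {x₁, x₁ + D12, x₁ + 2 * D12, -(3 * x₁)} ∨ ∃ v ∈ s, s = {v, v + E12, v - E12, -(3 * v)} := by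
        rcases h₂ with rfl | rfl <;> rcases h₃ with rfl | rfl <;> rcases h₄ with rfl | rfl
        · exfalso; apply K_ne_zero (p := p) hp0
          simp only [hE, hK] at hsum ⊢; linear_combination hsum
        · refine Or.inr ⟨x₁ + E12, by rw [hsx]; simp, ?_⟩
          rw [hsx, show x₁ + E12 + E12 = x₁ + 2 * E12 by ring, show x₁ + E12 - E12 = x₁ by ring,
            show -(3 * (x₁ + E12)) = -(3 * x₁) + K12 by simp only [hE, hK]; linear_combination -P12]
          simp only [Multiset.insert_eq_cons, ← Multiset.singleton_add]; abel
        · refine Or.inr ⟨x₁, by rw [hsx]; simp, ?_⟩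
          rw [hsx, show x₁ + 2 * E12 + K12 = x₁ - E12 by simp only [hE, hK]; linear_combination P12]
        · exfalso; apply K_ne_zero (p := p) hp0
          simp only [hE, hK] at hsum ⊢; linear_combination hsum - P12
        · left
          rw [hsx, show x₁ + E12 + K12 = x₁ + 2 * D12 by simp only [hE, hK, hD]; ring,
            show x₁ + 2 * E12 = x₁ + D12 by simp only [hE, hD]; ring]
          simp only [Multiset.insert_eq_cons, ← Multiset.singleton_add]; abel
        · exfalso; apply K_ne_zero (p := p) hp0
          simp only [hE, hK] at hsum ⊢; linear_combination hsum - P12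
        · exfalso; apply K_ne_zero (p := p) hp0
          simp only [hE, hK] at hsum ⊢; linear_combination hsum - P12
        · refine Or.inr ⟨x₁ + 2 * E12 + K12, by rw [hsx]; simp, ?_⟩
          rw [hsx, show x₁ + 2 * E12 + K12 + E12 = x₁ by simp only [hE, hK]; linear_combination P12,
            show x₁ + 2 * E12 + K12 - E12 = x₁ + E12 + K12 by ring,
            show -(3 * (x₁ + 2 * E12 + K12)) = -(3 * x₁) + K12 by simp only [hE, hK]; linear_combination (-3) * P12]
          simp only [Multiset.insert_eq_cons, ← Multiset.singleton_add]; abel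
      rcases hγδ with e' | ⟨v, hv, e'⟩
      · exact ⟨x₁, e'⟩
      · exfalso
        obtain ⟨e₀, c, rfl⟩ : ∃ e₀ c, v = pt h e₀ c := ⟨_, _, (pt_crt h v).symm⟩
        have hc : c ≠ 0 := by
          intro hc0
          subst hc0
          obtain ⟨w, hw, hw0⟩ := hex
          apply hw0
          rw [e'] at hw
          have hE2 : (crt h E12).2 = 0 := by rw [natCast_mul_P h 2, crt_pt]
          simp only [Multiset.insert_eq_cons, Multiset.mem_cons, Multiset.mem_singleton] at hw
          rcases hw with rfl | rfl | rfl | rfl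
          · simp only [crt_pt]
          · simp only [_root_.map_add, Prod.snd_add, crt_pt, hE2, add_zero]
          · simp only [_root_.map_sub, Prod.snd_sub, crt_pt, hE2, sub_zero]
          · simp only [_root_.map_neg, _root_.map_mul, map_ofNat, Prod.snd_neg, Prod.snd_mul, Prod.snd_ofNat, crt_pt, mul_zero, neg_zero]
        have he₀ : e₀.val % 2 = 1 := by rw [← val_pt_mod_two h e₀ c]; exact hodd _ hv
        refine delta_not_rels hp h17 he₀ hc ?_
        rw [e', map_crt_delta] at hRel
        exact hRel
  · -- `s̄` has a pair: `s = {u₁, 6p − u₁, u₃, 6p − u₃}`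
    push Not at hpair
    exfalso
    obtain ⟨a, ha, b, hb, hab⟩ := hpair
    obtain ⟨u₁, hu₁, rfl⟩ := Multiset.mem_map.mp ha
    rw [← Multiset.map_erase_of_mem _ _ hu₁] at hb
    obtain ⟨u₂, hu₂, rfl⟩ := Multiset.mem_map.mp hb
    have hK0 : ZMod.castHom hnm (ZMod (6 * p)) K12 = 0 := by rw [map_natCast, ZMod.natCast_self]
    rcases lift_eq hp0 hnm (a := u₂) (b := -u₁) (by rw [_root_.map_neg]; linear_combination hab) with e2 | e2
    · exact hpf u₁ hu₁ u₂ hu₂ (by rw [e2, add_neg_cancel])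
    -- the other two members
    obtain ⟨t, ht⟩ : ∃ t, s = u₁ ::ₘ u₂ ::ₘ t := by
      obtain ⟨t, ht⟩ := Multiset.exists_cons_of_mem hu₂
      exact ⟨t, by rw [← Multiset.cons_erase hu₁, ht]⟩
    have hct : Multiset.card t = 2 := by
      rw [ht, Multiset.card_cons, Multiset.card_cons] at hcard; omega
    obtain ⟨u₃, u₄, rfl⟩ := Multiset.card_eq_two.mp hct
    have hu₃ : u₃ ∈ s := by rw [ht]; simp
    have hu₄ : u₄ ∈ s.erase u₃ := by
      rw [ht, show u₁ ::ₘ u₂ ::ₘ ({u₃, u₄} : Multiset (ZMod (12 * p))) = u₃ ::ₘ u₁ ::ₘ u₂ ::ₘ {u₄} by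
        simp only [Multiset.insert_eq_cons, ← Multiset.singleton_add]; abel, Multiset.erase_cons_head]
      simp
    have hτ : IsHodgeMultiset ({ZMod.castHom hnm (ZMod (6 * p)) u₃, ZMod.castHom hnm (ZMod (6 * p)) u₄} :
        Multiset (ZMod (6 * p))) := by
      have e3 : s.map (ZMod.castHom hnm (ZMod (6 * p))) = ZMod.castHom hnm (ZMod (6 * p)) u₁ ::ₘ
          (-ZMod.castHom hnm (ZMod (6 * p)) u₁) ::ₘ {ZMod.castHom hnm (ZMod (6 * p)) u₃, ZMod.castHom hnm (ZMod (6 * p)) u₄} := by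
        rw [ht]
        simp only [Multiset.map_cons, Multiset.insert_eq_cons, Multiset.map_singleton, e2, _root_.map_add, _root_.map_neg, hK0, add_zero]
      rw [e3] at hT
      exact isHodgeMultiset_of_cons_cons_neg hT
    have e4 := eq_neg_of_isHodgeMultiset_pair hτ
    rcases lift_eq hp0 hnm (a := u₄) (b := -u₃) (by rw [_root_.map_neg]; exact e4) with e5 | e5
    · exact hpf u₃ hu₃ u₄ hu₄ (by rw [e5, add_neg_cancel])
    -- order the two half-pairs so that the first is off the fibre `0`
    have hsw : s = {u₁, -u₁ + K12, u₃, -u₃ + K12} := by rw [ht, e2, e5]; rfl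
    have hord : ∃ v₁ v₃ : ZMod (12 * p), (crt h v₁).2 ≠ 0 ∧ s = {v₁, -v₁ + K12, v₃, -v₃ + K12} := by
      by_cases h₁ : (crt h u₁).2 ≠ 0
      · exact ⟨u₁, u₃, h₁, hsw⟩
      · push Not at h₁
        refine ⟨u₃, u₁, ?_, by rw [hsw]; simp only [Multiset.insert_eq_cons, ← Multiset.singleton_add]; abel⟩
        obtain ⟨w, hw, hw0⟩ := hex
        rw [hsw] at hw
        have hK2 : (crt h K12).2 = 0 := by rw [sixP_eq_pt h hp h5, crt_pt]
        simp only [Multiset.insert_eq_cons, Multiset.mem_cons, Multiset.mem_singleton] at hw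
        rcases hw with rfl | rfl | rfl | rfl
        · exact absurd h₁ hw0
        · exfalso; apply hw0; rw [_root_.map_add, Prod.snd_add, _root_.map_neg, Prod.snd_neg, h₁, hK2, neg_zero, add_zero]
        · exact hw0
        · intro h₃; apply hw0; rw [_root_.map_add, Prod.snd_add, _root_.map_neg, Prod.snd_neg, h₃, hK2, neg_zero, add_zero]
    obtain ⟨v₁, v₃, hc, hsv⟩ := hord
    have hv₁ : v₁ ∈ s := by rw [hsv]; simp
    have hv₃ : v₃ ∈ s.erase v₁ := by rw [hsv, Multiset.insert_eq_cons, Multiset.erase_cons_head]; simp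
    have hv₃' : -v₃ + K12 ∈ s.erase v₁ := by rw [hsv, Multiset.insert_eq_cons, Multiset.erase_cons_head]; simp
    have hv₃s : v₃ ∈ s := Multiset.mem_of_mem_erase hv₃
    obtain ⟨e₀, c, rfl⟩ : ∃ e₀ c, v₁ = pt h e₀ c := ⟨_, _, (pt_crt h v₁).symm⟩
    obtain ⟨f, c', rfl⟩ : ∃ f c', v₃ = pt h f c' := ⟨_, _, (pt_crt h v₃).symm⟩
    simp only [crt_pt] at hc
    have he₀ : e₀.val % 2 = 1 := by rw [← val_pt_mod_two h e₀ c]; exact hodd _ hv₁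
    have hf : f.val % 2 = 1 := by rw [← val_pt_mod_two h f c']; exact hodd _ hv₃s
    have hK' : ∀ (e : ZMod 12) (b : ZMod p), -(pt h e b) + K12 = pt h (6 - e) (-b) := by
      intro e b
      rw [sixP_eq_pt h hp h5, neg_pt, pt_add, add_zero, show -e + 6 = 6 - e by ring]
    have hz1 : ((f, c') : ZMod 12 × ZMod p) ≠ -(e₀, c) := by
      intro hq
      apply hpf _ hv₁ _ hv₃
      have : crt h (pt h f c') = crt h (-(pt h e₀ c)) := by rw [crt_pt, _root_.map_neg, crt_pt]; exact hq
      have := (crt h).injective this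
      rw [this, add_neg_cancel]
    have hz2 : ((6 - f, -c') : ZMod 12 × ZMod p) ≠ -(e₀, c) := by
      intro hq
      apply hpf _ hv₁ _ hv₃'
      have : crt h (-(pt h f c') + K12) = crt h (-(pt h e₀ c)) := by rw [hK', crt_pt, _root_.map_neg, crt_pt]; exact hq
      have := (crt h).injective this
      rw [this, add_neg_cancel]
    refine halfpair_odd hp h17 hRel ?_ he₀ hf hc hz1 hz2
    rw [hsv, hK', hK']
    simp only [Multiset.insert_eq_cons, Multiset.map_cons, Multiset.map_singleton, crt_pt]

/-! ### Assembly -/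

/-- **Classification of the pair-free Hodge `4`-multisets of level `12p`, `p ≥ 17` prime** (multiset form of Shioda's Prop. 4 (Q′) /
Aoki–Shioda's Theorem (𝔅²ₘ) (ii) at `m = 12p`, together with the level-`12` exceptional quadruples). A pair-free Hodge `4`-multiset
over `ℤ/12p` is `{x, x + 6p, −2x, 6p}` (type `α`, `m′ = 6p`), `{x, x + 6p, 2x + 6p, −4x}` (type `β`),
`{x, x + 4p, x + 8p, −3x}` (type `γ`, `m″ = 4p`) for some residue `x`, or `p·u·(1, 4, 9, 10)`, `p·u·(1, 6, 8, 9)` for a unit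
`u` of `ℤ/12` — the multiples `x = u p` of Meyer–Neutsch's two exceptional quadruples of level `12` (Shioda's `ε(12) = 2`).
PROOF: the relations U, III, IV (`rels_of_isHodgeMultiset`, from `KoblitzOgus.hodge_eq_combination`) and the transfer to level `6p`
(`isHodgeMultiset_transfer_twelvePrime` + `classify_hodgeMultiset_sixPrime`), by the number of odd members: `fibre_zero`,
`case_all_even`, `case_two_odd`, `case_two_odd_fibre`, `case_all_odd`.
[cite: Shioda1982PicardFermat, §4 Lemma 1 p. 728, Prop. 4 (Q′) p. 729 and table p. 727 (m = 12)]
[cite: AokiShioda1983, §2 Theorem (𝔅²ₘ) (ii) a)–c), p. 3] [cite: MeyerNeutsch1981Fermatquadrupel, Tabelle 1 p. 54 (N = 12)]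
[cite: Aoki1983, Prop. 2.2] -/
theorem classify_hodgeMultiset_twelvePrime [NeZero (12 * p)] (hp : p.Prime) (h17 : 17 ≤ p) {s : Multiset (ZMod (12 * p))}
    (hs : IsHodgeMultiset s) (hcard : Multiset.card s = 4) (hind : ∀ a ∈ s, ∀ b ∈ s.erase a, a + b ≠ 0) :
    ∃ x : ZMod (12 * p), s = {x, x + K12, -(2 * x), K12} ∨ s = {x, x + K12, 2 * x + K12, -(4 * x)} ∨
      s = {x, x + D12, x + 2 * D12, -(3 * x)} ∨
      ((∃ t : ℕ, (t = 1 ∨ t = 5 ∨ t = 7 ∨ t = 11) ∧ x = ((t * p : ℕ) : ZMod (12 * p))) ∧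
        (s = {x, 4 * x, 9 * x, 10 * x} ∨ s = {x, 6 * x, 8 * x, 9 * x})) := by
  classical
  have h5 : 5 ≤ p := by omega
  have h := coprime_twelve hp h5
  -- the fibre `0`
  by_cases hex : ∃ w ∈ s, (crt h w).2 ≠ 0
  swap
  · push Not at hex
    exact fibre_zero h hp h17 hs hcard hind hex
  -- split by parity
  set so := s.filter fun w ↦ w.val % 2 = 1 with hso
  set se := s.filter fun w ↦ ¬ w.val % 2 = 1 with hse
  have hsplit : s = so + se := (Multiset.filter_add_not _ s).symm
  have hcs : Multiset.card so + Multiset.card se = 4 := by rw [← Multiset.card_add, ← hsplit, hcard]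
  have heven : Even (Multiset.card so) := even_card_filter_odd hs.1.2
  have hso1 : ∀ v ∈ so, v.val % 2 = 1 := fun v hv ↦ (Multiset.mem_filter.mp hv).2
  have hse0 : ∀ v ∈ se, v.val % 2 = 0 := fun v hv ↦ by have := (Multiset.mem_filter.mp hv).2; omega
  obtain ⟨k, hk⟩ := heven
  have hk2 : k ≤ 2 := by omega
  interval_cases k
  · -- no odd member
    have h0 : so = 0 := Multiset.card_eq_zero.mp (by omega)
    rw [h0, zero_add] at hsplit
    obtain ⟨x, hx⟩ := case_all_even hp h17 hs hcard hind fun v hv ↦ hse0 v (hsplit ▸ hv)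
    refine ⟨x, ?_⟩
    rcases hx with hx | hx | hx
    · exact Or.inl hx
    · exact Or.inr (Or.inl hx)
    · exact Or.inr (Or.inr (Or.inl hx))
  · -- two odd members
    have h2 : Multiset.card so = 2 := by omega
    have h2' : Multiset.card se = 2 := by omega
    obtain ⟨x, y, hxy⟩ := Multiset.card_eq_two.mp h2
    obtain ⟨z, w, hzw⟩ := Multiset.card_eq_two.mp h2'
    have hx1 : x.val % 2 = 1 := hso1 x (by rw [hxy]; simp)
    have hy1 : y.val % 2 = 1 := hso1 y (by rw [hxy]; simp)
    have hz0 : z.val % 2 = 0 := hse0 z (by rw [hzw]; simp)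
    have hw0 : w.val % 2 = 0 := hse0 w (by rw [hzw]; simp)
    have hsx : s = {x, y, z, w} := by rw [hsplit, hxy, hzw, pair_add_pair]
    by_cases hxc : (crt h x).2 ≠ 0
    · rcases case_two_odd h hp h17 hs hind hsx hx1 hz0 hw0 hxc with e | e
      · exact ⟨x, Or.inl e⟩
      · exact ⟨x, Or.inr (Or.inl e)⟩
    by_cases hyc : (crt h y).2 ≠ 0
    · have hsy : s = {y, x, z, w} := by
        rw [hsx]; simp only [Multiset.insert_eq_cons]; exact Multiset.cons_swap x y _
      rcases case_two_odd h hp h17 hs hind hsy hy1 hz0 hw0 hyc with e | e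
      · exact ⟨y, Or.inl e⟩
      · exact ⟨y, Or.inr (Or.inl e)⟩
    push Not at hxc hyc
    exfalso
    by_cases hzc : (crt h z).2 ≠ 0
    · exact case_two_odd_fibre h hp h17 hs hind hsx hx1 hy1 hz0 hw0 hxc hyc hzc
    push Not at hzc
    have hwc : (crt h w).2 ≠ 0 := by
      obtain ⟨v, hv, hvc⟩ := hex
      rw [hsx] at hv
      simp only [Multiset.insert_eq_cons, Multiset.mem_cons, Multiset.mem_singleton] at hv
      rcases hv with rfl | rfl | rfl | rfl
      · exact absurd hxc hvc
      · exact absurd hyc hvc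
      · exact absurd hzc hvc
      · exact hvc
    have hsw : s = {x, y, w, z} := by rw [hsx, Multiset.pair_comm z w]
    exact case_two_odd_fibre h hp h17 hs hind hsw hx1 hy1 hw0 hz0 hxc hyc hwc
  · -- four odd members
    have h0 : se = 0 := Multiset.card_eq_zero.mp (by omega)
    rw [h0, add_zero] at hsplit
    obtain ⟨x, hx⟩ := case_all_odd h hp h17 hs hcard hind (fun v hv ↦ hso1 v (hsplit ▸ hv)) hex
    exact ⟨x, Or.inr (Or.inr (Or.inl hx))⟩

end TwelvePrime

end Literature.AlgebraicGeometry.Shioda1982
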